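import Literature.MathematicalPhysics.QuantumFieldTheory.Balaban1983to89.Beta.ConstRemainderConsumers
import Literature.MathematicalPhysics.QuantumFieldTheory.Balaban1983to89.Beta.ComposedRoad

/-!
# `Balaban1983to89.Beta.AveragedAFCarrier` — the SLOPE-CARRYING END-grade carrier `BetaAvgAFH s D γ β` (history-level
averaged asymptotic freedom): GLOSS 3′ in the kernel on the [III] side, the (R11)/(R10-1′) wall END TO END on BOTH sides,
and two sharpness witnesses (cell `pub-balaban`, unit `b2b-balaban-strat-b14` = β sub-cell CO-LEAD, [III] side; node T11.F;
companion of `Beta.ConstRemainderConsumers`, `Beta.ComposedRoad`, `Beta.FlowConsumers`, `Beta.Assembly`)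

HONEST FRAMING (cell rule, verbatim, page 1 of everything): discharging `BetaPertH` makes Bałaban's UV stability
UNCONDITIONAL — a real constructive-QFT result; it is NOT the continuum limit and NOT the Clay problem.  (Gloss 1,
BETA-SPEC v1.8d/v1.9b l. 17–18, GAPS G-ref2-14 (a) / G-ref2-20 (a) / G-ref2-23 (a), verbatim: «UNCONDITIONAL» in
[Balaban1989LargeFieldII] (B16) p. 355's interval-hypothesis sense ONLY (`FlowStepRuns.p355Unconditional_of_partialSums`
keeps `hnodes`); the located leaves G-adv3-2 (left inequality of (0.1)/(2.50), d = 4), G-adv3-1 (U2 transfer of B14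
Cor. 3's lower bound) and `SecondExpLeaf` REMAIN.  Gloss 2, BETA-SPEC v1.9e, referee row C-beta-78, BINDING:
«UNCONDITIONAL» = `Beta.Assembly.EventualForm`-unconditional — the END statement with the interval hypothesis removed,
(0.31) in DEFECTED form on all lattices, admissible couplings shrunk to `g ≤ g⋆`; NOT «[Balaban1987RG1] Theorem 2 as
printed»; never the continuum limit / mass gap / Clay.  Gloss 3″, BETA-SPEC v1.9r §7.20 (c) (= the PROPOSED Gloss 3′ of
v1.9p §7.18 (c) + referee row R194 amendments A1–A3), BINDING from 2026-08-19T01:02Z: on the primary road «unconditional» = the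
interval hypothesis of [Balaban1987RG1] Thm 2 p. 259 REPLACED by the (R10-1′) partial-sums carrier
`Drift.OneLoopDrift (stepBal N L) A β⁰ ∧ (−r ≤ β¹, r < stepBal N L)`; END statements UNDER THE EXPLICIT γ-SMALLNESS RESTRICTIONS
(`2Aγ² ≤ β₀(2+β₀)`, `2Aγ² ≤ 1/2`, `(√2)^{κ₀−6}(2γ⁴/(stepBal − r) + γ⁶) < 1`): p. 355 (hnodes kept) / `EndpointExistence` and
(2.6)–(2.9) ∧ (2.46) along runs; the END STATEMENTS (not the split carrier) are also implied by Gloss 2's `EventualForm` grade;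
hypothetical on the wall's binders; a partial-sums carrier, no sign of any single `β_{k+1}`; never «Theorem 2 as printed», never
continuum / mass gap / Clay.)  THIS MODULE DISCHARGES NOTHING: every theorem is bookkeeping
over real sequences and over the cell's hypothesis carriers (`FlowStep.HBeta`, `Flow`, `B12.Construction`,
`B12Beta.OneLoopSplit`, `Beta.Drift.OneLoopDrift`, `Beta.RemainderChain.RemainderConst`/`Chain`, `Beta.Assembly.EventualForm`,
`B14DeltaBeta.CondSmallFC`, the k = 0 window data of `Beta.ComposedRoad`); nothing about Bałaban's β-functions (1.22), their
one-loop parts, window legs or 𝐑-terms is asserted.  ABSOLUTE RULE (cell rule, verbatim): "No internally-minted statement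
may enter as a cited fact. Every hypothesis is either kernel-proved in this package or a verbatim quotation of a PUBLISHED
theorem with page reference. The manuscript(s) under audit are NOT citable for their own disputed steps — they are the
thing under adjudication; programme-internal (2001/route/tribunal) claims are never citable."  Accordingly every β-input
below is a HYPOTHESIS BINDER; the `[cite: …]` tags point at the printed display a theorem CONCLUDES or at the printed
CONTEXT of a binder, never at a proof of it.

CITATION HEADER (lean-in-tree rule).  T. Bałaban, *Convergent renormalization expansions for lattice gauge theories*,
Commun. Math. Phys. **119**, 243–285 (1988) [Balaban1988Convergent] = [III] (cell paper B14; journal page = PDF page +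
242; renders `HOME/b2b-balaban-ref1/pages/1988-cmp119-convergent-renormalization-p013-x2.png`, `…-p021-x2.png` READ as
images by this lineage), p. 255 [13], after (2.6): *"where n > m, and β₀ > 0 can be chosen arbitrarily small, if g is
sufficiently small. The inequalities follow from the renormalization group equations (0.20) [I], and from the
properties of the β-functions."*; p. 263 [21], (2.46) with *"for κ₀ ≥ 7 and g sufficiently small"* — typed in
`B14.lean` / `B14FlowStep.lean` (`B14.FlowIneq26`–`28`, `B14FlowStep.FlowIneq29`, `B14FlowStep.SumIneq246`), bundled as
`B14DeltaBeta.HorizonFacts`.  T. Bałaban, *Renormalization group approach to lattice gauge field theories. I*, Commun. Math.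
Phys. **109**, 249–301 (1987) [Balaban1987RG1] = [I] (B12; journal page = PDF page + 248; render `…-p011-x2.png` read by
this lineage), Theorem 2 p. 259 [11], first sentence, verbatim: *"Let d = 4, G = SU(2), and let γ be a sufficiently small
positive constant, then for a sufficiently small positive g there exists a bare coupling constant g₀ = g₀(ε, g) such that
the sequence of the effective coupling constants g_k is contained in the interval ]0, γ], and g_K = g."* (typed by the
carver as `DagBinding.EndpointExistence`; *"A proof of this theorem, based on perturbative calculations, will be given in
a separate paper"* — UNPRINTED, under adjudication, never a `theorem` here); the split `β_{k+1} = β⁰_{k+1} + β¹_{k+1}` with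
`β¹_{k+1}(…,0) = 0` is read off (2.13)–(2.15) p. 268 per `B12Beta.OneLoopSplit` (p. 268 prints (2.13), the vanishing remark,
(2.14) and (2.15) — no split display; referee record C-adv2-43 R1); «uniformly bounded on this interval» p. 264
(`FlowStep.BetaUpperH`).  T. Bałaban, *Large field renormalization. II*, Commun. Math. Phys. **122**, 355–392 (1989)
[Balaban1989LargeFieldII] (B16; p. 355 reading through `FlowStepRuns` §8).  WHAT IS REPRODUCED: nothing of either paper is
re-proved or newly quoted; the module names ONE hypothesis shape and records, at statement level, what it buys and where it
comes from.

WHY THIS MODULE (RULING (R10-1′) + GLOSS 3′, BETA-SPEC v1.9p §7.18 (b)/(c), 2026-08-19T00:41Z — blessed with amendments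
A1–A3 by referee row R194 (00:54Z) and made BINDING as GLOSS 3″ in v1.9r §7.20 (c) (01:02Z) while this module was in flight;
this lineage's NOTE 00:32:25Z «name the slope-carrying carrier if Gloss 3 is to cover (2.46)»).  `gloss3'_END_of_driftConst`
below carries EXACTLY A2's restriction list; `gloss2_END_via_carrier` and the `Osc` witnesses are A1 in the kernel (the END
statements are implied by Gloss 2 — through `BetaAvgAFH` —, the split carrier is not comparable: it admits families with no
`EventualForm`).  The declaration names keep the «gloss3'» spelling of the proposal.  The END grade named by Gloss 3 / (R10-1),
`FlowStepRuns.BetaPartialSumsLowerH M γ β` (window sums `≥ −M` along `]0,γ]`-histories), buys p. 355 + `EndpointExistence` +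
(2.6)–(2.9) but NOT consumer C8 = (2.46) (`ConstRemainderConsumers.Margin.sum246_fails`).  Gloss 3′ therefore names a CARRIER
(drift + one-sided constant remainder, `r < stepBal` strictly) rather than an END grade.  THIS MODULE names the END grade
WITH SLOPE through which every road of the sub-cell and every located consumer factor:
  `BetaAvgAFH s D γ β :⟺ ∀ ]0,γ]-histories g, ∀ k ≤ n, s·(n − k) − D ≤ Σ_{j∈[k,n)} β_j(g_0,…,g_j)`
(history-level averaged asymptotic freedom, slope `s`, defect `D`; `s = 0` ⟺ `BetaPartialSumsLowerH D γ β`), and proves: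
§1  API: `zero_iff` (slope 0 = the Gloss-3 END grade), `partialSums` (`s ≥ 0` ⟹ END grade), monotonicity, `defect_nonneg`,
    the finite-horizon form `onHorizon` (exactly the hypothesis shape of `ConstRemainderConsumers` §3) and the run-wise form
    `along` (exactly the hypothesis shape of `B14FlowStep.flowControl_of_avgAF`).
§2  SOURCES, by name: pointwise `BetaLowerH b` ⟹ `(b, 0)` [(AF-0s) grade]; eventual pointwise lower bound + printed lower
    half ⟹ `(b, (b+β′)k₀)`, in particular `EventualForm E` ⟹ `(E.b, (E.b+E.β′)E.k₀)` [Gloss 2 grade]; the (R10-1′) carrier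
    `OneLoopSplit` + `OneLoopDrift b A β⁰` + `−r ≤ β¹` on `]0,γ]`-histories ⟹ `(b − r, 2A)` [Gloss 3′ grade;
    = `DriftRemainder.sum_Ico_beta_ge_of_drift_oneSided`], with the two-sided `RemainderConst` and row an4's printed `Chain`
    as instances; AND THE LEAD'S WALL SOCKETS (`ComposedRoad` §5/§7/§8 drift producers) + `RemainderConst rr`
    ⟹ `BetaAvgAFH (stepBal N Lc − rr) (2A′) γ₀ β`.
§3  CONSUMERS, by name: `s ≥ 0` ⟹ `EndpointExistence` (`FlowStepRuns.endpointExistence_of_partialSums`), the p. 355 reading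
    (`p355Unconditional_of_partialSums`, `hnodes` kept — Gloss 1), (2.6)–(2.9) along in-interval runs
    (`ConstRemainderConsumers.flowIneq_along_of_partialSums`); `s > 0` ⟹ `HorizonFacts` = (2.6)–(2.9) ∧ (2.46) along runs
    (`B14FlowStep.flowControl_of_avgAF`), sizes produced, (2.46) alone, the World-level bundle, and the reading-(α) clamp trick
    of census item C14 (`ConstRemainderConsumers.endpoint_and_flowControl_of_condSmallH_avgAF` takes `onHorizon` verbatim).
§4  GLOSS 3′ AS ONE THEOREM (`gloss3'_END_of_driftConst`): the (R10-1′) carrier ⟹ `EndpointExistence` ∧ the [III] list along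
    every in-interval run below one threshold; and THE WALL END TO END ON BOTH SIDES
    (`wallEND_of_composedLegInterfacePow_identity_remainderConst`, print's-shape variant `…Pow_remainderConst`): the (R11) wall
    declaration's hypotheses (`ComposedRoad.oneLoopDrift_of_composedLegInterfacePow_identity`) + `RemainderConst rr` with
    `rr < stepBal N Lc` STRICTLY + continuity + printed-type upper bound ⟹ `EndpointExistence` ∧ `HorizonFacts` along runs —
    the [III]-side twin that the lead's `endpointExistence_of_composedLegInterfacePow_identity_remainderConst` (`rr ≤ stepBal`)
    lacks.
§5  HONESTY WITNESSES.  (a) SLOPE NEEDED: the margin family `ConstRemainderConsumers.Margin.betaM b γ` is `BetaAvgAFH 0 0 γ` but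
    `BetaAvgAFH s D γ` for NO `s > 0` (`Margin.not_avgAFH_pos`) — consumer C8 fails exactly at slope 0 (`Margin.sum246_fails`).
    (b) A CARRIER OF PARTIAL SUMS: the history-free oscillating family `Osc.betaO s c`, `β_{k+1} = s + c(−1)^k` with `0 < s < c`,
    is a LITERAL (R10-1′) carrier (`Osc.splitO`: one-loop part `s + c(−1)^k` with `OneLoopDrift s c`, remainder `≡ 0`, `r = 0 < s`),
    hence `BetaAvgAFH s c γ` for every `γ`, continuous, two-sidedly bounded by `s + c`, yet `β_{k+1} < 0` on EVERY box of odd scale: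
    it is NOT of (AF-0s)/«Theorem 2 as printed» grade and admits NO `EventualForm` (`Osc.not_eventualForm`: no eventual pointwise
    `b > 0`), while §3 serves it every located consumer.  So: Gloss 2's `EventualForm` grade ⟹ `BetaAvgAFH` ⟸ Gloss 3′'s literal
    carrier, the literal carrier admits families OUTSIDE Gloss 2 (`Osc.literal_carrier_outside_gloss2`), and all three serve the
    SAME located consumers C1–C8, C11–C15 of MISSING-B14 §8 — kernel.  (Whether every `EventualForm` family is a literal (R10-1′)
    carrier is a structural question about (2.14)'s split, asked by no consumer — DECIDED NEGATIVELY in §5(c), v1.2: `NoSplit.*`.)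
§6  (v1.3) INHABITED WITNESSES: the §5 families generate honest constructions (`FlowStepRuns.modelOf`) — endpoint existence AND the
    [III] list along the runs of a sign-indefinite carrier's construction (`Osc.inhabited`, `Osc.inhabited_runs`); endpoint existence
    WITHOUT (2.46) along a run of the margin construction (`Margin.slope_zero_not_enough_inhabited`); referee record R-g26-1.
§7  (v1.4) THE (R13-3) BASE-POINT-AVERAGED WALL SOCKET (`ComposedRoad` §10) on the [III] side: carrier
    (`betaAvgAFH_of_composedLegInterfacePow_identity_avg_remainderConst`), END TO END BOTH SIDES
    (`wallEND_of_composedLegInterfacePow_identity_avg_remainderConst`), and the ONE-POINT INSTANCE recovering §2′'s carrier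
    (`betaAvgAFH_of_composedLegInterfacePow_identity_remainderConst_via_avg`).
§8  (v1.4) THE THRESHOLD EXISTS (`exists_threshold`): for every defect `D ≥ 0`, slope `s > 0`, `β′ ≥ 0`, `0 < β₀ ≤ 1`, `Lβ₀ ≤ 1`,
    `L ≥ 2`, `p`, `κ₀` ONE `γ₁ > 0` meets all four γ-hypotheses of the END theorems; hence the END statements with NO numeric
    smallness hypothesis, conclusion «∃ γ₁ > 0, …» = print's «if g is sufficiently small» / «γ depends on all other constants»
    (`BetaAvgAFH.endpoint_and_flowControl_smallCoupling`, `wallEND_of_composedLegInterfacePow_identity_avg_remainderConst_smallCoupling`).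
§9  (v1.5) AT PRINT'S BLOCK SIZE: `SmallnessFor` inhabited at `L = 13` (`smallnessFor_printL13`), NOT at print's example pair
    `(13, 1/7)` (`not_smallnessFor_13_7` — the `β₀ ≤ 1/L` divergence of convenience, D-sb14.2a), and the §6 inhabited witnesses at
    EVERY admissible `(L, β₀)` in the «∃ γ₁» shape (`Osc.inhabited_smallCoupling`, `Osc.inhabited_printL13`).
§10 (v1.6) EVERY `β₀ > 0`: the [III] list `HorizonFacts` is MONOTONE in `β₀` (`horizonFacts_mono_beta0`), so the «∃ γ₁» END statements hold
    with the hypotheses `β₀ ≤ 1`, `L·β₀ ≤ 1` REMOVED (`BetaAvgAFH.endpoint_and_flowControl_anyBeta0`,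
    `wallEND_of_composedLegInterfacePow_identity_avg_remainderConst_anyBeta0`); print's example pair `(13, 1/7)` is SERVED by the END statement
    (`Osc.inhabited_anyBeta0`, `Osc.inhabited_print_13_7`) — D-sb14.2a leaves the END-statement grade.
§11 (v1.7) ONE THRESHOLD FOR ALL PROFILES: `SmallnessFor` is ANTITONE in the exponent (`smallnessFor_of_exponent_le`), so ONE `γ₁` chosen
    for a maximal exponent `p` serves, along every run, EVERY exponent `p′ ≤ p` and EVERY amplitude `A₀ ≥ 0` at once — p. 256 «Similar
    inequalities hold for other constants» ((2.28) `α_{0,j}`, `α_{1,j}`; the radii's `r`; `ε_j`'s `(A₀, p₀)`) under a single «g sufficiently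
    small» (`BetaAvgAFH.endpoint_and_flowControl_allProfiles`, `wallEND_of_composedLegInterfacePow_identity_avg_remainderConst_allProfiles`,
    `Osc.inhabited_allProfiles`); ROAD (2) ADAPTER `BetaAvgAFH.t4FlowInputs` — the MIXED-exponent flow-fact binders of the T⁴ cell's
    `T4ScalePairing.kappa_mul_R_le_p0Profile` ((2.7) at `p₀`, radii at `r ≤ p₀`, `1 ≤ log g_s⁻²`) and `T4UniformRadius` ((2.9)) produced
    along every run below one threshold (census C19/C20).
§12 (v1.8) THE SAME AT THE BARE END GRADE (slope `s ≥ 0`): (2.6)–(2.9) for all profiles and every `β₀ > 0` below one threshold from the carrier with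
    `s ≥ 0` — equivalently from the Gloss-3 END grade `BetaPartialSumsLowerH` — with NO (2.46) (`BetaAvgAFH.flowIneq_allProfiles`), and the road-(2)
    adapter at that grade (`BetaAvgAFH.t4FlowInputs_of_nonneg`, `t4FlowInputs_of_partialSums`): census rows C19/C20 are «slope ≥ 0» rows like C1–C7.
§13 (v1.8) THE ACCELERATION LANES ON THE [III] SIDE (RULING (R15), BETA-SPEC §7.30; §5.19): the asymptotic lane's output = an
    `Assembly.LimitForm` ⟹ the carrier with slope `β⁰_∞/2` (`betaAvgAFH_of_limitForm`, Gloss 2 via `LimitForm.toEventual`) ⟹ EVERY located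
    consumer, all profiles, every β₀ (`limitForm_END_allProfiles`, `limitForm_t4FlowInputs`); the computer-assisted lane's certified finite list
    on top ⟹ the SAME carrier with DEFECT ZERO (`betaAvgAFH_of_limitForm_list`, (AF-0s) grade) — on the [III]/T⁴ consumer side the list buys
    exactly the defect (literal (0.31) anchors, `Thm2Printed`), nothing else.
CONSEQUENCE FOR THE CENSUS (MISSING-B14 §8/§9): Table 9.1's four carried forms and the (R10-1′)/(R11) wall all factor through
`BetaAvgAFH`; the [III] side needs `s > 0` for C8/C13 only and `s ≥ 0` for everything else; the sub-cell's wall (the window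
inputs for Bałaban's objects, BETA-SPEC §7.18 (a)) is untouched.  NOT CLAIMED: that Bałaban's β has averaged asymptotic
freedom in any sense — `BetaAvgAFH` is a binder; nothing of (AF-0)/(M2⁺).

v1.1 (same unit and generation; DOCSTRING-ONLY over v1 p181865 — every declaration byte-unchanged): the honest-framing paragraph
and this section updated from «Gloss 3′ PROPOSED» to «Gloss 3″ BINDING» (BETA-SPEC v1.9r §7.20 (c), referee row R194 A1–A3).
v1.2 (same unit and generation; APPEND-ONLY over v1.1 p181895 — every v1.1 declaration byte-unchanged, no new import): §5(c) `NoSplit.*` — the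
converse direction of R194 (A1) in the kernel: a Gloss-2 (`EventualForm`) family admitting NO `B12Beta.OneLoopSplit` at all (`β_{k+1} = b + c·g_0`: (2.14)'s
history-independence at zero coupling fails), so Gloss 2 ⇏ the literal (R10-1′) carrier; with `Osc`: the two carriers are INCOMPARABLE and meet only in
`BetaAvgAFH` (decides the question left open in v1's §5(b) note).
v1.3 (same unit, gen 12; APPEND-ONLY over v1.2 p181950 — every v1.2 declaration byte-unchanged, no new import; two docstring wordings: the
citation header's split sentence now «read off (2.13)–(2.15)» (referee record C-adv2-43 R1) and §5(b)'s `Osc.endpointExistence_example` labelled a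
SHAPE check (R-g26-1)): §6 INHABITED WITNESSES — the §5 families fed to `FlowStepRuns.modelOf` (the construction canonically generated by a
β-family, `ForwardGenerated ∧ HaltsOutside ∧ CurriesHBeta` for every β): (a) `Osc.inhabited` — an honest construction generated by a family with NO
pointwise positive lower bound on any box, NO `EventualForm`, negative realised β at every odd scale, which HAS endpoint existence and satisfies
sizes + the whole [III] list (2.6)–(2.9) ∧ (2.46) along every run in `]0,γ]`, `γ ≤ e^{−10}` (cell numbers `β′ = 1`, `β₀ = ½`, `L = p = 2`,
`κ₀ = 7`; threshold arithmetic `Osc.threshold_example`), runs supplied (`Osc.inhabited_runs`); (b) `Margin.slope_zero_not_enough_inhabited` —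
the margin construction HAS endpoint existence (sign and all) yet its constant run violates (2.46); (c) `NoSplit.endpoint_and_flowControl_modelOf`.
Referee record R-g26-1 («shape, not inhabitation») is thereby answered in the kernel.
v1.4 (same unit, gen 13; APPEND-ONLY over v1.3 p182178 — every v1.3 declaration byte-unchanged, no new import): §7 — the [III]-side twin of
the lead's `ComposedRoad` v1.5 §10 (BETA-SPEC §7.24 RULING (R13-3): leg data PER BASE POINT with `b`-free constants, identification binder
against a CONVEX COMBINATION of the single-base-point window sums; same conclusion, same constant): the averaged binders + `IdentityForm` +
`RemainderConst rr` ⟹ `BetaAvgAFH (stepBal N Lc − rr) (2A′) γ₀ β`; with `rr < stepBal` strictly + (C) + upper bound + ONE threshold ⟹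
`EndpointExistence` ∧ sizes ∧ `HorizonFacts` along runs (the lead's §10 END theorem states `EndpointExistence` only); and the one-point instance
(`κB = Unit`, `Bset ≡ {()}`, `wt ≡ 1`) recovering §2′'s carrier verbatim — (R13-3) changes no grade on the [III] side.  §8 — THE
THRESHOLD EXISTS: the four numeric γ-hypotheses of the END theorems are jointly satisfiable for EVERY value of the other constants
(`exists_threshold`, elementary real analysis near `0⁺`), so the END statements hold with conclusion «∃ γ₁ > 0, …» and no numeric
smallness binder (`BetaAvgAFH.endpoint_and_flowControl_smallCoupling`, `wallEND_…_avg_remainderConst_smallCoupling`) — the literal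
shape of [Balaban1988Convergent] p. 255 «if g is sufficiently small» and [Balaban1987RG1] Thm 3 p. 264 «The constant γ depends on
all other constants» (BETA-SPEC §7.20 (T) row «smallness»: arithmetic, now closed).
v1.5 (same unit and generation; APPEND-ONLY over v1.4 p182690 — every v1.4 declaration byte-unchanged, no new import): §9 AT PRINT'S BLOCK SIZE —
`smallnessFor_printL13` (the typed structure inhabited at [Balaban1987RG1] p. 251's smallest admissible `L = 13`, with `β₀ = 1/13`, the census
exponent `p = 23`, `γ = e^{−150}`), `not_smallnessFor_of_one_lt` / `not_smallnessFor_13_7` (print's example pair `(L, β₀) = (13, 1/7)` — p. 251 with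
[Balaban1989LargeFieldII] p. 389 — is NOT admitted: the typed structure's γ-free `L·β₀ ≤ 1` certifies `β₀ ≤ 1/L` where print allows `β₀ ≤ 1/2` at
γ's expense; DIVERGENCE D-sb14.2a, harmless for every located consumer), and `Osc.inhabited_smallCoupling` / `Osc.inhabited_printL13` (§6's
inhabited witnesses at EVERY admissible `(L, β₀)`, hence at `L = 13`, in §8's «∃ γ₁» shape — v1.3 had them at the cell numbers `L = p = 2` only).
v1.6 (same unit, gen 14; APPEND-ONLY over v1.5 p182807 — every v1.5 declaration byte-unchanged, no new import; one docstring locator added in §9's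
header for «β₀ ≤ 1/2»: [Balaban1989LargeFieldI] (1.52) p. 187 «the usual restrictions on β₀, β, L₀ (i.e., β₀ ≤ 1/2, …)», typed upstream as
`B15BasicStep.coeff152_lt_one` — referee advisory C-B5-48 A1): §10 EVERY `β₀ > 0` — every member of (2.6)–(2.9) carries `β₀` only through the
NONDECREASING factors `(1+β₀)` and `(1 + g_n²β′(n−m))^{β₀}` (base `≥ 1`), and (2.46) not at all, so `HorizonFacts` at `β₀` implies `HorizonFacts` at
every `β₀′ ≥ β₀` along couplings in `]0,1]` (`flowIneq26/27/28/29_mono_beta0`, `horizonFacts_mono_beta0`); running §8's END statement at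
`β₀⋆ := min(β₀, 1/L)` and lifting, the END statements hold for EVERY `β₀ > 0` and every `L ≥ 2` with NO `β₀ ≤ 1` and NO `L·β₀ ≤ 1`
(`BetaAvgAFH.endpoint_and_flowControl_anyBeta0`, `wallEND_of_composedLegInterfacePow_identity_avg_remainderConst_anyBeta0`,
`Osc.inhabited_anyBeta0`), in particular at print's example pair `(L, β₀) = (13, 1/7)` (`Osc.inhabited_print_13_7`) — the `β₀ ≤ 1/L` divergence of
the typed smallness STRUCTURE (D-sb14.2a, §9) no longer touches any END STATEMENT; the literal reading of p. 255 «β₀ > 0 can be chosen arbitrarily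
small, if g is sufficiently small» = a family of statements indexed by `β₀ > 0`, strongest as `β₀ ↓ 0`, each with its own threshold `γ₁(β₀, …)`.
v1.7 (same unit and generation; APPEND-ONLY over v1.6 — every v1.6 declaration byte-unchanged, no new import): §11 ONE THRESHOLD FOR ALL PROFILES —
the typed [III] list `HorizonFacts F β′ β₀ A₀ L p κ R k` fixes ONE profile exponent `p` (serving (2.7), the profile `ε_j = g_j·A₀(log g_j⁻²)^p` of
(2.8), and the radii exponent of (2.5)/(2.9) at once), while print has finitely many: `p₀` for `ε_j` ((2.4) p. 255), `r` for `R_j` ((2.5)), `q₀, q₁`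
for `α_{0,j}, α_{1,j}` ((2.28) p. 259: *"q₀, q₁ are integers greater than 1, C₀, C₁ are sufficiently large positive numbers"*), and p. 256 says
*"Similar inequalities hold for other constants, which will be introduced later."*  Since the two `p`-clauses of `SmallnessFor` (`4p + 2 ≤ log γ⁻²`,
`p ≤ β₀ log γ⁻²`) only weaken as `p` decreases (`smallnessFor_of_exponent_le`), the threshold `γ₁` of §8/§10 chosen for a MAXIMAL exponent `p`
serves every `p′ ≤ p` and every amplitude `A₀ ≥ 0` SIMULTANEOUSLY along each run (`BetaAvgAFH.endpoint_and_flowControl_allProfiles`; wall twin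
`wallEND_of_composedLegInterfacePow_identity_avg_remainderConst_allProfiles`; inhabited `Osc.inhabited_allProfiles`) — one «g sufficiently small»
for all the printed profiles, every `β₀ > 0`, every `L ≥ 2`.  (R3) of MISSING-B14 §2(e) («the p-dependence is NOT removable») is thereby read
exactly: not removable pointwise in `p`, but ONE threshold for any FINITE set of exponents.  LOCATED ROAD-(2) CONSUMERS of the mixed-exponent form
(MISSING-B14 §8 C19/C20): `T4ScalePairing.kappa_mul_R_le_p0Profile` (node U5c/NE7b; (2.7) at `p₀` + (2.5) radii at `r ≤ p₀` + `1 ≤ log g_s⁻²` on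
the same run) and `T4UniformRadius.radius_profile_of_flowIneq29` ((2.9)) — their binders are PRODUCED from the carrier by `BetaAvgAFH.t4FlowInputs`
(no new import; nothing of the T⁴ records asserted).
v1.8 (same unit and generation; APPEND-ONLY over v1.7 — every v1.7 declaration byte-unchanged, no new import): §12 THE SAME AT THE BARE END GRADE — the
T⁴ flow-fact consumers C19/C20 (and C1–C7, C11, C12, C15) need (2.6)–(2.9) but NOT (2.46), hence no slope: `BetaAvgAFH.flowIneq_allProfiles` (carrier with
`s ≥ 0` + printed-type upper bound `β′ ≥ 0` + `0 < β₀` + `L ≥ 2` + maximal exponent `p`, NO continuity ⟹ ∃ γ₁ > 0, along every run in `]0,γ]`,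
`γ ≤ min(γ₀,γ₁)`, for every `p′ ≤ p` and `A₀ ≥ 0`: sizes of exponent `p′` ∧ (2.6) ∧ (2.7)_{p′} ∧ (2.8)_{A₀,p′} ∧ (2.9); via v1 §3 `flowIneq_along` +
§10 monotonicity + §11 antitonicity), `BetaAvgAFH.t4FlowInputs_of_nonneg` (§11's adapter with `s ≥ 0` and without (C)) and `t4FlowInputs_of_partialSums`
(the Gloss-3 END grade `FlowStepRuns.BetaPartialSumsLowerH M γ₀ β` itself produces the T⁴ binders, by §1 `zero_iff`).  So in the census C19/C20 join
C1–C7 as «slope ≥ 0» rows: served by EVERY row of Table 9.1, (A-ps) included.  §13 THE ACCELERATION LANES ON THE [III] SIDE (lead's RULING (R15),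
BETA-SPEC v1.9zf §7.30: computer-assisted finite-k lane cap1–3 exporting `Beta.Certified.SmallKCert`, asymptotic lane asym1/asym2 exporting
`Assembly.LimitForm` data / `RateCertificate`; (R15-3) «their END-statement bookkeeping is §5 = CO-LEAD»): `betaAvgAFH_of_limitForm` (a `LimitForm D`
ALONE — the asymptotic lane's socket — gives `BetaAvgAFH (β⁰_∞/2) ((β⁰_∞/2 + max β′ c₀)·k₀) γ₁ β`, Gloss 2 by `LimitForm.toEventual`), hence
`limitForm_END_allProfiles` (EndpointExistence ∧ the whole [III] list for all profiles and every β₀ below one threshold) and `limitForm_t4FlowInputs`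
(the T⁴ flow-fact binders); `betaAvgAFH_of_limitForm_list` (the SAME `LimitForm` + the finite list `3β⁰_∞/4 ≤ β⁰_{k+1}, k < k₁` with
`c₀θ^{k₁} ≤ β⁰_∞/4` — the computer-assisted lane's `SmallKCert.hsmall` — gives the carrier with DEFECT ZERO, `BetaAvgAFH (β⁰_∞/2) 0 γ₁ β`, i.e. the
(AF-0s) row of Table 9.1).  CENSUS READING: on the consumer side ([III]/[IV] C1–C15 and the T⁴ rows C16, C18–C20) the certified finite list buys
EXACTLY the defect — zero instead of `(β⁰_∞/2 + max β′ c₀)·k₀` —, hence the LITERAL (0.31) anchors of C16/C18 and `B12.Thm2Printed` on the coarse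
lattices (`Assembly.LimitForm.thm2Printed_of_list`, `Certified.thm2Printed_of_cert`), and NOTHING ELSE: every located consumer is already served by the
asymptotic lane's `LimitForm` through Gloss 2 (`PrefixAbsorption.eventualForm_not_thm2Printed` marks the one statement that needs the list).  Every
`LimitForm` field is a BINDER (the wall's (D1)+(D3) «in rate clothing», (R15-2)); nothing of Bałaban's β asserted.

Imports `Beta.ConstRemainderConsumers` (→ `PerturbedFamily`, `DriftRemainder`, `B14DeltaBeta`, `B14FlowStep`, `Beta.Assembly`,
`FlowStepRuns`, `DagBinding`) and `Beta.ComposedRoad` (→ `WindowInterface`, `OneShotTelescope`); restates nothing of them (every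
source/consumer is USED BY NAME).  Mathlib only otherwise; 0 `sorry`, no `axiom`; the `def`s are the carrier predicate
`BetaAvgAFH` and the §5(b) witness family `Osc.betaO` with its split `Osc.splitO`.  Cell prose: `HOME/MISSING-B14.md` v11 §9.13, `HOME/BETA-SPEC.md` §5.15,
GAPS C-sb14-21.
-/

namespace Literature.MathematicalPhysics.QuantumFieldTheory.Balaban1983to89.Beta.AveragedAFCarrier

open Literature.Probability.LatticeModels (annulus)
open Literature.MathematicalPhysics.QuantumFieldTheory.Balaban1983to89
open Literature.MathematicalPhysics.QuantumFieldTheory.Balaban1983to89.FlowStep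
open Literature.MathematicalPhysics.QuantumFieldTheory.Balaban1983to89.DagBinding
open Literature.MathematicalPhysics.QuantumFieldTheory.Balaban1983to89.FlowStepRuns
open Literature.MathematicalPhysics.QuantumFieldTheory.Balaban1983to89.B14DeltaBeta
open Literature.MathematicalPhysics.QuantumFieldTheory.Balaban1983to89.Beta.PerturbedFamily
  (smallnessFor_of_le polySmall_of_le defect_of_le)
open Literature.MathematicalPhysics.QuantumFieldTheory.Balaban1983to89.Beta.Assembly (EventualForm)
open Literature.MathematicalPhysics.QuantumFieldTheory.Balaban1983to89.Beta.Drift (OneLoopDrift)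
open Literature.MathematicalPhysics.QuantumFieldTheory.Balaban1983to89.Beta.RemainderChain (RemainderConst Chain ChainSigns
  remCoeff)
open Literature.MathematicalPhysics.QuantumFieldTheory.Balaban1983to89.Beta.DriftRemainder (sum_Ico_beta_ge_of_drift_oneSided)
open Literature.MathematicalPhysics.QuantumFieldTheory.Balaban1983to89.Beta.ConstRemainderConsumers
  (flowIneq_along_of_partialSums endpoint_and_flowControl_of_condSmallH_avgAF)
open Literature.MathematicalPhysics.QuantumFieldTheory.Balaban1983to89.Beta.TransverseStructure (E4)
open Literature.MathematicalPhysics.QuantumFieldTheory.Balaban1983to89.Beta.LeadingCoefficient (leadingIntegrand kappaBal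
  transverseValue)
open Literature.MathematicalPhysics.QuantumFieldTheory.Balaban1983to89.Beta.DyadicShell (Pt toReal supNorm)
open Literature.MathematicalPhysics.QuantumFieldTheory.Balaban1983to89.Beta.LargeLWindow.WindowDecomposition (constA)
open Literature.MathematicalPhysics.QuantumFieldTheory.Balaban1983to89.Beta.BubbleTransfer (Leg contBubble bubbleConst)
open Literature.MathematicalPhysics.QuantumFieldTheory.Balaban1983to89.Beta.MarginalTelescoping (composedCoeff SeparationRate
  IdentityForm)
open Literature.MathematicalPhysics.QuantumFieldTheory.Balaban1983to89.Beta.ComposedRoad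
  (oneLoopDrift_of_composedLegInterfacePow oneLoopDrift_of_composedLegInterfacePow_identity
    oneLoopDrift_of_composedLegInterfaceOn_identity)

noncomputable section

/-! ## 1. The carrier: history-level averaged asymptotic freedom with slope `s` and defect `D` -/

/-- **THE SLOPE-CARRYING END-GRADE CARRIER** (history level).  `BetaAvgAFH s D γ β`: along EVERY history `g` with all
`g_i ∈ ]0,γ]` and all `k ≤ n`, the window sum of the history-dependent β-functions obeys
`s·(n − k) − D ≤ Σ_{j∈[k,n)} β_j(g_0,…,g_j)` — averaged asymptotic freedom with slope `s` and defect `D`.  At `s = 0` it IS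
`FlowStepRuns.BetaPartialSumsLowerH D γ β` (`zero_iff`), the END grade of RULING (R10-1)/Gloss 3; with `s > 0` it is what the
[III]-side consumer (2.46) needs (§3), and the grade through which Gloss 3″'s carrier (BETA-SPEC v1.9r §7.20 (c)) is consumed.  A HYPOTHESIS SHAPE over the carrier `FlowStep.HBeta`; for Bałaban's (1.22) every
instance is a located UNPRINTED input (BETA-SPEC §7), never a fact. [cite: Balaban1987RG1, Thm 2 p.259 and §1 p.264] -/
def BetaAvgAFH (s D γ : ℝ) (β : HBeta) : Prop :=
  ∀ g : ℕ → ℝ, (∀ i, 0 < g i ∧ g i ≤ γ) → ∀ k n : ℕ, k ≤ n →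
    s * ((n : ℝ) - k) - D ≤ ∑ j ∈ Finset.Ico k n, β j (prefixOf g j)

namespace BetaAvgAFH

variable {β : HBeta} {s s' D D' γ γ' : ℝ}

/-- Slope `0` is EXACTLY the END grade `BetaPartialSumsLowerH`. [folklore] -/
theorem zero_iff : BetaAvgAFH 0 D γ β ↔ BetaPartialSumsLowerH D γ β := by
  constructor
  · intro h g hg k n hkn
    have := h g hg k n hkn
    simpa using this
  · intro h g hg k n hkn
    have := h g hg k n hkn
    simpa using this

/-- Weakening the slope and enlarging the defect. [folklore] -/
theorem of_le (h : BetaAvgAFH s D γ β) (hs : s' ≤ s) (hD : D ≤ D') : BetaAvgAFH s' D' γ β := by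
  intro g hg k n hkn
  have h1 := h g hg k n hkn
  have hnk : (0 : ℝ) ≤ (n : ℝ) - k := by
    have : (k : ℝ) ≤ n := by exact_mod_cast hkn
    linarith
  have h2 : s' * ((n : ℝ) - k) ≤ s * ((n : ℝ) - k) := mul_le_mul_of_nonneg_right hs hnk
  linarith

/-- A nonnegative slope may be dropped: the carrier CONTAINS the END grade `BetaPartialSumsLowerH D γ β` — hence everything
that grade buys (§3: endpoint existence, the p. 355 reading, (2.6)–(2.9)). [folklore] -/
theorem partialSums (h : BetaAvgAFH s D γ β) (hs : 0 ≤ s) : BetaPartialSumsLowerH D γ β :=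
  zero_iff.mp (h.of_le hs le_rfl)

/-- Restriction to a smaller interval. [folklore] -/
theorem mono (hγ : γ ≤ γ') (h : BetaAvgAFH s D γ' β) : BetaAvgAFH s D γ β :=
  fun g hg k n hkn => h g (fun i => ⟨(hg i).1, (hg i).2.trans hγ⟩) k n hkn

/-- The defect is nonnegative as soon as the interval is nonempty (`γ > 0`: empty window along the constant history `γ`).
[folklore] -/
theorem defect_nonneg (hγ : 0 < γ) (h : BetaAvgAFH s D γ β) : 0 ≤ D := by
  have := h (fun _ => γ) (fun _ => ⟨hγ, le_rfl⟩) 0 0 le_rfl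
  simp at this
  linarith

/-- **FINITE-HORIZON FORM** (the hypothesis shape of `ConstRemainderConsumers` §3, into which every road's output maps): for a
sequence known to lie in `]0,γ]` only up to `K`, the window bounds hold for all `[m,n) ⊆ [0,K]` (extend the sequence beyond `K`
by `g_0`; the prefixes up to `K` are unchanged). [folklore] -/
theorem onHorizon (h : BetaAvgAFH s D γ β) :
    ∀ (g : ℕ → ℝ) (K : ℕ), (∀ i, i ≤ K → 0 < g i ∧ g i ≤ γ) →
      ∀ m n : ℕ, m ≤ n → n ≤ K → s * ((n : ℝ) - m) - D ≤ ∑ j ∈ Finset.Ico m n, β j (prefixOf g j) := by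
  intro g K hg m n hmn hnK
  set g' : ℕ → ℝ := fun i => if i ≤ K then g i else g 0 with hg'
  have hg'box : ∀ i, 0 < g' i ∧ g' i ≤ γ := by
    intro i
    by_cases hi : i ≤ K
    · simp only [hg', hi, if_true]; exact hg i hi
    · simp only [hg', hi, if_false]; exact hg 0 (Nat.zero_le K)
  have hpre : ∀ j, j < K → prefixOf g' j = prefixOf g j := by
    intro j hj
    funext i
    have hi : (i : ℕ) ≤ K := by have := i.isLt; omega
    simp [prefixOf, hg', hi]
  have h1 := h g' hg'box m n hmn
  have hsum : ∑ j ∈ Finset.Ico m n, β j (prefixOf g' j) = ∑ j ∈ Finset.Ico m n, β j (prefixOf g j) := by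
    refine Finset.sum_congr rfl fun j hj => ?_
    rw [hpre j (lt_of_lt_of_le (Finset.mem_Ico.mp hj).2 hnK)]
  rw [hsum] at h1
  exact h1

/-- **RUN-WISE FORM** (the hypothesis shape of `B14FlowStep.flowControl_of_avgAF`): along an in-interval run (`γ ≤ γ₀`) of a
construction whose run-wise β-functions CURRY `β`, the realised values satisfy `s(n−m) − D ≤ Σ_{j∈[m,n)} β_{j+1}(g_j)` for all
`m ≤ n ≤ K`. [folklore] -/
theorem along {γ₀ : ℝ} (h : BetaAvgAFH s D γ₀ β) {C : B12.Construction} (hcur : CurriesHBeta C β) (hγ₀ : γ ≤ γ₀)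
    (P : B12.RunParams) (hI : (C P).flow.InInterval γ P.K) :
    ∀ m n : ℕ, m ≤ n → n ≤ P.K →
      s * ((n : ℝ) - m) - D ≤ ∑ j ∈ Finset.Ico m n, (C P).flow.β (j + 1) ((C P).flow.g j) := by
  intro m n hmn hnK
  have hg : ∀ i, i ≤ P.K → 0 < (C P).flow.g i ∧ (C P).flow.g i ≤ γ₀ :=
    fun i hi => ⟨(hI i hi).1, (hI i hi).2.trans hγ₀⟩
  have h1 := h.onHorizon (C P).flow.g P.K hg m n hmn hnK
  have hsum : ∑ j ∈ Finset.Ico m n, β j (prefixOf (C P).flow.g j)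
      = ∑ j ∈ Finset.Ico m n, (C P).flow.β (j + 1) ((C P).flow.g j) := by
    refine Finset.sum_congr rfl fun j hj => ?_
    have hjK : j < P.K := lt_of_lt_of_le (Finset.mem_Ico.mp hj).2 hnK
    rw [(realised_eq_hist hcur P hγ₀ hI hjK).1]
  rw [hsum] at h1
  exact h1

end BetaAvgAFH

/-! ## 2. SOURCES: every road of the sub-cell produces the carrier (by name) -/

section Sources

variable {β : HBeta}

/-- **(AF-0s) grade**: a pointwise lower bound `b ≤ β_{k+1}` on the `]0,γ]`-boxes (`FlowStep.BetaLowerH b γ β`; for Bałaban's β an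
UNPRINTED input — «Theorem 2 as printed» needs it for all k) gives slope `b`, defect `0`. [folklore] -/
theorem betaAvgAFH_of_betaLowerH {b γ : ℝ} (h : BetaLowerH b γ β) : BetaAvgAFH b 0 γ β := by
  intro g hg k n hkn
  have hbox : ∀ j, prefixOf g j ∈ Box γ j := fun j => mem_box.mpr fun i => hg i
  have hsum := Finset.sum_le_sum fun j (_ : j ∈ Finset.Ico k n) => h j _ (hbox j)
  rw [Finset.sum_const, Nat.card_Ico, nsmul_eq_mul, Nat.cast_sub hkn] at hsum
  linarith

/-- **Gloss 2 grade, unbundled**: an EVENTUAL pointwise lower bound `b ≤ β_{k+1}` on the boxes for `k ≥ k₀` (`b ≥ 0`) plus the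
PRINTED lower half `−β′ ≤ β_{k+1}` of the two-sided bound ([Balaban1987RG1] p. 264 «uniformly bounded», `β′ ≥ 0`) give slope
`b`, defect `(b+β′)k₀` — the finitely many early scales contribute a CONSTANT (history-level twin of
`B14FlowStep.avgAF_of_eventualLower`). [cite: Balaban1987RG1, §1 p.264] -/
theorem betaAvgAFH_of_eventualLower {γ₀ b β' : ℝ} {k₀ : ℕ} (hb : 0 ≤ b) (hβ' : 0 ≤ β')
    (htail : ∀ k, k₀ ≤ k → ∀ v ∈ Box γ₀ k, b ≤ β k v) (hlo : ∀ k, ∀ v ∈ Box γ₀ k, -β' ≤ β k v) :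
    BetaAvgAFH b ((b + β') * k₀) γ₀ β := by
  intro g hg m n hmn
  have hbox : ∀ j, prefixOf g j ∈ Box γ₀ j := fun j => mem_box.mpr fun i => hg i
  have hpt : ∀ j ∈ Finset.Ico m n, b - (if j < k₀ then (b + β') else 0) ≤ β j (prefixOf g j) := by
    intro j _
    by_cases hjk : j < k₀
    · rw [if_pos hjk]; have := hlo j _ (hbox j); linarith
    · rw [if_neg hjk]; have := htail j (not_lt.mp hjk) _ (hbox j); linarith
  have hsum := Finset.sum_le_sum hpt
  have hs1 : ∑ _j ∈ Finset.Ico m n, (b : ℝ) = b * ((n : ℝ) - m) := by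
    rw [Finset.sum_const, Nat.card_Ico, nsmul_eq_mul, Nat.cast_sub hmn]; ring
  have hs2 : ∑ j ∈ Finset.Ico m n, (if j < k₀ then (b + β') else 0)
      = (((Finset.Ico m n).filter (· < k₀)).card : ℝ) * (b + β') := by
    rw [Finset.sum_ite, Finset.sum_const_zero, add_zero, Finset.sum_const, nsmul_eq_mul]
  rw [Finset.sum_sub_distrib, hs1, hs2] at hsum
  have hcard : (((Finset.Ico m n).filter (· < k₀)).card : ℝ) ≤ k₀ := by
    exact_mod_cast B14FlowStep.card_filter_lt_Ico_le m n k₀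
  have hbb : 0 ≤ b + β' := by linarith
  have h1 : (((Finset.Ico m n).filter (· < k₀)).card : ℝ) * (b + β') ≤ (k₀ : ℝ) * (b + β') :=
    mul_le_mul_of_nonneg_right hcard hbb
  linarith

/-- **Gloss 2 grade, bundled**: the minimal residual form `Beta.Assembly.EventualForm β` gives
`BetaAvgAFH E.b ((E.b + E.β′)·E.k₀) E.γ₀ β`.  So the slope-carrying END grade — the grade at which Gloss 3′'s carrier is CONSUMED
(§3/§4) — is IMPLIED by Gloss 2's `EventualForm` grade (BETA-SPEC §7.18 (c) «implied by Gloss 2's EventualForm grade», kernel, at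
the grade of `BetaAvgAFH`); the converse FAILS (§5(b): a literal (R10-1′) carrier with no `EventualForm`).  Whether an `EventualForm`
family admits a LITERAL `OneLoopSplit` with drift is a different, structural question ((2.14)'s vanishing at zero coupling) that no
located consumer asks. [folklore] -/
theorem betaAvgAFH_of_eventualForm (E : EventualForm β) : BetaAvgAFH E.b ((E.b + E.β') * E.k₀) E.γ₀ β :=
  betaAvgAFH_of_eventualLower E.b_pos.le E.β'_pos.le E.tail E.lower

/-- **Gloss 3′ grade = the (R10-1′) CARRIER**: a split `β = β⁰ + β¹` ([Balaban1987RG1] (2.12)–(2.14)) whose one-loop part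
DRIFTS, `OneLoopDrift b A β⁰` (BINDER, row an1), and whose remainder obeys the ONE-SIDED CONSTANT form `−r ≤ β¹_{k+1}` on the
`]0,γ]`-histories (BINDER, row an4's printed-type slot) gives slope `b − r`, defect `2A`
(`DriftRemainder.sum_Ico_beta_ge_of_drift_oneSided`).  Positive slope ⟺ `r < b` STRICTLY — the (R10-1′) amendment.
[cite: Balaban1987RG1, (2.12)–(2.14) p.268] -/
theorem betaAvgAFH_of_driftOneSided (S : B12Beta.OneLoopSplit β) {b A r γ : ℝ} (hdrift : OneLoopDrift b A S.β0)
    (hlow : ∀ k (p : Fin (k + 1) → ℝ), p ∈ B12Beta.HistBox γ k → -r ≤ S.β1 k p) :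
    BetaAvgAFH (b - r) (2 * A) γ β :=
  fun _ hg _ _ hkn => sum_Ico_beta_ge_of_drift_oneSided S hdrift hlow hg hkn

/-- The same from row an4's TWO-SIDED constant form `RemainderConst S γ r` (`|β¹_{k+1}| ≤ r`; e.g. `r = ε₁·K_rem` from the printed
chain, `RemainderChain.Chain.abs_beta1_le`, or `RemainderChainKP.ChainKP.abs_beta1_le`). [folklore] -/
theorem betaAvgAFH_of_driftRemainderConst (S : B12Beta.OneLoopSplit β) {b A r γ : ℝ} (hdrift : OneLoopDrift b A S.β0)
    (hrem : RemainderConst S γ r) : BetaAvgAFH (b - r) (2 * A) γ β :=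
  betaAvgAFH_of_driftOneSided S hdrift fun k q hq => (abs_le.mp (hrem k q hq)).1

/-- The same with the remainder slot filled by row an4's PRINTED CHAIN (`RemainderChain.Chain` + signs): slope `b − ε₁·K_rem`,
defect `2A`; the leaves inside the chain stay located. [cite: Balaban1988RG2Cluster, (2.41) p.21] -/
theorem betaAvgAFH_of_driftChain {S : B12Beta.OneLoopSplit β} {d : ℕ} {μ ν : Fin d} {c : B13.Consts}
    {α₂ B₃ c₁ K₀ K₁ γ b A : ℝ} (Rc : Chain d μ ν S γ c α₂ B₃ c₁ K₀ K₁) (hs : ChainSigns c α₂ B₃ K₀)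
    (hdrift : OneLoopDrift b A S.β0) :
    BetaAvgAFH (b - c.ε₁ * remCoeff d c α₂ B₃ c₁ K₀ K₁) (2 * A) γ β :=
  betaAvgAFH_of_driftRemainderConst S hdrift (Rc.abs_beta1_le hs)

end Sources

/-! ### 2′ SOURCES (continued): the lead's WALL SOCKETS (`Beta.ComposedRoad` §5/§7/§8) produce the carrier

The wall of the sub-cell as ONE declaration is `ComposedRoad.oneLoopDrift_of_composedLegInterface…`: k = 0 leg-level window data
((W1)₀ table `hdeg/hval`, (W2′)₀ corrections `hF/hG`, (W3a)₀ tails `hFtail/hGtail`, (W3b)₀ identification `hident`) along the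
blocking factors + [H-germ′] (`SeparationRate C θ` in print's shape, or `IdentityForm` under RULING (R11)) ⟹ `OneLoopDrift
(stepBal N Lc) A′ β⁰`.  Adding the (R10-1′) remainder binder `RemainderConst S γ₀ rr` gives the carrier with slope
`stepBal N Lc − rr` and defect `2A′`.  The binder lists below are COPIED from the lead's declarations (nothing added, nothing
dropped); every one of them is a HYPOTHESIS — none is instantiated for Bałaban's objects anywhere in the tree (BETA-SPEC §7.18 (a)). -/

section Wall

variable {β : HBeta} {ι : Type*} {s : Finset ι} {cc₀ : ι → ℝ} {P Q : ι → Leg}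

/-- **THE (R11) WALL ⟹ THE CARRIER**: window data for the composed coefficient `composedCoeff μC m` along `n = Lc^m`,
`IdentityForm μC β⁰` for [H-germ′], and `RemainderConst S γ₀ rr` give `BetaAvgAFH (stepBal N Lc − rr) (2A′) γ₀ β` with `A′` the
window constant of `ComposedRoad.oneLoopDrift_of_composedLegInterfacePow_identity`. [folklore] -/
theorem betaAvgAFH_of_composedLegInterfacePow_identity_remainderConst (S : B12Beta.OneLoopSplit β)
    (hdeg : ∀ i ∈ s, (P i).a + (Q i).a = 6) {μ ν : Fin 4} (hμν : μ ≠ ν) {N : ℝ} (hN : N ≠ 0)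
    (hval : ∀ x : E4, x ≠ 0 → x μ * x ν * contBubble s cc₀ P Q x = leadingIntegrand (kappaBal N) μ ν x)
    {Lc : ℕ} (hL : 2 ≤ Lc) {μC : ℕ → ℕ → ℝ}
    {F' G' : ι → ℕ → Pt → ℝ} {R S' R' Sg : ι → ℝ} {δ U cc : ℝ} {M : ℕ → ℕ}
    (hR : ∀ i ∈ s, 0 ≤ R i) (hS : ∀ i ∈ s, 0 ≤ Sg i) (hR' : ∀ i ∈ s, 0 ≤ R' i) (hS' : ∀ i ∈ s, 0 ≤ S' i) (hδ : 0 < δ)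
    (hc : 1 ≤ cc) (hM : ∀ L : ℕ, 2 ≤ L → 1 ≤ M L ∧ (L : ℝ) ≤ cc * M L) (hML : ∀ L : ℕ, 2 ≤ L → M L ≤ L)
    (hF : ∀ m : ℕ, 1 ≤ m → ∀ w ∈ annulus 4 0 (M (Lc ^ m)), ∀ i ∈ s,
      |F' i (Lc ^ m) w - (P i).f (Lc ^ m) 0 w| ≤ R i / ((supNorm w : ℝ) ^ ((P i).a - 2) * ((Lc ^ m : ℕ) : ℝ) ^ 2))
    (hG : ∀ m : ℕ, 1 ≤ m → ∀ w ∈ annulus 4 0 (M (Lc ^ m)), ∀ i ∈ s,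
      |G' i (Lc ^ m) w - (Q i).f (Lc ^ m) 0 w| ≤ Sg i / ((supNorm w : ℝ) ^ ((Q i).a - 2) * ((Lc ^ m : ℕ) : ℝ) ^ 2))
    (hFtail : ∀ m : ℕ, 1 ≤ m → ∀ r : ℕ, M (Lc ^ m) ≤ r → ∀ w ∈ annulus 4 r (r + 1), ∀ i ∈ s,
      |F' i (Lc ^ m) w| ≤ R' i / ((r : ℝ) + 1) ^ (P i).a * Real.exp (-(δ / ((Lc ^ m : ℕ) : ℝ)) * ((r : ℝ) + 1)))
    (hGtail : ∀ m : ℕ, 1 ≤ m → ∀ r : ℕ, M (Lc ^ m) ≤ r → ∀ w ∈ annulus 4 r (r + 1), ∀ i ∈ s,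
      |G' i (Lc ^ m) w| ≤ S' i / ((r : ℝ) + 1) ^ (Q i).a)
    (hident : ∀ m : ℕ, 1 ≤ m → ∃ R₀ : ℕ, M (Lc ^ m) ≤ R₀ ∧
      |composedCoeff μC m - ∑ w ∈ annulus 4 0 R₀, toReal w μ * toReal w ν *
        ∑ i ∈ s, cc₀ i * (F' i (Lc ^ m) w * G' i (Lc ^ m) w)| ≤ U)
    (hid : IdentityForm μC S.β0) {rr γ₀ : ℝ} (hrem : RemainderConst S γ₀ rr) :
    BetaAvgAFH (B12Normalization.stepBal N Lc - rr)
      (2 * constA (|kappaBal N| * 24 + |kappaBal N| * 110592) (bubbleConst s cc₀ P Q)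
          ((80 * (∑ i ∈ s, |cc₀ i| * (R' i * S' i)) * (1 + cc / δ) + U) +
            80 * ∑ i ∈ s, |cc₀ i| * ((((P i).A + (P i).B) * Sg i + R i * ((Q i).A + (Q i).B) + R i * Sg i)))
          cc (kappaBal N * transverseValue)) γ₀ β :=
  betaAvgAFH_of_driftRemainderConst S
    (oneLoopDrift_of_composedLegInterfacePow_identity S hdeg hμν hN hval hL hR hS hR' hS' hδ hc hM hML hF hG hFtail hGtail
      hident hid) hrem

/-- **THE WALL IN PRINT'S SHAPE ⟹ THE CARRIER**: as above with [H-germ′] entering as `SeparationRate C θ μC β⁰` ([Balaban1987RG1]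
p. 290 (4.35)–(4.36), p. 292 l. 2–9 — HYPOTHESIS); the defect gains `2·Cθ/(1−θ)`. [folklore] -/
theorem betaAvgAFH_of_composedLegInterfacePow_remainderConst (S : B12Beta.OneLoopSplit β)
    (hdeg : ∀ i ∈ s, (P i).a + (Q i).a = 6) {μ ν : Fin 4} (hμν : μ ≠ ν) {N : ℝ} (hN : N ≠ 0)
    (hval : ∀ x : E4, x ≠ 0 → x μ * x ν * contBubble s cc₀ P Q x = leadingIntegrand (kappaBal N) μ ν x)
    {Lc : ℕ} (hL : 2 ≤ Lc) {μC : ℕ → ℕ → ℝ}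
    {F' G' : ι → ℕ → Pt → ℝ} {R S' R' Sg : ι → ℝ} {δ U cc : ℝ} {M : ℕ → ℕ}
    (hR : ∀ i ∈ s, 0 ≤ R i) (hS : ∀ i ∈ s, 0 ≤ Sg i) (hR' : ∀ i ∈ s, 0 ≤ R' i) (hS' : ∀ i ∈ s, 0 ≤ S' i) (hδ : 0 < δ)
    (hc : 1 ≤ cc) (hM : ∀ L : ℕ, 2 ≤ L → 1 ≤ M L ∧ (L : ℝ) ≤ cc * M L) (hML : ∀ L : ℕ, 2 ≤ L → M L ≤ L)
    (hF : ∀ m : ℕ, 1 ≤ m → ∀ w ∈ annulus 4 0 (M (Lc ^ m)), ∀ i ∈ s,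
      |F' i (Lc ^ m) w - (P i).f (Lc ^ m) 0 w| ≤ R i / ((supNorm w : ℝ) ^ ((P i).a - 2) * ((Lc ^ m : ℕ) : ℝ) ^ 2))
    (hG : ∀ m : ℕ, 1 ≤ m → ∀ w ∈ annulus 4 0 (M (Lc ^ m)), ∀ i ∈ s,
      |G' i (Lc ^ m) w - (Q i).f (Lc ^ m) 0 w| ≤ Sg i / ((supNorm w : ℝ) ^ ((Q i).a - 2) * ((Lc ^ m : ℕ) : ℝ) ^ 2))
    (hFtail : ∀ m : ℕ, 1 ≤ m → ∀ r : ℕ, M (Lc ^ m) ≤ r → ∀ w ∈ annulus 4 r (r + 1), ∀ i ∈ s,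
      |F' i (Lc ^ m) w| ≤ R' i / ((r : ℝ) + 1) ^ (P i).a * Real.exp (-(δ / ((Lc ^ m : ℕ) : ℝ)) * ((r : ℝ) + 1)))
    (hGtail : ∀ m : ℕ, 1 ≤ m → ∀ r : ℕ, M (Lc ^ m) ≤ r → ∀ w ∈ annulus 4 r (r + 1), ∀ i ∈ s,
      |G' i (Lc ^ m) w| ≤ S' i / ((r : ℝ) + 1) ^ (Q i).a)
    (hident : ∀ m : ℕ, 1 ≤ m → ∃ R₀ : ℕ, M (Lc ^ m) ≤ R₀ ∧
      |composedCoeff μC m - ∑ w ∈ annulus 4 0 R₀, toReal w μ * toReal w ν *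
        ∑ i ∈ s, cc₀ i * (F' i (Lc ^ m) w * G' i (Lc ^ m) w)| ≤ U)
    {C θ : ℝ} (hC : 0 ≤ C) (hθ0 : 0 ≤ θ) (hθ1 : θ < 1) (hsep : SeparationRate C θ μC S.β0)
    {rr γ₀ : ℝ} (hrem : RemainderConst S γ₀ rr) :
    BetaAvgAFH (B12Normalization.stepBal N Lc - rr)
      (2 * (constA (|kappaBal N| * 24 + |kappaBal N| * 110592) (bubbleConst s cc₀ P Q)
          ((80 * (∑ i ∈ s, |cc₀ i| * (R' i * S' i)) * (1 + cc / δ) + U) +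
            80 * ∑ i ∈ s, |cc₀ i| * ((((P i).A + (P i).B) * Sg i + R i * ((Q i).A + (Q i).B) + R i * Sg i)))
          cc (kappaBal N * transverseValue) + C * θ / (1 - θ))) γ₀ β :=
  betaAvgAFH_of_driftRemainderConst S
    (oneLoopDrift_of_composedLegInterfacePow S hdeg hμν hN hval hL hR hS hR' hS' hδ hc hM hML hF hG hFtail hGtail hident hC hθ0
      hθ1 hsep) hrem

/-- **THE RELATIVISED k = 0 WALL (admissible blocking factors `Adm ∋ Lc^m`, first-step family `B`, `hcomp`), IDENTITY SHAPE ⟹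
THE CARRIER** (`ComposedRoad.oneLoopDrift_of_composedLegInterfaceOn_identity` + `RemainderConst`). [folklore] -/
theorem betaAvgAFH_of_composedLegInterfaceOn_identity_remainderConst (S : B12Beta.OneLoopSplit β)
    (hdeg : ∀ i ∈ s, (P i).a + (Q i).a = 6) {μ ν : Fin 4} (hμν : μ ≠ ν) {N : ℝ} (hN : N ≠ 0)
    (hval : ∀ x : E4, x ≠ 0 → x μ * x ν * contBubble s cc₀ P Q x = leadingIntegrand (kappaBal N) μ ν x)
    (Adm : ℕ → Prop) {Lc : ℕ} (hL : 2 ≤ Lc) (hAdm : ∀ m : ℕ, Adm (Lc ^ m))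
    {B : ℕ → ℝ} {F' G' : ι → ℕ → Pt → ℝ} {R S' R' Sg : ι → ℝ} {δ U cc : ℝ} {M : ℕ → ℕ}
    (hR : ∀ i ∈ s, 0 ≤ R i) (hS : ∀ i ∈ s, 0 ≤ Sg i) (hR' : ∀ i ∈ s, 0 ≤ R' i) (hS' : ∀ i ∈ s, 0 ≤ S' i) (hδ : 0 < δ)
    (hc : 1 ≤ cc) (hM : ∀ L : ℕ, 2 ≤ L → 1 ≤ M L ∧ (L : ℝ) ≤ cc * M L) (hML : ∀ L : ℕ, 2 ≤ L → M L ≤ L)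
    (hF : ∀ n : ℕ, Adm n → 2 ≤ n → ∀ w ∈ annulus 4 0 (M n), ∀ i ∈ s,
      |F' i n w - (P i).f n 0 w| ≤ R i / ((supNorm w : ℝ) ^ ((P i).a - 2) * (n : ℝ) ^ 2))
    (hG : ∀ n : ℕ, Adm n → 2 ≤ n → ∀ w ∈ annulus 4 0 (M n), ∀ i ∈ s,
      |G' i n w - (Q i).f n 0 w| ≤ Sg i / ((supNorm w : ℝ) ^ ((Q i).a - 2) * (n : ℝ) ^ 2))
    (hFtail : ∀ n : ℕ, Adm n → 2 ≤ n → ∀ r : ℕ, M n ≤ r → ∀ w ∈ annulus 4 r (r + 1), ∀ i ∈ s,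
      |F' i n w| ≤ R' i / ((r : ℝ) + 1) ^ (P i).a * Real.exp (-(δ / n) * ((r : ℝ) + 1)))
    (hGtail : ∀ n : ℕ, Adm n → 2 ≤ n → ∀ r : ℕ, M n ≤ r → ∀ w ∈ annulus 4 r (r + 1), ∀ i ∈ s,
      |G' i n w| ≤ S' i / ((r : ℝ) + 1) ^ (Q i).a)
    (hident : ∀ n : ℕ, Adm n → 2 ≤ n → ∃ R₀ : ℕ, M n ≤ R₀ ∧
      |B n - ∑ w ∈ annulus 4 0 R₀, toReal w μ * toReal w ν * ∑ i ∈ s, cc₀ i * (F' i n w * G' i n w)| ≤ U)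
    {μC : ℕ → ℕ → ℝ} (hid : IdentityForm μC S.β0) (hcomp : ∀ m : ℕ, composedCoeff μC m = B (Lc ^ m))
    {rr γ₀ : ℝ} (hrem : RemainderConst S γ₀ rr) :
    BetaAvgAFH (B12Normalization.stepBal N Lc - rr)
      (2 * constA (|kappaBal N| * 24 + |kappaBal N| * 110592) (bubbleConst s cc₀ P Q)
          ((80 * (∑ i ∈ s, |cc₀ i| * (R' i * S' i)) * (1 + cc / δ) + U) +
            80 * ∑ i ∈ s, |cc₀ i| * ((((P i).A + (P i).B) * Sg i + R i * ((Q i).A + (Q i).B) + R i * Sg i)))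
          cc (kappaBal N * transverseValue)) γ₀ β :=
  betaAvgAFH_of_driftRemainderConst S
    (oneLoopDrift_of_composedLegInterfaceOn_identity S hdeg hμν hN hval Adm hL hAdm hR hS hR' hS' hδ hc hM hML hF hG hFtail
      hGtail hident hid hcomp) hrem

end Wall

/-! ## 3. CONSUMERS: everything the located [I]/[III]/[IV] consumers need, from the carrier (by name) -/

namespace BetaAvgAFH

variable {β : HBeta} {s D : ℝ}

/-- **ENDPOINT EXISTENCE** ([Balaban1987RG1] Thm 2, first sentence; `DagBinding.EndpointExistence`) from the carrier with `s ≥ 0`,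
continuity and the printed-type upper bound, for a construction generated forward by (0.20) — through the END grade
(`FlowStepRuns.endpointExistence_of_partialSums`; `g⋆ = (1/γ² + D)^{−1/2}`). [cite: Balaban1987RG1, Thm 2 p.259] -/
theorem endpointExistence {γ₀ β' : ℝ} (h : BetaAvgAFH s D γ₀ β) (hs : 0 ≤ s) {C : B12.Construction}
    (hgen : ForwardGenerated C β) (hγ₀ : 0 < γ₀) (hβ' : 0 ≤ β') (hcont : BetaContH γ₀ β) (hup : BetaUpperH β' γ₀ β) :
    EndpointExistence C :=
  endpointExistence_of_partialSums hgen hγ₀ (h.defect_nonneg hγ₀) hβ' hcont (h.partialSums hs) hup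

/-- **THE p. 355 READING** (`FlowStepRuns.p355Unconditional_of_partialSums`, `hnodes` kept — Gloss 1) from the carrier with
`s ≥ 0`, the world's interval small: `γ ≤ γ₀`, `Dγ² ≤ β₀(2+β₀)`. [cite: Balaban1989LargeFieldII, p.355] -/
theorem p355 {γ₀ : ℝ} (h : BetaAvgAFH s D γ₀ β) (hs : 0 ≤ s) (w : World) (hγw : 0 < w.γ) (hγ₀ : w.γ ≤ γ₀)
    (hβup : 0 ≤ w.βup) (hDγ : D * w.γ ^ 2 ≤ w.β₀ * (2 + w.β₀)) (hnodes : ∀ P, Nodes (leaves w P))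
    (hgen : ForwardGenerated w.C.toB12 β) (hhalt : HaltsOutside w.C.toB12 β) (hcur : CurriesHBeta w.C.toB12 β)
    (hcont : BetaContH γ₀ β) (hup : BetaUpperH w.βup γ₀ β) :
    B16.Sect2Unconditional w.C ∧
      ∃ Em Ep : ℝ, ∀ m : ℕ, ∃ gstar : ℝ, 0 < gstar ∧ ∀ g : ℝ, 0 < g → g ≤ gstar →
        ∀ K : ℕ, ∃ g0 : ℝ, (w.C ⟨K, m, g0⟩).flow.g K = g ∧
          ∀ k, k ≤ K → ∀ V : (w.C ⟨K, m, g0⟩).Cfg k, B16.UVIneq (w.C ⟨K, m, g0⟩) k V Em Ep :=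
  p355Unconditional_of_partialSums w hγw hγ₀ (h.defect_nonneg (lt_of_lt_of_le hγw hγ₀)) hβup hDγ hnodes hgen hhalt hcur
    hcont (h.partialSums hs) hup

/-- **(2.6)–(2.9) ALONG RUNS** from the carrier with `s ≥ 0` (consumers C1–C7, C11, C12, C15 of MISSING-B14 §8): the printed
constants, given the printed upper bound, `SmallnessFor γ β′ β₀ L p` (`γ ≤ γ₀`), sizes by (2.5) and `Dγ² ≤ β₀(2+β₀)`
(`ConstRemainderConsumers.flowIneq_along_of_partialSums`). [cite: Balaban1988Convergent, (2.6)–(2.9) pp.255–256] -/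
theorem flowIneq_along {γ γ₀ β' β₀ : ℝ} (h : BetaAvgAFH s D γ₀ β) (hs : 0 ≤ s) {C : B12.Construction}
    (hgen : ForwardGenerated C β) (hhalt : HaltsOutside C β) (hcur : CurriesHBeta C β) {L p : ℕ}
    (Sm : B14FlowStep.SmallnessFor γ β' β₀ L p) {A₀ : ℝ} (hA₀ : 0 ≤ A₀) (hγ₀ : γ ≤ γ₀)
    (hup : BetaUpperH β' γ₀ β) (hDγ : D * γ ^ 2 ≤ β₀ * (2 + β₀))
    (P : B12.RunParams) (hI : (C P).flow.InInterval γ P.K)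
    (Rj : ℕ → ℕ) (hRj : ∀ j, j ≤ P.K → B14.IsRj L p ((C P).flow.g j) (Rj j)) :
    B14.FlowIneq26 (C P).flow.g β' β₀ P.K ∧ B14.FlowIneq27 (C P).flow.g β' β₀ p P.K ∧
      B14.FlowIneq28 (epsK A₀ p (C P).flow) (C P).flow.g β' β₀ P.K ∧
      B14FlowStep.FlowIneq29 Rj (C P).flow.g L β' β₀ P.K :=
  flowIneq_along_of_partialSums hgen hhalt hcur Sm hA₀ hγ₀ (h.partialSums hs) hup hDγ P hI Rj hRj

/-- **THE WHOLE [III] LIST ALONG RUNS — (2.6)–(2.9) printed constants AND (2.46)** (consumers C8, C13 added) from the carrier with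
`s > 0` STRICTLY: printed upper bound, `SmallnessFor γ β′ β₀ L p` (`γ ≤ γ₀`), sizes by (2.5), `Dγ² ≤ β₀(2+β₀)`, `Dγ² ≤ 1/2`,
`(√2)^{κ₀−6}(2γ⁴/s + γ⁶) < 1`, `κ₀ ≥ 6` (`B14FlowStep.flowControl_of_avgAF` fed by `along`). [cite: Balaban1988Convergent, (2.6)–(2.9) pp.255–256 and (2.46) p.263] -/
theorem flowControl_along {γ γ₀ β' β₀ : ℝ} (h : BetaAvgAFH s D γ₀ β) (hs : 0 < s) {C : B12.Construction}
    (hgen : ForwardGenerated C β) (hhalt : HaltsOutside C β) (hcur : CurriesHBeta C β) {L p : ℕ}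
    (Sm : B14FlowStep.SmallnessFor γ β' β₀ L p) {A₀ : ℝ} (hA₀ : 0 ≤ A₀) (hγ₀ : γ ≤ γ₀)
    (hup : BetaUpperH β' γ₀ β) (hDγ : D * γ ^ 2 ≤ β₀ * (2 + β₀)) (hDγ' : D * γ ^ 2 ≤ 1 / 2) {κ₀ : ℕ} (hκ : 6 ≤ κ₀)
    (hsmall : Real.sqrt 2 ^ (κ₀ - 6) * (2 * γ ^ 4 / s + γ ^ 6) < 1)
    (P : B12.RunParams) (hI : (C P).flow.InInterval γ P.K)
    (Rj : ℕ → ℕ) (hRj : ∀ j, j ≤ P.K → B14.IsRj L p ((C P).flow.g j) (Rj j)) :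
    HorizonFacts (C P).flow β' β₀ A₀ L p κ₀ Rj P.K := by
  have hrg : (C P).flow.SatisfiesRG P.K := satisfiesRG_of_inInterval hgen hhalt hcur P hI
  have hub : ∀ j, j < P.K → (C P).flow.β (j + 1) ((C P).flow.g j) ≤ β' := by
    intro j hj
    obtain ⟨hpt, hbox⟩ := realised_eq_hist hcur P hγ₀ hI hj
    rw [hpt]; exact hup j _ hbox
  exact B14FlowStep.flowControl_of_avgAF (C P).flow P.K Sm hA₀ Rj hRj hrg hI hub hs (h.along hcur hγ₀ P hI) hDγ hDγ' hκ
    hsmall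

/-- **Sizes supplied** (`B14FlowStep.isRj_exists`, `L ≥ 2` from `SmallnessFor`): along every in-interval run there ARE sizes `R_j`
obeying (2.5) for which the whole list holds. [cite: Balaban1988Convergent, (2.5)–(2.9) pp.255–256 and (2.46) p.263] -/
theorem flowControl_along' {γ γ₀ β' β₀ : ℝ} (h : BetaAvgAFH s D γ₀ β) (hs : 0 < s) {C : B12.Construction}
    (hgen : ForwardGenerated C β) (hhalt : HaltsOutside C β) (hcur : CurriesHBeta C β) {L p : ℕ}
    (Sm : B14FlowStep.SmallnessFor γ β' β₀ L p) {A₀ : ℝ} (hA₀ : 0 ≤ A₀) (hγ₀ : γ ≤ γ₀)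
    (hup : BetaUpperH β' γ₀ β) (hDγ : D * γ ^ 2 ≤ β₀ * (2 + β₀)) (hDγ' : D * γ ^ 2 ≤ 1 / 2) {κ₀ : ℕ} (hκ : 6 ≤ κ₀)
    (hsmall : Real.sqrt 2 ^ (κ₀ - 6) * (2 * γ ^ 4 / s + γ ^ 6) < 1)
    (P : B12.RunParams) (hI : (C P).flow.InInterval γ P.K) :
    ∃ Rj : ℕ → ℕ, (∀ j, B14.IsRj L p ((C P).flow.g j) (Rj j)) ∧ HorizonFacts (C P).flow β' β₀ A₀ L p κ₀ Rj P.K := by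
  choose Rj hRj using fun j => B14FlowStep.isRj_exists Sm.hL p ((C P).flow.g j)
  exact ⟨Rj, hRj, h.flowControl_along hs hgen hhalt hcur Sm hA₀ hγ₀ hup hDγ hDγ' hκ hsmall P hI Rj fun j _ => hRj j⟩

/-- **(2.46) alone along an in-interval run** (no `SmallnessFor`, no sizes, no upper bound): `s > 0`, `Dγ² ≤ 1/2`,
`(√2)^{κ₀−6}(2γ⁴/s + γ⁶) < 1`, `κ₀ ≥ 6` (`B14FlowStep.sumIneq246_of_avgAF`). [cite: Balaban1988Convergent, (2.46) p.263] -/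
theorem sum246_along {γ γ₀ : ℝ} (h : BetaAvgAFH s D γ₀ β) (hs : 0 < s) {C : B12.Construction}
    (hgen : ForwardGenerated C β) (hhalt : HaltsOutside C β) (hcur : CurriesHBeta C β) (hγ₀ : γ ≤ γ₀)
    (hDγ' : D * γ ^ 2 ≤ 1 / 2) {κ₀ : ℕ} (hκ : 6 ≤ κ₀)
    (hsmall : Real.sqrt 2 ^ (κ₀ - 6) * (2 * γ ^ 4 / s + γ ^ 6) < 1)
    (P : B12.RunParams) (hI : (C P).flow.InInterval γ P.K) :
    B14FlowStep.SumIneq246 (C P).flow.g κ₀ P.K :=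
  B14FlowStep.sumIneq246_of_avgAF (C P).flow P.K hs (satisfiesRG_of_inInterval hgen hhalt hcur P hI) hI
    (h.along hcur hγ₀ P hI) hDγ' hκ hsmall

/-- **THE p. 355 READING AND THE WHOLE [III] LIST ALONG EVERY IN-INTERVAL RUN** from the carrier with `s > 0`, for a world whose
interval is small (`γ ≤ γ₀`, `β′ = w.βup`, `Dγ² ≤ β₀(2+β₀)`, `Dγ² ≤ 1/2`, `(√2)^{κ₀−6}(2γ⁴/s + γ⁶) < 1`) and which carries
`SmallnessFor w.γ w.βup w.β₀ L p`. [cite: Balaban1989LargeFieldII, p.355; Balaban1988Convergent, (2.5)–(2.9) pp.255–256 and (2.46) p.263] -/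
theorem p355_and_flowControl {γ₀ : ℝ} (h : BetaAvgAFH s D γ₀ β) (hs : 0 < s) (w : World) (hγw : 0 < w.γ)
    (hγ₀ : w.γ ≤ γ₀) (hβup : 0 ≤ w.βup) {L p : ℕ} (Sm : B14FlowStep.SmallnessFor w.γ w.βup w.β₀ L p) {A₀ : ℝ}
    (hA₀ : 0 ≤ A₀) (hDγ : D * w.γ ^ 2 ≤ w.β₀ * (2 + w.β₀)) (hDγ' : D * w.γ ^ 2 ≤ 1 / 2) {κ₀ : ℕ} (hκ : 6 ≤ κ₀)
    (hsmall : Real.sqrt 2 ^ (κ₀ - 6) * (2 * w.γ ^ 4 / s + w.γ ^ 6) < 1) (hnodes : ∀ P, Nodes (leaves w P))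
    (hgen : ForwardGenerated w.C.toB12 β) (hhalt : HaltsOutside w.C.toB12 β) (hcur : CurriesHBeta w.C.toB12 β)
    (hcont : BetaContH γ₀ β) (hup : BetaUpperH w.βup γ₀ β) :
    (B16.Sect2Unconditional w.C ∧
      ∃ Em Ep : ℝ, ∀ m : ℕ, ∃ gstar : ℝ, 0 < gstar ∧ ∀ g : ℝ, 0 < g → g ≤ gstar →
        ∀ K : ℕ, ∃ g0 : ℝ, (w.C ⟨K, m, g0⟩).flow.g K = g ∧
          ∀ k, k ≤ K → ∀ V : (w.C ⟨K, m, g0⟩).Cfg k, B16.UVIneq (w.C ⟨K, m, g0⟩) k V Em Ep) ∧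
    ∀ P : B12.RunParams, (w.C.toB12 P).flow.InInterval w.γ P.K →
      ∃ Rj : ℕ → ℕ, (∀ j, B14.IsRj L p ((w.C.toB12 P).flow.g j) (Rj j)) ∧
        HorizonFacts (w.C.toB12 P).flow w.βup w.β₀ A₀ L p κ₀ Rj P.K :=
  ⟨h.p355 hs.le w hγw hγ₀ hβup hDγ hnodes hgen hhalt hcur hcont hup,
    fun P hI => h.flowControl_along' hs hgen hhalt hcur Sm hA₀ hγ₀ hup hDγ hDγ' hκ hsmall P hI⟩

/-- **BOTH HALVES BELOW ONE THRESHOLD** (the shape `EndpointExistence` asks: one `γ₁` serving every `γ ≤ min(γ₀,γ₁)`): from the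
carrier with `s > 0` on `]0,γ₀]`, continuity, the printed-type upper bound `β′ ≥ 0`, and ONE smallness threshold `γ₁`
(`SmallnessFor γ₁ β′ β₀ L p`, `Dγ₁² ≤ β₀(2+β₀)`, `Dγ₁² ≤ 1/2`, `(√2)^{κ₀−6}(2γ₁⁴/s + γ₁⁶) < 1`): `EndpointExistence C` AND, along
every run in `]0,γ]` with `γ ≤ min(γ₀,γ₁)`, sizes and `HorizonFacts`. [cite: Balaban1987RG1, Thm 2 p.259] [cite: Balaban1988Convergent, (2.5)–(2.9) pp.255–256 and (2.46) p.263] -/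
theorem endpoint_and_flowControl {γ₀ γ₁ β' β₀ : ℝ} (h : BetaAvgAFH s D γ₀ β) (hs : 0 < s) {C : B12.Construction}
    (hgen : ForwardGenerated C β) (hhalt : HaltsOutside C β) (hcur : CurriesHBeta C β) (hγ₀ : 0 < γ₀) {L p : ℕ}
    (Sm : B14FlowStep.SmallnessFor γ₁ β' β₀ L p) {A₀ : ℝ} (hA₀ : 0 ≤ A₀) (hcont : BetaContH γ₀ β)
    (hup : BetaUpperH β' γ₀ β) (hDγ : D * γ₁ ^ 2 ≤ β₀ * (2 + β₀)) (hDγ' : D * γ₁ ^ 2 ≤ 1 / 2) {κ₀ : ℕ} (hκ : 6 ≤ κ₀)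
    (hsmall : Real.sqrt 2 ^ (κ₀ - 6) * (2 * γ₁ ^ 4 / s + γ₁ ^ 6) < 1) :
    EndpointExistence C ∧
      ∀ γ : ℝ, 0 < γ → γ ≤ min γ₀ γ₁ → ∀ P : B12.RunParams, (C P).flow.InInterval γ P.K →
        ∃ Rj : ℕ → ℕ, (∀ j, B14.IsRj L p ((C P).flow.g j) (Rj j)) ∧ HorizonFacts (C P).flow β' β₀ A₀ L p κ₀ Rj P.K := by
  have hD : 0 ≤ D := h.defect_nonneg hγ₀
  refine ⟨h.endpointExistence hs.le hgen hγ₀ Sm.β'_nonneg hcont hup, fun γ hγ hγle P hI => ?_⟩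
  have hγγ₀ : γ ≤ γ₀ := hγle.trans (min_le_left _ _)
  have hγγ₁ : γ ≤ γ₁ := hγle.trans (min_le_right _ _)
  exact h.flowControl_along' hs hgen hhalt hcur (smallnessFor_of_le Sm hγ hγγ₁) hA₀ hγγ₀ hup (defect_of_le hD hγ.le hγγ₁ hDγ)
    (defect_of_le hD hγ.le hγγ₁ hDγ') hκ (polySmall_of_le hs hγ.le hγγ₁ hsmall) P hI

/-- **READING (α) / census item C14 — THE CLAMP TRICK takes the carrier verbatim.**  For the REALISED family `β = βᴵ + δ` with
`BetaAvgAFH s D γ₀ βᴵ` (`s > 0`), the printed-type upper bound on `βᴵ`, joint continuity of `βᴵ, δ`, and `δ` conditionally small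
history-wise with threshold `s/2` (`B14DeltaBeta.CondSmallFC` lifted to histories; the lineage's READING, print asserts no bound):
`EndpointExistence` AND the [III] list along runs below one threshold
(`ConstRemainderConsumers.endpoint_and_flowControl_of_condSmallH_avgAF` fed by `onHorizon`). [cite: Balaban1987RG1, Thm 2 p.259] [cite: Balaban1988Convergent, (2.6)–(2.9) pp.255–256, (2.46) p.263, p.271, p.278] -/
theorem endpoint_and_flowControl_of_condSmallH {βfull βI δ : HBeta} {γ₀ : ℝ} (h : BetaAvgAFH s D γ₀ βI) (hs : 0 < s)
    {C : B12.Construction} (hgen : ForwardGenerated C βfull) (hhalt : HaltsOutside C βfull) (hcur : CurriesHBeta C βfull)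
    (hγ₀ : 0 < γ₀) (hsplit : ∀ k, ∀ v ∈ Box γ₀ k, βfull k v = βI k v + δ k v)
    {γ₁ β' β₀ A₀ : ℝ} {L p κ : ℕ} (Sm : B14FlowStep.SmallnessFor γ₁ (β' + s / 2) β₀ L p) (hA₀ : 0 ≤ A₀) (hβ' : 0 ≤ β')
    (hup : BetaUpperH β' γ₀ βI) (hcontI : BetaContH γ₀ βI) (hcontδ : BetaContH γ₀ δ)
    (hDγ : D * γ₁ ^ 2 ≤ β₀ * (2 + β₀)) (hDγ' : D * γ₁ ^ 2 ≤ 1 / 2) (hκ : 6 ≤ κ)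
    (hsmall : Real.sqrt 2 ^ (κ - 6) * (2 * γ₁ ^ 4 / (s / 2) + γ₁ ^ 6) < 1)
    (hcs : ∀ (F : Flow) (K : ℕ) (R : ℕ → ℕ), F.SatisfiesRG K → F.InInterval (min γ₀ γ₁) K →
      (∀ j, j ≤ K → B14.IsRj L p (F.g j) (R j)) →
      CondSmallFC F (β' + s / 2) β₀ A₀ L p κ R (fun k => δ k (prefixOf F.g k)) K (s / 2)) :
    EndpointExistence C ∧
      ∀ γ : ℝ, 0 < γ → γ ≤ min γ₀ γ₁ → ∀ P : B12.RunParams, (C P).flow.InInterval γ P.K →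
        ∃ R : ℕ → ℕ, (∀ j, B14.IsRj L p ((C P).flow.g j) (R j)) ∧
          HorizonFacts (C P).flow (β' + s / 2) β₀ A₀ L p κ R P.K :=
  endpoint_and_flowControl_of_condSmallH_avgAF hgen hhalt hcur hγ₀ hsplit Sm hA₀ hs (h.defect_nonneg hγ₀) hβ' h.onHorizon hup
    hcontI hcontδ hDγ hDγ' hκ hsmall hcs

end BetaAvgAFH

/-! ## 4. GLOSS 3′ AS ONE THEOREM; the (R11)/(R10-1′) WALL END TO END ON BOTH SIDES -/

section Gloss

variable {β : HBeta}

/-- **GLOSS 3′ IN THE KERNEL** (binding as GLOSS 3″, BETA-SPEC v1.9r §7.20 (c): the hypotheses `hAγ`, `hAγ'`, `hsmall` below are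
EXACTLY referee row R194's amendment A2 «state the γ-smallness restrictions explicitly»; the name keeps the proposal's spelling).
For a construction generated forward by (0.20) with `β`, halting outside, currying `β`: the
(R10-1′) CARRIER — a split `β = β⁰ + β¹` with `OneLoopDrift b A β⁰` (BINDER) and `−r ≤ β¹_{k+1}` on the `]0,γ₀]`-histories (BINDER)
with `r < b` STRICTLY — plus continuity (BINDER, row an4) and the printed-type upper bound `β ≤ β′` give, below ONE threshold `γ₁`
(`SmallnessFor γ₁ β′ β₀ L p`, `2Aγ₁² ≤ β₀(2+β₀)`, `2Aγ₁² ≤ 1/2`, `(√2)^{κ₀−6}(2γ₁⁴/(b−r) + γ₁⁶) < 1`): `EndpointExistence C` AND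
the whole [III] list (2.6)–(2.9) ∧ (2.46) with sizes along every run in `]0,γ]`, `γ ≤ min(γ₀,γ₁)` — the END statements Gloss 3′
names, both sides, from ONE carrier.  Never «Theorem 2 as printed» (§5(b)), never continuum / mass gap / Clay.
[cite: Balaban1987RG1, Thm 2 p.259 and (2.12)–(2.14) p.268] [cite: Balaban1988Convergent, (2.5)–(2.9) pp.255–256 and (2.46) p.263] -/
theorem gloss3'_END_of_driftConst {C : B12.Construction} (hgen : ForwardGenerated C β) (hhalt : HaltsOutside C β)
    (hcur : CurriesHBeta C β) (S : B12Beta.OneLoopSplit β) {γ₀ γ₁ b A r β' β₀ : ℝ} (hγ₀ : 0 < γ₀)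
    (hdrift : OneLoopDrift b A S.β0)
    (hlow : ∀ k (q : Fin (k + 1) → ℝ), q ∈ B12Beta.HistBox γ₀ k → -r ≤ S.β1 k q) (hrb : r < b)
    (hcont : BetaContH γ₀ β) (hup : BetaUpperH β' γ₀ β) {L p : ℕ} (Sm : B14FlowStep.SmallnessFor γ₁ β' β₀ L p)
    {A₀ : ℝ} (hA₀ : 0 ≤ A₀) (hAγ : 2 * A * γ₁ ^ 2 ≤ β₀ * (2 + β₀)) (hAγ' : 2 * A * γ₁ ^ 2 ≤ 1 / 2) {κ₀ : ℕ}
    (hκ : 6 ≤ κ₀) (hsmall : Real.sqrt 2 ^ (κ₀ - 6) * (2 * γ₁ ^ 4 / (b - r) + γ₁ ^ 6) < 1) :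
    EndpointExistence C ∧
      ∀ γ : ℝ, 0 < γ → γ ≤ min γ₀ γ₁ → ∀ P : B12.RunParams, (C P).flow.InInterval γ P.K →
        ∃ Rj : ℕ → ℕ, (∀ j, B14.IsRj L p ((C P).flow.g j) (Rj j)) ∧ HorizonFacts (C P).flow β' β₀ A₀ L p κ₀ Rj P.K :=
  (betaAvgAFH_of_driftOneSided S hdrift hlow).endpoint_and_flowControl (sub_pos.mpr hrb) hgen hhalt hcur hγ₀ Sm hA₀ hcont
    hup hAγ hAγ' hκ hsmall

variable {ι : Type*} {s : Finset ι} {cc₀ : ι → ℝ} {P Q : ι → Leg}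

/-- **THE (R11)/(R10-1′) WALL, END TO END, BOTH SIDES.**  The hypotheses of the wall declaration
`ComposedRoad.oneLoopDrift_of_composedLegInterfacePow_identity` — leg table (W1)₀ (`hdeg`, `hval`), window data (W2′)₀ (`hF`, `hG`),
(W3a)₀ (`hFtail`, `hGtail`) and identification (W3b)₀ (`hident`) for the COMPOSED coefficient along `n = Lc^m`, `IdentityForm μC β⁰`
for [H-germ′] — plus the (R10-1′) remainder `RemainderConst S γ₀ rr` with `rr < stepBal N Lc` STRICTLY, continuity (C) and the
printed-type upper bound, and ONE smallness threshold `γ₁` for the defect `2A′` and the slope `stepBal N Lc − rr`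
⟹ `EndpointExistence Cn` ∧ sizes and `HorizonFacts` ((2.6)–(2.9) ∧ (2.46)) along every run in `]0,γ]`, `γ ≤ min(γ₀,γ₁)`.
The first conjunct alone needs only `rr ≤ stepBal` (`ComposedRoad.endpointExistence_of_composedLegInterfacePow_identity_remainderConst`);
the second is the [III]-side END statement the lead's §8 does not state.  EVERY binder uninstantiated for Bałaban's objects.
[cite: Balaban1987RG1, Thm 2 p.259] [cite: Balaban1988Convergent, (2.5)–(2.9) pp.255–256 and (2.46) p.263] -/
theorem wallEND_of_composedLegInterfacePow_identity_remainderConst {Cn : B12.Construction}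
    (hgen : ForwardGenerated Cn β) (hhalt : HaltsOutside Cn β) (hcur : CurriesHBeta Cn β) (S : B12Beta.OneLoopSplit β)
    (hdeg : ∀ i ∈ s, (P i).a + (Q i).a = 6) {μ ν : Fin 4} (hμν : μ ≠ ν) {N : ℝ} (hN : N ≠ 0)
    (hval : ∀ x : E4, x ≠ 0 → x μ * x ν * contBubble s cc₀ P Q x = leadingIntegrand (kappaBal N) μ ν x)
    {Lc : ℕ} (hL : 2 ≤ Lc) {μC : ℕ → ℕ → ℝ}
    {F' G' : ι → ℕ → Pt → ℝ} {R S' R' Sg : ι → ℝ} {δ U cc : ℝ} {M : ℕ → ℕ}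
    (hR : ∀ i ∈ s, 0 ≤ R i) (hS : ∀ i ∈ s, 0 ≤ Sg i) (hR' : ∀ i ∈ s, 0 ≤ R' i) (hS' : ∀ i ∈ s, 0 ≤ S' i) (hδ : 0 < δ)
    (hc : 1 ≤ cc) (hM : ∀ L : ℕ, 2 ≤ L → 1 ≤ M L ∧ (L : ℝ) ≤ cc * M L) (hML : ∀ L : ℕ, 2 ≤ L → M L ≤ L)
    (hF : ∀ m : ℕ, 1 ≤ m → ∀ w ∈ annulus 4 0 (M (Lc ^ m)), ∀ i ∈ s,
      |F' i (Lc ^ m) w - (P i).f (Lc ^ m) 0 w| ≤ R i / ((supNorm w : ℝ) ^ ((P i).a - 2) * ((Lc ^ m : ℕ) : ℝ) ^ 2))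
    (hG : ∀ m : ℕ, 1 ≤ m → ∀ w ∈ annulus 4 0 (M (Lc ^ m)), ∀ i ∈ s,
      |G' i (Lc ^ m) w - (Q i).f (Lc ^ m) 0 w| ≤ Sg i / ((supNorm w : ℝ) ^ ((Q i).a - 2) * ((Lc ^ m : ℕ) : ℝ) ^ 2))
    (hFtail : ∀ m : ℕ, 1 ≤ m → ∀ r : ℕ, M (Lc ^ m) ≤ r → ∀ w ∈ annulus 4 r (r + 1), ∀ i ∈ s,
      |F' i (Lc ^ m) w| ≤ R' i / ((r : ℝ) + 1) ^ (P i).a * Real.exp (-(δ / ((Lc ^ m : ℕ) : ℝ)) * ((r : ℝ) + 1)))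
    (hGtail : ∀ m : ℕ, 1 ≤ m → ∀ r : ℕ, M (Lc ^ m) ≤ r → ∀ w ∈ annulus 4 r (r + 1), ∀ i ∈ s,
      |G' i (Lc ^ m) w| ≤ S' i / ((r : ℝ) + 1) ^ (Q i).a)
    (hident : ∀ m : ℕ, 1 ≤ m → ∃ R₀ : ℕ, M (Lc ^ m) ≤ R₀ ∧
      |composedCoeff μC m - ∑ w ∈ annulus 4 0 R₀, toReal w μ * toReal w ν *
        ∑ i ∈ s, cc₀ i * (F' i (Lc ^ m) w * G' i (Lc ^ m) w)| ≤ U)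
    (hid : IdentityForm μC S.β0)
    {rr γ₀ γ₁ β' β₀ : ℝ} (hγ₀ : 0 < γ₀) (hrem : RemainderConst S γ₀ rr) (hr : rr < B12Normalization.stepBal N Lc)
    (hcont : BetaContH γ₀ β) (hup : BetaUpperH β' γ₀ β) {L p : ℕ} (Sm : B14FlowStep.SmallnessFor γ₁ β' β₀ L p)
    {A₀ : ℝ} (hA₀ : 0 ≤ A₀)
    (hAγ : 2 * constA (|kappaBal N| * 24 + |kappaBal N| * 110592) (bubbleConst s cc₀ P Q)
          ((80 * (∑ i ∈ s, |cc₀ i| * (R' i * S' i)) * (1 + cc / δ) + U) +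
            80 * ∑ i ∈ s, |cc₀ i| * ((((P i).A + (P i).B) * Sg i + R i * ((Q i).A + (Q i).B) + R i * Sg i)))
          cc (kappaBal N * transverseValue) * γ₁ ^ 2 ≤ β₀ * (2 + β₀))
    (hAγ' : 2 * constA (|kappaBal N| * 24 + |kappaBal N| * 110592) (bubbleConst s cc₀ P Q)
          ((80 * (∑ i ∈ s, |cc₀ i| * (R' i * S' i)) * (1 + cc / δ) + U) +
            80 * ∑ i ∈ s, |cc₀ i| * ((((P i).A + (P i).B) * Sg i + R i * ((Q i).A + (Q i).B) + R i * Sg i)))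
          cc (kappaBal N * transverseValue) * γ₁ ^ 2 ≤ 1 / 2)
    {κ₀ : ℕ} (hκ : 6 ≤ κ₀)
    (hsmall : Real.sqrt 2 ^ (κ₀ - 6) * (2 * γ₁ ^ 4 / (B12Normalization.stepBal N Lc - rr) + γ₁ ^ 6) < 1) :
    EndpointExistence Cn ∧
      ∀ γ : ℝ, 0 < γ → γ ≤ min γ₀ γ₁ → ∀ Pr : B12.RunParams, (Cn Pr).flow.InInterval γ Pr.K →
        ∃ Rj : ℕ → ℕ, (∀ j, B14.IsRj L p ((Cn Pr).flow.g j) (Rj j)) ∧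
          HorizonFacts (Cn Pr).flow β' β₀ A₀ L p κ₀ Rj Pr.K :=
  (betaAvgAFH_of_composedLegInterfacePow_identity_remainderConst S hdeg hμν hN hval hL hR hS hR' hS' hδ hc hM hML hF hG hFtail
    hGtail hident hid hrem).endpoint_and_flowControl (sub_pos.mpr hr) hgen hhalt hcur hγ₀ Sm hA₀ hcont hup hAγ hAγ' hκ hsmall

/-- **THE WALL IN PRINT'S SHAPE, END TO END, BOTH SIDES**: as above with `SeparationRate C θ μC β⁰` for [H-germ′]; defect
`2(A′ + Cθ/(1−θ))`. [cite: Balaban1987RG1, Thm 2 p.259, (4.35)–(4.36) p.290] [cite: Balaban1988Convergent, (2.5)–(2.9) pp.255–256 and (2.46) p.263] -/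
theorem wallEND_of_composedLegInterfacePow_remainderConst {Cn : B12.Construction}
    (hgen : ForwardGenerated Cn β) (hhalt : HaltsOutside Cn β) (hcur : CurriesHBeta Cn β) (S : B12Beta.OneLoopSplit β)
    (hdeg : ∀ i ∈ s, (P i).a + (Q i).a = 6) {μ ν : Fin 4} (hμν : μ ≠ ν) {N : ℝ} (hN : N ≠ 0)
    (hval : ∀ x : E4, x ≠ 0 → x μ * x ν * contBubble s cc₀ P Q x = leadingIntegrand (kappaBal N) μ ν x)
    {Lc : ℕ} (hL : 2 ≤ Lc) {μC : ℕ → ℕ → ℝ}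
    {F' G' : ι → ℕ → Pt → ℝ} {R S' R' Sg : ι → ℝ} {δ U cc : ℝ} {M : ℕ → ℕ}
    (hR : ∀ i ∈ s, 0 ≤ R i) (hS : ∀ i ∈ s, 0 ≤ Sg i) (hR' : ∀ i ∈ s, 0 ≤ R' i) (hS' : ∀ i ∈ s, 0 ≤ S' i) (hδ : 0 < δ)
    (hc : 1 ≤ cc) (hM : ∀ L : ℕ, 2 ≤ L → 1 ≤ M L ∧ (L : ℝ) ≤ cc * M L) (hML : ∀ L : ℕ, 2 ≤ L → M L ≤ L)
    (hF : ∀ m : ℕ, 1 ≤ m → ∀ w ∈ annulus 4 0 (M (Lc ^ m)), ∀ i ∈ s,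
      |F' i (Lc ^ m) w - (P i).f (Lc ^ m) 0 w| ≤ R i / ((supNorm w : ℝ) ^ ((P i).a - 2) * ((Lc ^ m : ℕ) : ℝ) ^ 2))
    (hG : ∀ m : ℕ, 1 ≤ m → ∀ w ∈ annulus 4 0 (M (Lc ^ m)), ∀ i ∈ s,
      |G' i (Lc ^ m) w - (Q i).f (Lc ^ m) 0 w| ≤ Sg i / ((supNorm w : ℝ) ^ ((Q i).a - 2) * ((Lc ^ m : ℕ) : ℝ) ^ 2))
    (hFtail : ∀ m : ℕ, 1 ≤ m → ∀ r : ℕ, M (Lc ^ m) ≤ r → ∀ w ∈ annulus 4 r (r + 1), ∀ i ∈ s,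
      |F' i (Lc ^ m) w| ≤ R' i / ((r : ℝ) + 1) ^ (P i).a * Real.exp (-(δ / ((Lc ^ m : ℕ) : ℝ)) * ((r : ℝ) + 1)))
    (hGtail : ∀ m : ℕ, 1 ≤ m → ∀ r : ℕ, M (Lc ^ m) ≤ r → ∀ w ∈ annulus 4 r (r + 1), ∀ i ∈ s,
      |G' i (Lc ^ m) w| ≤ S' i / ((r : ℝ) + 1) ^ (Q i).a)
    (hident : ∀ m : ℕ, 1 ≤ m → ∃ R₀ : ℕ, M (Lc ^ m) ≤ R₀ ∧
      |composedCoeff μC m - ∑ w ∈ annulus 4 0 R₀, toReal w μ * toReal w ν *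
        ∑ i ∈ s, cc₀ i * (F' i (Lc ^ m) w * G' i (Lc ^ m) w)| ≤ U)
    {C θ : ℝ} (hC : 0 ≤ C) (hθ0 : 0 ≤ θ) (hθ1 : θ < 1) (hsep : SeparationRate C θ μC S.β0)
    {rr γ₀ γ₁ β' β₀ : ℝ} (hγ₀ : 0 < γ₀) (hrem : RemainderConst S γ₀ rr) (hr : rr < B12Normalization.stepBal N Lc)
    (hcont : BetaContH γ₀ β) (hup : BetaUpperH β' γ₀ β) {L p : ℕ} (Sm : B14FlowStep.SmallnessFor γ₁ β' β₀ L p)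
    {A₀ : ℝ} (hA₀ : 0 ≤ A₀)
    (hAγ : 2 * (constA (|kappaBal N| * 24 + |kappaBal N| * 110592) (bubbleConst s cc₀ P Q)
          ((80 * (∑ i ∈ s, |cc₀ i| * (R' i * S' i)) * (1 + cc / δ) + U) +
            80 * ∑ i ∈ s, |cc₀ i| * ((((P i).A + (P i).B) * Sg i + R i * ((Q i).A + (Q i).B) + R i * Sg i)))
          cc (kappaBal N * transverseValue) + C * θ / (1 - θ)) * γ₁ ^ 2 ≤ β₀ * (2 + β₀))
    (hAγ' : 2 * (constA (|kappaBal N| * 24 + |kappaBal N| * 110592) (bubbleConst s cc₀ P Q)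
          ((80 * (∑ i ∈ s, |cc₀ i| * (R' i * S' i)) * (1 + cc / δ) + U) +
            80 * ∑ i ∈ s, |cc₀ i| * ((((P i).A + (P i).B) * Sg i + R i * ((Q i).A + (Q i).B) + R i * Sg i)))
          cc (kappaBal N * transverseValue) + C * θ / (1 - θ)) * γ₁ ^ 2 ≤ 1 / 2)
    {κ₀ : ℕ} (hκ : 6 ≤ κ₀)
    (hsmall : Real.sqrt 2 ^ (κ₀ - 6) * (2 * γ₁ ^ 4 / (B12Normalization.stepBal N Lc - rr) + γ₁ ^ 6) < 1) :
    EndpointExistence Cn ∧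
      ∀ γ : ℝ, 0 < γ → γ ≤ min γ₀ γ₁ → ∀ Pr : B12.RunParams, (Cn Pr).flow.InInterval γ Pr.K →
        ∃ Rj : ℕ → ℕ, (∀ j, B14.IsRj L p ((Cn Pr).flow.g j) (Rj j)) ∧
          HorizonFacts (Cn Pr).flow β' β₀ A₀ L p κ₀ Rj Pr.K :=
  (betaAvgAFH_of_composedLegInterfacePow_remainderConst S hdeg hμν hN hval hL hR hS hR' hS' hδ hc hM hML hF hG hFtail hGtail
    hident hC hθ0 hθ1 hsep hrem).endpoint_and_flowControl (sub_pos.mpr hr) hgen hhalt hcur hγ₀ Sm hA₀ hcont hup hAγ hAγ' hκ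
    hsmall

/-- **GLOSS 2 ⟹ GLOSS 3′'s CONSUMERS through the carrier** (check of the factorisation): `EventualForm E` gives both halves below
one threshold, slope `E.b`, defect `(E.b+E.β′)E.k₀` — the content of `FlowConsumers.eventualForm_flowControl_along` +
`Assembly.EventualForm.endpointExistence`, now via `BetaAvgAFH`. [folklore] -/
theorem gloss2_END_via_carrier (E : EventualForm β) {C : B12.Construction} (hgen : ForwardGenerated C β)
    (hhalt : HaltsOutside C β) (hcur : CurriesHBeta C β) {γ₁ β₀ : ℝ} {L p : ℕ}
    (Sm : B14FlowStep.SmallnessFor γ₁ E.β' β₀ L p) {A₀ : ℝ} (hA₀ : 0 ≤ A₀)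
    (hDγ : (E.b + E.β') * E.k₀ * γ₁ ^ 2 ≤ β₀ * (2 + β₀)) (hDγ' : (E.b + E.β') * E.k₀ * γ₁ ^ 2 ≤ 1 / 2) {κ₀ : ℕ}
    (hκ : 6 ≤ κ₀) (hsmall : Real.sqrt 2 ^ (κ₀ - 6) * (2 * γ₁ ^ 4 / E.b + γ₁ ^ 6) < 1) :
    EndpointExistence C ∧
      ∀ γ : ℝ, 0 < γ → γ ≤ min E.γ₀ γ₁ → ∀ P : B12.RunParams, (C P).flow.InInterval γ P.K →
        ∃ Rj : ℕ → ℕ, (∀ j, B14.IsRj L p ((C P).flow.g j) (Rj j)) ∧ HorizonFacts (C P).flow E.β' β₀ A₀ L p κ₀ Rj P.K :=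
  (betaAvgAFH_of_eventualForm E).endpoint_and_flowControl E.b_pos hgen hhalt hcur E.γ₀_pos Sm hA₀ E.cont E.upper hDγ hDγ' hκ
    hsmall

end Gloss

/-! ## 5. HONESTY WITNESSES: (a) the slope is needed for C8; (b) the carrier is one of PARTIAL SUMS — strictly below Gloss 2 -/

namespace Margin

open Literature.MathematicalPhysics.QuantumFieldTheory.Balaban1983to89.Beta.ConstRemainderConsumers.Margin
  (betaM partialSums)

/-- The margin family of `ConstRemainderConsumers` §2 (`β_{k+1}(p) = b − b·p_k/γ`) sits EXACTLY at slope 0: it is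
`BetaAvgAFH 0 0 γ` (`b ≥ 0`, `γ > 0`) … [folklore] -/
theorem avgAFH_zero {b γ : ℝ} (hb : 0 ≤ b) (hγ : 0 < γ) : BetaAvgAFH 0 0 γ (betaM b γ) :=
  BetaAvgAFH.zero_iff.mpr (partialSums hb hγ)

/-- … and `BetaAvgAFH s D γ` for NO `s > 0`, whatever the defect `D`: along the constant history `g ≡ γ` every `β_{k+1}` vanishes,
so the window sums are `0 < s(n − 0) − D` for `n > D/s`.  Together with `ConstRemainderConsumers.Margin.sum246_fails` (recorded
below by name): consumer C8 = (2.46) fails EXACTLY where the slope vanishes. [folklore] -/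
theorem not_avgAFH_pos {b γ s D : ℝ} (hγ : 0 < γ) (hs : 0 < s) : ¬ BetaAvgAFH s D γ (betaM b γ) := by
  intro h
  -- the constant history at the top of the interval: every β-value vanishes there
  have hzero : ∀ j, betaM b γ j (prefixOf (fun _ => γ) j) = 0 := fun j => by
    simp [betaM, prefixOf, div_self hγ.ne']
  have h1 := h (fun _ => γ) (fun _ => ⟨hγ, le_rfl⟩) 0 (⌈D / s⌉₊ + 1) (Nat.zero_le _)
  simp only [hzero, Finset.sum_const_zero, Nat.cast_zero, sub_zero, Nat.cast_add, Nat.cast_one] at h1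
  have hceil : D / s ≤ (⌈D / s⌉₊ : ℝ) := Nat.le_ceil _
  have hD' : D ≤ s * (⌈D / s⌉₊ : ℝ) := by
    have := (div_le_iff₀ hs).mp hceil
    linarith
  have hexp : s * ((⌈D / s⌉₊ : ℝ) + 1) = s * (⌈D / s⌉₊ : ℝ) + s := by ring
  rw [hexp] at h1
  linarith

/-- **(a) recorded**: for every `0 < γ ≤ 1`, `b ≥ 0`, `κ₀` there is a family at slope EXACTLY 0 of the carrier (with the drift, the
two-sided constant remainder at the margin `r = b`, continuity, the printed-type upper bound, even the sign) along a currying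
(0.20)-run of which (2.46) FAILS (`ConstRemainderConsumers.Margin.sum246_fails`, by name). [cite: Balaban1988Convergent, (2.46) p.263] -/
theorem slope_zero_not_enough {γ b : ℝ} (hγ : 0 < γ) (hγ1 : γ ≤ 1) (hb : 0 ≤ b) (κ₀ : ℕ) :
    ∃ β : HBeta, BetaAvgAFH 0 0 γ β ∧ (∀ s D : ℝ, 0 < s → ¬ BetaAvgAFH s D γ β) ∧ BetaContH γ β ∧ BetaUpperH b γ β ∧
      ∃ (K : ℕ) (F : Flow), F.SatisfiesRG K ∧ F.InInterval γ K ∧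
        (∀ j x, F.β (j + 1) x = β j (Function.update (prefixOf F.g j) (Fin.last j) x)) ∧
        ¬ B14FlowStep.SumIneq246 F.g κ₀ K := by
  obtain ⟨hrg, hI, hcur⟩ := ConstRemainderConsumers.Margin.constRun b hγ (⌈(γ ^ κ₀)⁻¹⌉₊ + 1)
  exact ⟨betaM b γ, avgAFH_zero hb hγ, fun s D hs => not_avgAFH_pos hγ hs, ConstRemainderConsumers.Margin.cont b γ γ,
    (ConstRemainderConsumers.Margin.upper_and_sign hb hγ).1, ⌈(γ ^ κ₀)⁻¹⌉₊ + 1, ⟨fun _ => γ, fun _ x => b - b * (x / γ)⟩,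
    hrg, hI, hcur, ConstRemainderConsumers.Margin.not_sum246_const hγ hγ1 κ₀⟩

end Margin

namespace Osc

/-- The OSCILLATING witness family (history-free): `β_{k+1} = s + c·(−1)^k`. [folklore] -/
def betaO (s c : ℝ) : HBeta := fun k _ => s + c * (-1) ^ k

/-- Window sums of `(−1)^j` over `[k,n)` lie in `[−1, 1]` (induction on `n`). [folklore] -/
theorem abs_sum_negOnePow_le (k n : ℕ) (hkn : k ≤ n) : |∑ j ∈ Finset.Ico k n, ((-1 : ℝ)) ^ j| ≤ 1 := by
  -- closed form: the sum is `((−1)^k − (−1)^n)/2`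
  have hclosed : ∑ j ∈ Finset.Ico k n, ((-1 : ℝ)) ^ j = ((-1 : ℝ) ^ k - (-1) ^ n) / 2 := by
    induction n, hkn using Nat.le_induction with
    | base => simp
    | succ m hkm ih =>
      rw [Finset.sum_Ico_succ_top hkm, ih, pow_succ]
      ring
  rw [hclosed]
  have hk : |((-1 : ℝ)) ^ k| = 1 := by rw [abs_pow, abs_neg, abs_one, one_pow]
  have hn : |((-1 : ℝ)) ^ n| = 1 := by rw [abs_pow, abs_neg, abs_one, one_pow]
  have h1 := abs_le.mp (le_of_eq hk)
  have h2 := abs_le.mp (le_of_eq hn)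
  rw [abs_le]
  constructor <;> linarith [h1.1, h1.2, h2.1, h2.2]

/-- **The oscillating family CARRIES averaged asymptotic freedom**: `BetaAvgAFH s c γ (betaO s c)` for every `γ` and `c ≥ 0`
(window sums `= s(n−k) + c·Σ(−1)^j ≥ s(n−k) − c`). [folklore] -/
theorem avgAFH (s γ : ℝ) {c : ℝ} (hc : 0 ≤ c) : BetaAvgAFH s c γ (betaO s c) := by
  intro g _ k n hkn
  have hsum : ∑ j ∈ Finset.Ico k n, betaO s c j (prefixOf g j)
      = s * ((n : ℝ) - k) + c * ∑ j ∈ Finset.Ico k n, ((-1 : ℝ)) ^ j := by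
    simp only [betaO]
    rw [Finset.sum_add_distrib, Finset.sum_const, Nat.card_Ico, nsmul_eq_mul, Nat.cast_sub hkn, ← Finset.mul_sum]
    ring
  rw [hsum]
  have h1 := (abs_le.mp (abs_sum_negOnePow_le k n hkn)).1
  nlinarith

/-- It is continuous on every box and obeys the printed-type two-sided bound `|β| ≤ s + c` there (`s, c ≥ 0`). [folklore] -/
theorem cont_and_bounds {s c : ℝ} (hs : 0 ≤ s) (hc : 0 ≤ c) (γ : ℝ) :
    BetaContH γ (betaO s c) ∧ BetaUpperH (s + c) γ (betaO s c) ∧ ∀ k, ∀ v ∈ Box γ k, -(s + c) ≤ betaO s c k v := by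
  have hpow : ∀ k : ℕ, -1 ≤ ((-1 : ℝ)) ^ k ∧ ((-1 : ℝ)) ^ k ≤ 1 := fun k => by
    have : |((-1 : ℝ)) ^ k| = 1 := by rw [abs_pow, abs_neg, abs_one, one_pow]
    exact abs_le.mp this.le
  refine ⟨fun k => continuousOn_const, fun k v _ => ?_, fun k v _ => ?_⟩
  · show s + c * (-1) ^ k ≤ s + c
    nlinarith [(hpow k).2]
  · show -(s + c) ≤ s + c * (-1) ^ k
    nlinarith [(hpow k).1]

/-- **… yet at every ODD scale the β-function is NEGATIVE on the whole box** when `s < c`: `β_{2m+2} = s − c < 0`.  So the carrier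
is NOT of (AF-0s) grade (`FlowStep.BetaLowerH b`, `b > 0`, fails) — it is a statement about PARTIAL SUMS, not about the sign of any
single `β_{k+1}`; in particular it is not «[Balaban1987RG1] Theorem 2 as printed» material (RULING (R6)). [folklore] -/
theorem neg_at_odd {s c : ℝ} (hsc : s < c) (m : ℕ) (v : Fin (2 * m + 1 + 1) → ℝ) : betaO s c (2 * m + 1) v < 0 := by
  show s + c * (-1) ^ (2 * m + 1) < 0
  rw [pow_succ, pow_mul]
  norm_num
  linarith

/-- No pointwise positive lower bound on any box family: `¬ BetaLowerH b γ (betaO s c)` for `b > 0`, `γ > 0`, `s < c`. [folklore] -/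
theorem not_betaLowerH {s c b γ : ℝ} (hsc : s < c) (hb : 0 < b) (hγ : 0 < γ) : ¬ BetaLowerH b γ (betaO s c) := by
  intro h
  have hmem : (fun _ : Fin (2 * 0 + 1 + 1) => γ) ∈ Box γ (2 * 0 + 1) := mem_box.mpr fun _ => ⟨hγ, le_rfl⟩
  have h1 := h (2 * 0 + 1) _ hmem
  have h2 := neg_at_odd hsc 0 (fun _ => γ)
  linarith

/-- **NOT OF GLOSS-2 GRADE**: the oscillating family admits NO `EventualForm` (no scale `k₀` after which `β_{k+1} ≥ b > 0` on the
boxes — every odd scale beyond `k₀` refutes it).  With `avgAFH` and §3: Gloss 3′'s carrier grade is STRICTLY WEAKER than Gloss 2's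
`EventualForm` grade, yet serves the same located consumers. [folklore] -/
theorem not_eventualForm {s c : ℝ} (hsc : s < c) (E : EventualForm (betaO s c)) : False := by
  have hk : E.k₀ ≤ 2 * E.k₀ + 1 := by omega
  have hmem : (fun _ : Fin (2 * E.k₀ + 1 + 1) => E.γ₀) ∈ Box E.γ₀ (2 * E.k₀ + 1) :=
    mem_box.mpr fun _ => ⟨E.γ₀_pos, le_rfl⟩
  have h1 := E.tail (2 * E.k₀ + 1) hk _ hmem
  have h2 := neg_at_odd hsc E.k₀ (fun _ => E.γ₀)
  linarith [E.b_pos]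

/-- Its split along [Balaban1987RG1] (2.12)–(2.14): one-loop part `β⁰_{k+1} = s + c(−1)^k` (history-free), remainder `β¹ ≡ 0`
(vanishing at zero coupling trivially). [folklore] -/
def splitO (s c : ℝ) : B12Beta.OneLoopSplit (betaO s c) where
  β0 := fun k => s + c * (-1) ^ k
  β1 := fun _ _ => 0
  split := fun k p => by simp [betaO]
  vanish := fun _ _ _ => rfl

/-- The one-loop part DRIFTS with slope `s` and constant `c` (`c ≥ 0`): `|Σ_{j<k} β⁰_j − s k| = c·|Σ_{j<k}(−1)^j| ≤ c` — row an1's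
`OneLoopDrift s c`, with NO sign of any single `β⁰_{k+1}` when `s < c`. [folklore] -/
theorem drift (s : ℝ) {c : ℝ} (hc : 0 ≤ c) : OneLoopDrift s c (splitO s c).β0 := by
  intro k
  have hsum : ∑ j ∈ Finset.range k, (splitO s c).β0 j = s * (k : ℝ) + c * ∑ j ∈ Finset.range k, ((-1 : ℝ)) ^ j := by
    simp only [splitO]
    rw [Finset.sum_add_distrib, Finset.sum_const, Finset.card_range, nsmul_eq_mul, ← Finset.mul_sum]
    ring
  rw [hsum, show s * (k : ℝ) + c * ∑ j ∈ Finset.range k, ((-1 : ℝ)) ^ j - s * k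
      = c * ∑ j ∈ Finset.range k, ((-1 : ℝ)) ^ j by ring, abs_mul, abs_of_nonneg hc]
  refine mul_le_of_le_one_right hc ?_
  rw [Finset.range_eq_Ico]
  exact abs_sum_negOnePow_le 0 k (Nat.zero_le k)

/-- The remainder obeys the constant form with `r = 0` on every box (two-sided, `RemainderChain.RemainderConst`). [folklore] -/
theorem remainderConst (s c γ : ℝ) : RemainderConst (splitO s c) γ 0 := by
  intro k p _
  show |(0 : ℝ)| ≤ 0
  rw [abs_zero]

/-- **THE LITERAL (R10-1′) CARRIER ADMITS FAMILIES OUTSIDE GLOSS 2.**  For every slope `s > 0`: a history family with a split whose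
one-loop part drifts with slope `s` (constant `2s`), whose remainder obeys the constant form with `r = 0 < s` STRICTLY (so RULING
(R10-1′)'s carrier hypotheses hold on EVERY interval), continuous and two-sidedly bounded (printed type) — which has NO pointwise
positive lower bound on any box and NO `EventualForm`.  By §3/§4 it is served every located consumer nonetheless. [folklore] -/
theorem literal_carrier_outside_gloss2 {s : ℝ} (hs : 0 < s) :
    ∃ (β : HBeta) (S : B12Beta.OneLoopSplit β), OneLoopDrift s (2 * s) S.β0 ∧ (∀ γ, RemainderConst S γ 0) ∧
      (∀ γ, BetaContH γ β ∧ BetaUpperH (3 * s) γ β ∧ ∀ k, ∀ v ∈ Box γ k, -(3 * s) ≤ β k v) ∧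
      (∀ b γ : ℝ, 0 < b → 0 < γ → ¬ BetaLowerH b γ β) ∧ (EventualForm β → False) := by
  have hsc : s < 2 * s := by linarith
  refine ⟨betaO s (2 * s), splitO s (2 * s), drift s (by linarith), remainderConst s (2 * s), fun γ => ?_,
    fun b γ hb hγ => not_betaLowerH hsc hb hγ, fun E => not_eventualForm hsc E⟩
  have h := cont_and_bounds hs.le (by linarith : (0 : ℝ) ≤ 2 * s) γ
  have e : s + 2 * s = 3 * s := by ring
  rw [e] at h
  exact h

/-- **(b) recorded**: for every slope `s > 0` there is a history family that CARRIES averaged asymptotic freedom with slope `s`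
(defect `2s`, any interval), is continuous and two-sidedly bounded (printed type), is served EVERY located consumer by §3 — and has
NO pointwise positive lower bound on any box and NO `EventualForm`.  [folklore] -/
theorem carrier_strictly_below_gloss2 {s : ℝ} (hs : 0 < s) :
    ∃ β : HBeta, (∀ γ, BetaAvgAFH s (2 * s) γ β) ∧ (∀ γ, BetaContH γ β ∧ BetaUpperH (3 * s) γ β) ∧
      (∀ b γ : ℝ, 0 < b → 0 < γ → ¬ BetaLowerH b γ β) ∧ (EventualForm β → False) := by
  have hsc : s < 2 * s := by linarith
  refine ⟨betaO s (2 * s), fun γ => avgAFH s γ (by linarith), fun γ => ?_, fun b γ hb hγ => not_betaLowerH hsc hb hγ,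
    fun E => not_eventualForm hsc E⟩
  obtain ⟨hc, hu, -⟩ := cont_and_bounds hs.le (by linarith : (0 : ℝ) ≤ 2 * s) γ
  have e : s + 2 * s = 3 * s := by ring
  rw [e] at hu
  exact ⟨hc, hu⟩

/-- The oscillating carrier is CONSUMED: any construction forward-generated with it gets endpoint existence from §3 with `s ≥ 0` — a
SHAPE check of `BetaAvgAFH.endpointExistence`'s hypothesis list on a family outside Gloss 2 (referee record R-g26-1; the INHABITED
version, `C := FlowStepRuns.modelOf _`, is §6's `endpointExistence_modelOf` / `inhabited`). [folklore] -/
theorem endpointExistence_example {s : ℝ} (hs : 0 < s) {γ₀ : ℝ} (hγ₀ : 0 < γ₀) {C : B12.Construction}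
    (hgen : ForwardGenerated C (betaO s (2 * s))) : EndpointExistence C := by
  obtain ⟨hc, hu, -⟩ := cont_and_bounds hs.le (by linarith : (0 : ℝ) ≤ 2 * s) γ₀
  exact (avgAFH s γ₀ (by linarith : (0 : ℝ) ≤ 2 * s)).endpointExistence hs.le hgen hγ₀ (by linarith) hc hu

end Osc

/-! ### 5(c) (v1.2) The converse direction: a Gloss-2 family that is NO literal split carrier — the two carriers meet ONLY in `BetaAvgAFH`

Referee row R194 (A1): «the SPLIT carrier `OneLoopDrift ∧ (−r ≤ β¹, r < stepBal)` itself is not implied by `EventualForm`».  Kernel reason, recorded here: a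
`B12Beta.OneLoopSplit β` EXISTS iff `β_{k+1}(g_0,…,g_{k−1},0)` does not depend on `g_0,…,g_{k−1}` ([Balaban1987RG1] (2.14): `β¹_{k+1}(…,0) = 0`, so
`β_{k+1}(…,0) = β⁰_{k+1}` is history-free) — a STRUCTURAL property that `EventualForm` does not carry.  For Bałaban's (1.22) the split (2.12)–(2.14) is PRINTED
structure (β⁰ history-free by construction), so this is a statement about the cell's hypothesis CARRIERS, not an objection to anything printed. -/

namespace NoSplit

/-- The witness family `β_{k+1}(g_0,…,g_k) = b + c·g_0` (depends on the FIRST coupling of the history only). [folklore] -/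
def betaN (b c : ℝ) : HBeta := fun _ p => b + c * p 0

/-- It is of Gloss-2 grade: an `EventualForm` with `k₀ = 0`, tail bound `b`, two-sided bound `b + cγ₀` (`b, γ₀ > 0`, `c ≥ 0`). [folklore] -/
def eventualForm {b c γ₀ : ℝ} (hb : 0 < b) (hc : 0 ≤ c) (hγ₀ : 0 < γ₀) : EventualForm (betaN b c) where
  γ₀ := γ₀
  γ₀_pos := hγ₀
  b := b
  b_pos := hb
  k₀ := 0
  tail := fun k _ v hv => by
    have h0 := (mem_box.mp hv) 0
    show b ≤ b + c * v 0
    nlinarith [h0.1]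
  β' := b + c * γ₀
  upper := fun k v hv => by
    have h0 := (mem_box.mp hv) 0
    show b + c * v 0 ≤ b + c * γ₀
    nlinarith [h0.2]
  lower := fun k v hv => by
    have h0 := (mem_box.mp hv) 0
    show -(b + c * γ₀) ≤ b + c * v 0
    nlinarith [h0.1, hγ₀.le]
  cont := fun k => by
    have : Continuous (betaN b c k) := by unfold betaN; fun_prop
    exact this.continuousOn

/-- **No split at all** when `c ≠ 0`: at scale `k = 1` the two histories `(1, 0)` and `(2, 0)` end at zero coupling but give different values `b + c ≠ b + 2c`,
contradicting `β_2(g_0, 0) = β⁰_2` ((2.14)). [folklore] -/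
theorem no_split {b c : ℝ} (hc : c ≠ 0) (S : B12Beta.OneLoopSplit (betaN b c)) : False := by
  have key : ∀ x : ℝ, betaN b c 1 (fun i => if (i : ℕ) = 0 then x else 0) = S.β0 1 := by
    intro x
    have hv := S.vanish 1 (fun i => if (i : ℕ) = 0 then x else 0) (by simp [Fin.last])
    have hs := S.split 1 (fun i => if (i : ℕ) = 0 then x else 0)
    rw [hv, add_zero] at hs
    exact hs
  have h1 := key 1
  have h2 := key 2
  simp only [betaN, Fin.val_zero, if_true] at h1 h2
  have : c = 0 := by linarith
  exact hc this

/-- **(c) recorded — GLOSS 2 ⇏ THE LITERAL (R10-1′) CARRIER**: for all `b, c, γ₀ > 0` a history family of `EventualForm` grade (hence `BetaAvgAFH b (b+cγ₀)·0 …` by §2 and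
served every located consumer by §3) that admits NO `B12Beta.OneLoopSplit` whatsoever — so in particular no split with drift and one-sided remainder.  With
`Osc.literal_carrier_outside_gloss2`: the Gloss-2 carrier and the literal Gloss-3″ carrier are INCOMPARABLE; they meet only in the END grade with slope `BetaAvgAFH`,
through which both are consumed. [folklore] -/
theorem gloss2_not_literal_carrier {b c γ₀ : ℝ} (hb : 0 < b) (hc : 0 < c) (hγ₀ : 0 < γ₀) :
    ∃ β : HBeta, Nonempty (EventualForm β) ∧ (B12Beta.OneLoopSplit β → False) ∧ BetaAvgAFH b 0 γ₀ β := by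
  refine ⟨betaN b c, ⟨eventualForm hb hc.le hγ₀⟩, fun S => no_split hc.ne' S, ?_⟩
  have h := betaAvgAFH_of_eventualForm (eventualForm hb hc.le hγ₀)
  -- k₀ = 0: the defect `(b + β′)·0` vanishes
  simpa [eventualForm] using h

end NoSplit

/-! ## 6. (v1.3) INHABITED WITNESSES — the §5 families GENERATE honest constructions (referee record R-g26-1 in the kernel)

Referee record R-g26-1 (REFEREE-BETA §27, R202 (c)): `Osc.endpointExistence_example` is conditional on
`hgen : ForwardGenerated C (betaO …)` — «it checks the hypothesis SHAPE, not the inhabitation of a forward-generated construction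
for betaO».  The construction CANONICALLY GENERATED by a β-family, `FlowStepRuns.modelOf β` ([Balaban1987RG1] (0.17)–(0.20): run
(0.20) forward from the bare coupling by the positive root, `0` once the right side is `≤ 0`; all non-flow data trivial), is
`ForwardGenerated ∧ HaltsOutside ∧ CurriesHBeta` for EVERY `β` (`FlowStepRuns` §6).  Feeding it to §3/§5 turns the three shape checks
into INHABITED statements:
(a) the oscillating literal (R10-1′) carrier `betaO s (2s)`: `EndpointExistence (modelOf (betaO s (2s)))` outright (`s > 0`), and —
    below ONE explicit threshold — sizes and the whole [III] list (2.6)–(2.9) ∧ (2.46) along EVERY in-interval run of that construction,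
    whose realised β-values are `−s < 0` at every odd scale; with the cell's own numbers (`γ₁ = e^{−10}`, `β′ = 1`, `β₀ = ½`, `L = p = 2`,
    `κ₀ = 7`, `s = ⅓`) a CLOSED existence statement: an honest construction, generated by a family with NO pointwise positive lower bound
    on any box and NO `EventualForm`, that HAS endpoint existence, HAS in-interval runs of every length ending at every small prescribed
    coupling, and satisfies the [III] list along every one of them (`Osc.inhabited`).  (Compare `FlowStepRuns.sign_not_necessary`, which
    inhabits endpoint existence alone, for `betaAlt`, whose partial sums carry NO slope.)
(b) the margin family `betaM b γ`: the run of `modelOf (betaM b γ)` from the bare coupling `γ` is the CONSTANT run `g_k ≡ γ`, inside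
    `]0,γ]` at every horizon; the construction HAS endpoint existence (its family even has the sign on the boxes) and that run VIOLATES
    (2.46) at the horizon `⌈γ^{−κ₀}⌉ + 1` — consumer C8 fails along an actual run of an honest construction with endpoint existence:
    the slope is needed, inhabited (`Margin.slope_zero_not_enough_inhabited`).
(c) the no-split Gloss-2 family `betaN b c`: `modelOf (betaN b c)` gets both halves below one threshold (`gloss2_END_via_carrier`).
Elementary over the tree's own objects; nothing of the series; NOT a statement about Bałaban's (1.22). -/

namespace Osc

/-- **(a1) ENDPOINT EXISTENCE, INHABITED**: the canonical construction generated by the oscillating carrier `betaO s (2s)` (`s > 0`)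
satisfies `DagBinding.EndpointExistence` — §5(b)'s `endpointExistence_example` with `hgen := FlowStepRuns.modelOf_forwardGenerated _`;
no hypothesis is left but `s > 0`. [folklore] -/
theorem endpointExistence_modelOf {s : ℝ} (hs : 0 < s) : EndpointExistence (modelOf (betaO s (2 * s))) :=
  endpointExistence_example hs one_pos (modelOf_forwardGenerated _)

/-- **(a2)** Along EVERY run of that construction the realised β-function of each ODD scale is the negative constant `−s`: the
run-wise β-functions of `modelOf β` curry `β` definitionally, and `betaO s (2s) (2m+1) ≡ s − 2s`. [folklore] -/
theorem realised_neg_at_odd_modelOf {s : ℝ} (hs : 0 < s) (P : B12.RunParams) (m : ℕ) (x : ℝ) :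
    (modelOf (betaO s (2 * s)) P).flow.β (2 * m + 1 + 1) x < 0 := by
  have hsc : s < 2 * s := by linarith
  have h : (modelOf (betaO s (2 * s)) P).flow.β (2 * m + 1 + 1) x
      = betaO s (2 * s) (2 * m + 1)
          (Function.update (prefixOf (modelOf (betaO s (2 * s)) P).flow.g (2 * m + 1)) (Fin.last _) x) := rfl
  rw [h]
  exact neg_at_odd hsc m _

/-- **(a3) BOTH HALVES FOR THE HONEST CONSTRUCTION OF A SIGN-INDEFINITE CARRIER, below ONE threshold.**  For `s > 0` and a threshold
`γ₁ > 0` with `SmallnessFor γ₁ (3s) β₀ L p` (the printed-type two-sided bound of `betaO s (2s)` is `3s`), `2s·γ₁² ≤ β₀(2+β₀)`,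
`2s·γ₁² ≤ 1/2`, `(√2)^{κ₀−6}(2γ₁⁴/s + γ₁⁶) < 1`, `κ₀ ≥ 6`: `EndpointExistence (modelOf (betaO s (2s)))` AND, along every run of
`modelOf (betaO s (2s))` staying in `]0,γ]` (`γ ≤ γ₁`) up to its horizon, sizes `R_j` by (2.5) and `HorizonFacts` = (2.6)–(2.9) with the
printed constants ∧ (2.46) — §3's `endpoint_and_flowControl` fed with `FlowStepRuns.modelOf_forwardGenerated/_haltsOutside/_curries`.
[cite: Balaban1987RG1, Thm 2 p.259] [cite: Balaban1988Convergent, (2.5)–(2.9) pp.255–256 and (2.46) p.263] -/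
theorem endpoint_and_flowControl_modelOf {s : ℝ} (hs : 0 < s) {γ₁ β₀ : ℝ} (hγ₁ : 0 < γ₁) {L p : ℕ}
    (Sm : B14FlowStep.SmallnessFor γ₁ (3 * s) β₀ L p) {A₀ : ℝ} (hA₀ : 0 ≤ A₀)
    (hDγ : 2 * s * γ₁ ^ 2 ≤ β₀ * (2 + β₀)) (hDγ' : 2 * s * γ₁ ^ 2 ≤ 1 / 2) {κ₀ : ℕ} (hκ : 6 ≤ κ₀)
    (hsmall : Real.sqrt 2 ^ (κ₀ - 6) * (2 * γ₁ ^ 4 / s + γ₁ ^ 6) < 1) :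
    EndpointExistence (modelOf (betaO s (2 * s))) ∧
      ∀ γ : ℝ, 0 < γ → γ ≤ γ₁ → ∀ P : B12.RunParams, (modelOf (betaO s (2 * s)) P).flow.InInterval γ P.K →
        ∃ Rj : ℕ → ℕ, (∀ j, B14.IsRj L p ((modelOf (betaO s (2 * s)) P).flow.g j) (Rj j)) ∧
          HorizonFacts (modelOf (betaO s (2 * s)) P).flow (3 * s) β₀ A₀ L p κ₀ Rj P.K := by
  have hc : (0 : ℝ) ≤ 2 * s := by linarith
  obtain ⟨hcont, hup, -⟩ := cont_and_bounds hs.le hc γ₁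
  have e : s + 2 * s = 3 * s := by ring
  rw [e] at hup
  have h := (avgAFH s γ₁ hc).endpoint_and_flowControl hs (modelOf_forwardGenerated _) (modelOf_haltsOutside _)
    (modelOf_curries _) hγ₁ Sm hA₀ hcont hup hDγ hDγ' hκ hsmall
  refine ⟨h.1, fun γ hγ hγ₁' P hI => h.2 γ hγ ?_ P hI⟩
  rw [min_self]
  exact hγ₁'

/-- `e^{−10} ≤ 1/11` (from `x + 1 ≤ e^x`). [folklore] -/
theorem exp_neg_ten_le : Real.exp (-10) ≤ 1 / 11 := by
  have h : (10 : ℝ) + 1 ≤ Real.exp 10 := Real.add_one_le_exp 10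
  have hpos : 0 < Real.exp 10 := Real.exp_pos 10
  rw [Real.exp_neg]
  rw [inv_eq_one_div]
  exact one_div_le_one_div_of_le (by norm_num) (by linarith)

/-- The cell's own threshold numbers serve (a3) with `s = ⅓` (`β′ = 3s = 1`): `γ₁ = e^{−10}`, `β₀ = ½`, `L = p = 2`
(`B14FlowStep.smallnessFor_example`), `κ₀ = 7`; the three defect/polynomial smallness conditions hold with room. [folklore] -/
theorem threshold_example :
    2 * (1 / 3 : ℝ) * Real.exp (-10) ^ 2 ≤ 1 / 2 * (2 + 1 / 2) ∧ 2 * (1 / 3 : ℝ) * Real.exp (-10) ^ 2 ≤ 1 / 2 ∧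
      Real.sqrt 2 ^ (7 - 6) * (2 * Real.exp (-10) ^ 4 / (1 / 3) + Real.exp (-10) ^ 6) < 1 := by
  have hx0 : 0 < Real.exp (-10) := Real.exp_pos _
  have hx1 : Real.exp (-10) ≤ 1 / 11 := exp_neg_ten_le
  have hx2 : Real.exp (-10) ^ 2 ≤ (1 / 11) ^ 2 := pow_le_pow_left₀ hx0.le hx1 2
  have hx4 : Real.exp (-10) ^ 4 ≤ (1 / 11) ^ 4 := pow_le_pow_left₀ hx0.le hx1 4
  have hx6 : Real.exp (-10) ^ 6 ≤ (1 / 11) ^ 6 := pow_le_pow_left₀ hx0.le hx1 6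
  have h2 : Real.sqrt 2 ≤ 2 := by
    rw [show (2 : ℝ) = Real.sqrt (2 ^ 2) from (Real.sqrt_sq (by norm_num)).symm]
    exact Real.sqrt_le_sqrt (by norm_num)
  have h0 : 0 ≤ Real.sqrt 2 := Real.sqrt_nonneg 2
  refine ⟨by nlinarith, by nlinarith, ?_⟩
  have hin : 2 * Real.exp (-10) ^ 4 / (1 / 3) + Real.exp (-10) ^ 6 ≤ 2 * (1 / 11 : ℝ) ^ 4 / (1 / 3) + (1 / 11) ^ 6 := by
    have : 2 * Real.exp (-10) ^ 4 / (1 / 3) ≤ 2 * (1 / 11 : ℝ) ^ 4 / (1 / 3) := by nlinarith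
    linarith
  have hin0 : 0 ≤ 2 * Real.exp (-10) ^ 4 / (1 / 3) + Real.exp (-10) ^ 6 := by positivity
  calc Real.sqrt 2 ^ (7 - 6) * (2 * Real.exp (-10) ^ 4 / (1 / 3) + Real.exp (-10) ^ 6)
      ≤ 2 * (2 * (1 / 11 : ℝ) ^ 4 / (1 / 3) + (1 / 11) ^ 6) := by
        rw [show (7 : ℕ) - 6 = 1 from rfl, pow_one]
        exact mul_le_mul h2 hin hin0 (by norm_num)
    _ < 1 := by norm_num

/-- **(a4) recorded — THE [III] LIST ALONG THE RUNS OF AN HONEST CONSTRUCTION WITH A SIGN-INDEFINITE FAMILY, CLOSED FORM.**  There are a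
history family `β` and a construction `C` with: `C` forward-generated by (0.20) with `β`, halting outside, currying `β`
(`C = FlowStepRuns.modelOf β`); `β` has NO pointwise positive lower bound on any box and NO `EventualForm`, and along EVERY run of `C`
the realised β-function of every odd scale is NEGATIVE; yet `C` HAS endpoint existence and, along every run of `C` staying in `]0,γ]`
with `γ ≤ e^{−10}`, sizes by (2.5) (`L = p = 2`) and `HorizonFacts` = (2.6)–(2.9) (printed constants, `β′ = 1`, `β₀ = ½`, `A₀ = 1`)
∧ (2.46) (`κ₀ = 7`) hold.  Witness: `β = betaO ⅓ ⅔`.  Referee record R-g26-1 answered by inhabitation; with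
`FlowStepRuns.sign_not_necessary` (endpoint half alone, no slope) this is the kernel form of «no located consumer of the flow needs
the sign of any single β_{k+1}». [cite: Balaban1987RG1, Thm 2 p.259] [cite: Balaban1988Convergent, (2.5)–(2.9) pp.255–256 and (2.46) p.263] -/
theorem inhabited :
    ∃ (β : HBeta) (C : B12.Construction), ForwardGenerated C β ∧ HaltsOutside C β ∧ CurriesHBeta C β ∧
      (∀ b γ : ℝ, 0 < b → 0 < γ → ¬ BetaLowerH b γ β) ∧ (EventualForm β → False) ∧
      (∀ (P : B12.RunParams) (m : ℕ) (x : ℝ), (C P).flow.β (2 * m + 1 + 1) x < 0) ∧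
      EndpointExistence C ∧
      ∀ γ : ℝ, 0 < γ → γ ≤ Real.exp (-10) → ∀ P : B12.RunParams, (C P).flow.InInterval γ P.K →
        ∃ Rj : ℕ → ℕ, (∀ j, B14.IsRj 2 2 ((C P).flow.g j) (Rj j)) ∧
          HorizonFacts (C P).flow 1 (1 / 2) 1 2 2 7 Rj P.K := by
  have hs : (0 : ℝ) < 1 / 3 := by norm_num
  have hsc : (1 / 3 : ℝ) < 2 * (1 / 3) := by norm_num
  obtain ⟨hD, hD', hsm⟩ := threshold_example
  have Sm : B14FlowStep.SmallnessFor (Real.exp (-10)) (3 * (1 / 3)) (1 / 2) 2 2 := by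
    rw [show (3 : ℝ) * (1 / 3) = 1 by norm_num]
    exact B14FlowStep.smallnessFor_example
  have h := endpoint_and_flowControl_modelOf hs (Real.exp_pos (-10)) Sm zero_le_one hD hD' (κ₀ := 7) (by norm_num) hsm
  refine ⟨betaO (1 / 3) (2 * (1 / 3)), modelOf (betaO (1 / 3) (2 * (1 / 3))), modelOf_forwardGenerated _,
    modelOf_haltsOutside _, modelOf_curries _, fun b γ hb hγ => not_betaLowerH hsc hb hγ, fun E => not_eventualForm hsc E,
    fun P m x => realised_neg_at_odd_modelOf hs P m x, h.1, fun γ hγ hγ₁ P hI => ?_⟩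
  obtain ⟨Rj, hRj, hH⟩ := h.2 γ hγ hγ₁ P hI
  refine ⟨Rj, hRj, ?_⟩
  rw [show (3 : ℝ) * (1 / 3) = 1 by norm_num] at hH
  exact hH

/-- **(a5) … and the runs ARE there**: for every `m` there is an interval bound `γ ∈ ]0, e^{−10}]` and a coupling threshold `g⋆ > 0`
such that for every prescribed end coupling `g ∈ ]0,g⋆]` and EVERY horizon `K` some bare coupling generates a run of the (a4)
construction inside `]0,γ]` with `g_K = g` — along which, therefore, sizes and the whole [III] list hold.  (Endpoint existence
supplies the runs; (a4) serves them.) [cite: Balaban1987RG1, Thm 2 p.259] [cite: Balaban1988Convergent, (2.5)–(2.9) pp.255–256 and (2.46) p.263] -/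
theorem inhabited_runs :
    ∃ (β : HBeta) (C : B12.Construction), ForwardGenerated C β ∧ HaltsOutside C β ∧ CurriesHBeta C β ∧
      (∀ (P : B12.RunParams) (m : ℕ) (x : ℝ), (C P).flow.β (2 * m + 1 + 1) x < 0) ∧
      ∀ m : ℕ, ∃ γ : ℝ, 0 < γ ∧ γ ≤ Real.exp (-10) ∧ ∃ gstar : ℝ, 0 < gstar ∧ ∀ g : ℝ, 0 < g → g ≤ gstar →
        ∀ K : ℕ, ∃ g0 : ℝ, (C ⟨K, m, g0⟩).flow.InInterval γ K ∧ (C ⟨K, m, g0⟩).flow.g K = g ∧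
          ∃ Rj : ℕ → ℕ, (∀ j, B14.IsRj 2 2 ((C ⟨K, m, g0⟩).flow.g j) (Rj j)) ∧
            HorizonFacts (C ⟨K, m, g0⟩).flow 1 (1 / 2) 1 2 2 7 Rj K := by
  obtain ⟨β, C, hgen, hhalt, hcur, -, -, hneg, hex, hserve⟩ := inhabited
  refine ⟨β, C, hgen, hhalt, hcur, hneg, fun m => ?_⟩
  obtain ⟨γ₂, hγ₂, hγ₂run⟩ := hex m
  set γ : ℝ := min γ₂ (Real.exp (-10)) with hγdef
  have hγpos : 0 < γ := lt_min hγ₂ (Real.exp_pos _)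
  have hγle₂ : γ ≤ γ₂ := min_le_left _ _
  have hγle : γ ≤ Real.exp (-10) := min_le_right _ _
  obtain ⟨gstar, hgstar, hrun⟩ := hγ₂run γ hγpos hγle₂
  refine ⟨γ, hγpos, hγle, gstar, hgstar, fun g hg hgle K => ?_⟩
  obtain ⟨g0, hI, hK⟩ := hrun g hg hgle K
  obtain ⟨Rj, hRj, hH⟩ := hserve γ hγpos hγle ⟨K, m, g0⟩ hI
  exact ⟨g0, hI, hK, Rj, hRj, hH⟩

end Osc

namespace Margin

open Literature.MathematicalPhysics.QuantumFieldTheory.Balaban1983to89.Beta.ConstRemainderConsumers.Margin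
  (betaM splitM)

/-- **(b1)** The run of `modelOf (betaM b γ)` from the bare coupling `γ` (`γ > 0`) is the CONSTANT run `g_k ≡ γ`: at every step the
history lies at the top of the interval, where `betaM b γ` vanishes, so (0.20) reads `1/g_{k+1}² = 1/γ²` and the positive root is `γ`.
[folklore] -/
theorem modelOf_run_const (b : ℝ) {γ : ℝ} (hγ : 0 < γ) (K m : ℕ) :
    ∀ k, (modelOf (betaM b γ) ⟨K, m, γ⟩).flow.g k = γ := by
  intro k
  show genSeq (betaM b γ) γ k = γ
  induction k with
  | zero => exact genSeq_zero _ _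
  | succ k ih =>
    rw [genSeq_succ]
    have hβ : betaM b γ k (prefixOf (genSeq (betaM b γ) γ) k) = 0 := by
      simp [betaM, prefixOf, ih, div_self hγ.ne']
    rw [hβ, ih, sub_zero]
    have hy : 0 < 1 / γ ^ 2 := by positivity
    have ha0 : 0 < solveCoupling (1 / γ ^ 2) := solveCoupling_pos hy
    have h1 : 1 / (solveCoupling (1 / γ ^ 2)) ^ 2 = 1 / γ ^ 2 := inv_sq_solveCoupling hy
    have h2 : (solveCoupling (1 / γ ^ 2)) ^ 2 = γ ^ 2 := by
      rw [← one_div_one_div ((solveCoupling (1 / γ ^ 2)) ^ 2), h1, one_div_one_div]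
    exact (pow_left_inj₀ ha0.le hγ.le two_ne_zero).mp h2

/-- **(b2) ENDPOINT EXISTENCE FOR THE MARGIN CONSTRUCTION** (`b ≥ 0`, `γ > 0`): from §3 at slope `0` (the family is `BetaAvgAFH 0 0 γ`,
continuous, `≤ b` on the boxes) with `hgen := FlowStepRuns.modelOf_forwardGenerated _`. [folklore] -/
theorem endpointExistence_modelOf {b γ : ℝ} (hb : 0 ≤ b) (hγ : 0 < γ) : EndpointExistence (modelOf (betaM b γ)) :=
  (avgAFH_zero hb hγ).endpointExistence le_rfl (modelOf_forwardGenerated _) hγ hb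
    (ConstRemainderConsumers.Margin.cont b γ γ) (ConstRemainderConsumers.Margin.upper_and_sign hb hγ).1

/-- **(b3) … YET (2.46) FAILS ALONG AN ACTUAL RUN OF IT**: the constant run (bare coupling `γ`, any `m`) stays in `]0,γ]` at every
horizon and violates `SumIneq246 · κ₀` at the horizon `⌈γ^{−κ₀}⌉ + 1` (`0 < γ ≤ 1`; `ConstRemainderConsumers.Margin.not_sum246_const`).
[cite: Balaban1988Convergent, (2.46) p.263] -/
theorem sum246_fails_modelOf (b : ℝ) {γ : ℝ} (hγ : 0 < γ) (hγ1 : γ ≤ 1) (κ₀ m : ℕ) :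
    (modelOf (betaM b γ) ⟨⌈(γ ^ κ₀)⁻¹⌉₊ + 1, m, γ⟩).flow.InInterval γ (⌈(γ ^ κ₀)⁻¹⌉₊ + 1) ∧
      ¬ B14FlowStep.SumIneq246 (modelOf (betaM b γ) ⟨⌈(γ ^ κ₀)⁻¹⌉₊ + 1, m, γ⟩).flow.g κ₀ (⌈(γ ^ κ₀)⁻¹⌉₊ + 1) := by
  have hconst := modelOf_run_const b hγ (⌈(γ ^ κ₀)⁻¹⌉₊ + 1) m
  have hfun : (modelOf (betaM b γ) ⟨⌈(γ ^ κ₀)⁻¹⌉₊ + 1, m, γ⟩).flow.g = fun _ => γ := funext hconst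
  refine ⟨fun k _ => ?_, ?_⟩
  · rw [hconst k]; exact ⟨hγ, le_rfl⟩
  · rw [hfun]; exact ConstRemainderConsumers.Margin.not_sum246_const hγ hγ1 κ₀

/-- **(b) recorded — THE SLOPE IS NEEDED, INHABITED.**  For every `0 < γ ≤ 1`, `b ≥ 0`, `κ₀`: a history family `β` with a split `S`
and a construction `C` forward-generated by (0.20) with `β`, halting outside, currying `β`, such that the one-loop part DRIFTS
(`OneLoopDrift b 0`), the remainder obeys the two-sided CONSTANT form at the margin `r = b`, `β` is jointly continuous, obeys the
printed-type upper bound AND the sign on the `]0,γ]`-boxes, sits EXACTLY at slope `0` of the carrier (`BetaAvgAFH 0 0 γ`, and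
`BetaAvgAFH s D γ` for no `s > 0`), `C` HAS endpoint existence — and an in-interval run of `C` VIOLATES (2.46).  §5(a)'s
`slope_zero_not_enough` with the flow realised as a run of an honest construction. [cite: Balaban1988Convergent, (2.46) p.263] -/
theorem slope_zero_not_enough_inhabited {γ b : ℝ} (hγ : 0 < γ) (hγ1 : γ ≤ 1) (hb : 0 ≤ b) (κ₀ : ℕ) :
    ∃ (β : HBeta) (S : B12Beta.OneLoopSplit β) (C : B12.Construction),
      ForwardGenerated C β ∧ HaltsOutside C β ∧ CurriesHBeta C β ∧
      OneLoopDrift b 0 S.β0 ∧ RemainderConst S γ b ∧ BetaContH γ β ∧ BetaUpperH b γ β ∧ BetaLowerH 0 γ β ∧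
      BetaAvgAFH 0 0 γ β ∧ (∀ s D : ℝ, 0 < s → ¬ BetaAvgAFH s D γ β) ∧ EndpointExistence C ∧
      ∃ P : B12.RunParams, (C P).flow.InInterval γ P.K ∧ ¬ B14FlowStep.SumIneq246 (C P).flow.g κ₀ P.K := by
  obtain ⟨hI, hno⟩ := sum246_fails_modelOf b hγ hγ1 κ₀ 0
  exact ⟨betaM b γ, splitM b γ, modelOf (betaM b γ), modelOf_forwardGenerated _, modelOf_haltsOutside _, modelOf_curries _,
    ConstRemainderConsumers.Margin.drift b γ, ConstRemainderConsumers.Margin.remainderConst hb hγ,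
    ConstRemainderConsumers.Margin.cont b γ γ, (ConstRemainderConsumers.Margin.upper_and_sign hb hγ).1,
    (ConstRemainderConsumers.Margin.upper_and_sign hb hγ).2, avgAFH_zero hb hγ, fun s D hs => not_avgAFH_pos hγ hs,
    endpointExistence_modelOf hb hγ, ⟨⌈(γ ^ κ₀)⁻¹⌉₊ + 1, 0, γ⟩, hI, hno⟩

end Margin

namespace NoSplit

/-- **(c) THE NO-SPLIT GLOSS-2 FAMILY, INHABITED**: the canonical construction generated by `betaN b c` (`b > 0`, `c ≥ 0`, `γ₀ > 0`)
gets BOTH halves below one threshold from §4's `gloss2_END_via_carrier` (`E.k₀ = 0`: no defect) — endpoint existence and, along every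
run in `]0,γ]` with `γ ≤ min(γ₀,γ₁)`, sizes and `HorizonFacts` — although `betaN b c` admits no `B12Beta.OneLoopSplit` when `c ≠ 0`
(`no_split`). [cite: Balaban1987RG1, Thm 2 p.259] [cite: Balaban1988Convergent, (2.5)–(2.9) pp.255–256 and (2.46) p.263] -/
theorem endpoint_and_flowControl_modelOf {b c γ₀ : ℝ} (hb : 0 < b) (hc : 0 ≤ c) (hγ₀ : 0 < γ₀) {γ₁ β₀ : ℝ} {L p : ℕ}
    (Sm : B14FlowStep.SmallnessFor γ₁ (b + c * γ₀) β₀ L p) {A₀ : ℝ} (hA₀ : 0 ≤ A₀) {κ₀ : ℕ} (hκ : 6 ≤ κ₀)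
    (hsmall : Real.sqrt 2 ^ (κ₀ - 6) * (2 * γ₁ ^ 4 / b + γ₁ ^ 6) < 1) :
    EndpointExistence (modelOf (betaN b c)) ∧
      ∀ γ : ℝ, 0 < γ → γ ≤ min γ₀ γ₁ → ∀ P : B12.RunParams, (modelOf (betaN b c) P).flow.InInterval γ P.K →
        ∃ Rj : ℕ → ℕ, (∀ j, B14.IsRj L p ((modelOf (betaN b c) P).flow.g j) (Rj j)) ∧
          HorizonFacts (modelOf (betaN b c) P).flow (b + c * γ₀) β₀ A₀ L p κ₀ Rj P.K := by
  have hβ₀ : 0 ≤ β₀ * (2 + β₀) := by nlinarith [Sm.β₀_pos]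
  exact gloss2_END_via_carrier (eventualForm hb hc hγ₀) (modelOf_forwardGenerated _) (modelOf_haltsOutside _)
    (modelOf_curries _) Sm hA₀ (by simpa [eventualForm] using hβ₀) (by simp [eventualForm]) hκ hsmall

end NoSplit

/-! ## 7. (v1.4, RULING (R13-3)) THE BASE-POINT-AVERAGED WALL SOCKET (`Beta.ComposedRoad` §10, v1.5) ON THE [III] SIDE

BETA-SPEC §7.24 RULING (R13-3) (lead strat-b12 gen 8, 2026-08-19; `Beta.ComposedRoad` v1.5 §10): the one-shot entries at blocking
factor `n` are `n`-block-periodic jointly, not fine-translation invariant, so the wall's leg families are READ PER BASE POINT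
`b ∈ Bset n` (`F′ b i n w`, constants free of `b`) and the identification binder `hident` compares `composedCoeff μC m` with a CONVEX
COMBINATION (weights `wt n b ≥ 0`, `Σ wt n b = 1`) of the single-base-point window sums — a WEAKENING of the §8 one-point binder with the
SAME conclusion `OneLoopDrift (stepBal N Lc) A′ β⁰` and the SAME constant `A′` (`ComposedRoad.oneLoopDrift_of_composedLegInterfacePow_identity_avg`).
The lead's END theorem on that socket (`ComposedRoad.endpointExistence_of_composedLegInterfacePow_identity_avg_remainderConst`, `rr ≤ stepBal`)
states `EndpointExistence` only.  THIS SECTION is the [III]-side twin, exactly as §2′/§4 twin the §8 socket: the averaged binders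
(COPIED from the lead's declaration — nothing added, nothing dropped) + `IdentityForm μC β⁰` + `RemainderConst S γ₀ rr` ⟹ the carrier
`BetaAvgAFH (stepBal N Lc − rr) (2A′) γ₀ β` (`betaAvgAFH_of_composedLegInterfacePow_identity_avg_remainderConst`); with `rr < stepBal N Lc`
STRICTLY, continuity (C), the printed-type upper bound and ONE smallness threshold ⟹ `EndpointExistence` ∧ sizes ∧ `HorizonFacts`
((2.6)–(2.9) ∧ (2.46)) along every run in `]0,γ]`, `γ ≤ min(γ₀,γ₁)` (`wallEND_of_composedLegInterfacePow_identity_avg_remainderConst`).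
ONE-POINT INSTANCE (`betaAvgAFH_of_composedLegInterfacePow_identity_remainderConst_via_avg`): with `κB = Unit`, `Bset n = {()}`,
`wt ≡ 1` the averaged socket returns EXACTLY the §2′ carrier of the §8 socket (same slope, same defect) — on the [III] side (R13-3)
subsumes (R11)'s socket at no cost, so no consumer of MISSING-B14 §8 (C1–C8, C11–C16, C18) changes grade.  Every binder is a
HYPOTHESIS, uninstantiated for Bałaban's objects; nothing of [Balaban1987RG1]/[Balaban1988Convergent] is asserted; NOT summit
progress, never continuum / mass gap / Clay. -/

section WallAvg

variable {β : HBeta} {ι : Type*} {s : Finset ι} {cc₀ : ι → ℝ} {P Q : ι → Leg} {κB : Type*}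

/-- **THE (R13-3) AVERAGED WALL ⟹ THE CARRIER**: leg data PER BASE POINT `b ∈ Bset (Lc^m)` with `b`-free constants ((W2′)₀ `hF/hG`,
(W3a)₀ `hFtail/hGtail`), the leg table (W1)₀ (`hdeg`, `hval`), the BASE-POINT-AVERAGED identification (W3b)₀ (`hident`: `composedCoeff μC m`
vs the `wt`-convex combination of the single-base-point window sums, up to `U`), `IdentityForm μC β⁰` for [H-germ′], and the (R10-1′)
remainder `RemainderConst S γ₀ rr` give `BetaAvgAFH (stepBal N Lc − rr) (2A′) γ₀ β` with `A′` the (unchanged) window constant of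
`ComposedRoad.oneLoopDrift_of_composedLegInterfacePow_identity_avg`.  Binder list copied from the lead's §10 declaration. [folklore] -/
theorem betaAvgAFH_of_composedLegInterfacePow_identity_avg_remainderConst (S : B12Beta.OneLoopSplit β)
    (hdeg : ∀ i ∈ s, (P i).a + (Q i).a = 6) {μ ν : Fin 4} (hμν : μ ≠ ν) {N : ℝ} (hN : N ≠ 0)
    (hval : ∀ x : E4, x ≠ 0 → x μ * x ν * contBubble s cc₀ P Q x = leadingIntegrand (kappaBal N) μ ν x)
    {Lc : ℕ} (hL : 2 ≤ Lc) {μC : ℕ → ℕ → ℝ}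
    {F' G' : κB → ι → ℕ → Pt → ℝ} {R Sg R' S' : ι → ℝ} {δ U cc : ℝ} {M : ℕ → ℕ}
    {Bset : ℕ → Finset κB} {wt : ℕ → κB → ℝ}
    (hwt0 : ∀ n : ℕ, 2 ≤ n → ∀ b ∈ Bset n, 0 ≤ wt n b) (hwt1 : ∀ n : ℕ, 2 ≤ n → ∑ b ∈ Bset n, wt n b = 1)
    (hR : ∀ i ∈ s, 0 ≤ R i) (hS : ∀ i ∈ s, 0 ≤ Sg i) (hR' : ∀ i ∈ s, 0 ≤ R' i) (hS' : ∀ i ∈ s, 0 ≤ S' i) (hδ : 0 < δ)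
    (hc : 1 ≤ cc) (hM : ∀ L : ℕ, 2 ≤ L → 1 ≤ M L ∧ (L : ℝ) ≤ cc * M L) (hML : ∀ L : ℕ, 2 ≤ L → M L ≤ L)
    (hF : ∀ m : ℕ, 1 ≤ m → ∀ b ∈ Bset (Lc ^ m), ∀ w ∈ annulus 4 0 (M (Lc ^ m)), ∀ i ∈ s,
      |F' b i (Lc ^ m) w - (P i).f (Lc ^ m) 0 w| ≤ R i / ((supNorm w : ℝ) ^ ((P i).a - 2) * ((Lc ^ m : ℕ) : ℝ) ^ 2))
    (hG : ∀ m : ℕ, 1 ≤ m → ∀ b ∈ Bset (Lc ^ m), ∀ w ∈ annulus 4 0 (M (Lc ^ m)), ∀ i ∈ s,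
      |G' b i (Lc ^ m) w - (Q i).f (Lc ^ m) 0 w| ≤ Sg i / ((supNorm w : ℝ) ^ ((Q i).a - 2) * ((Lc ^ m : ℕ) : ℝ) ^ 2))
    (hFtail : ∀ m : ℕ, 1 ≤ m → ∀ b ∈ Bset (Lc ^ m), ∀ r : ℕ, M (Lc ^ m) ≤ r → ∀ w ∈ annulus 4 r (r + 1), ∀ i ∈ s,
      |F' b i (Lc ^ m) w| ≤ R' i / ((r : ℝ) + 1) ^ (P i).a * Real.exp (-(δ / ((Lc ^ m : ℕ) : ℝ)) * ((r : ℝ) + 1)))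
    (hGtail : ∀ m : ℕ, 1 ≤ m → ∀ b ∈ Bset (Lc ^ m), ∀ r : ℕ, M (Lc ^ m) ≤ r → ∀ w ∈ annulus 4 r (r + 1), ∀ i ∈ s,
      |G' b i (Lc ^ m) w| ≤ S' i / ((r : ℝ) + 1) ^ (Q i).a)
    (hident : ∀ m : ℕ, 1 ≤ m → ∃ R₀ : ℕ, M (Lc ^ m) ≤ R₀ ∧
      |composedCoeff μC m - ∑ b ∈ Bset (Lc ^ m), wt (Lc ^ m) b * ∑ w ∈ annulus 4 0 R₀, toReal w μ * toReal w ν *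
        ∑ i ∈ s, cc₀ i * (F' b i (Lc ^ m) w * G' b i (Lc ^ m) w)| ≤ U)
    (hid : IdentityForm μC S.β0) {rr γ₀ : ℝ} (hrem : RemainderConst S γ₀ rr) :
    BetaAvgAFH (B12Normalization.stepBal N Lc - rr)
      (2 * constA (|kappaBal N| * 24 + |kappaBal N| * 110592) (bubbleConst s cc₀ P Q)
          ((80 * (∑ i ∈ s, |cc₀ i| * (R' i * S' i)) * (1 + cc / δ) + U) +
            80 * ∑ i ∈ s, |cc₀ i| * ((((P i).A + (P i).B) * Sg i + R i * ((Q i).A + (Q i).B) + R i * Sg i)))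
          cc (kappaBal N * transverseValue)) γ₀ β :=
  betaAvgAFH_of_driftRemainderConst S
    (ComposedRoad.oneLoopDrift_of_composedLegInterfacePow_identity_avg S hdeg hμν hN hval hL hwt0 hwt1 hR hS hR' hS' hδ hc hM
      hML hF hG hFtail hGtail hident hid) hrem

/-- **THE (R13-3) AVERAGED WALL, END TO END, BOTH SIDES.**  The hypotheses of the lead's averaged wall declaration
`ComposedRoad.oneLoopDrift_of_composedLegInterfacePow_identity_avg` — leg table (W1)₀ (`hdeg`, `hval`), base points and convex weights
(`hwt0`, `hwt1`), per-base-point window data (W2′)₀ (`hF`, `hG`) and tails (W3a)₀ (`hFtail`, `hGtail`), the base-point-averaged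
identification (W3b)₀ (`hident`) for the COMPOSED coefficient along `n = Lc^m`, `IdentityForm μC β⁰` for [H-germ′] — plus the (R10-1′)
remainder `RemainderConst S γ₀ rr` with `rr < stepBal N Lc` STRICTLY, continuity (C), the printed-type upper bound, and ONE smallness
threshold `γ₁` for the defect `2A′` and the slope `stepBal N Lc − rr` ⟹ `EndpointExistence Cn` ∧ sizes and `HorizonFacts`
((2.6)–(2.9) ∧ (2.46)) along every run in `]0,γ]`, `γ ≤ min(γ₀,γ₁)`.  The first conjunct alone needs only `rr ≤ stepBal`
(`ComposedRoad.endpointExistence_of_composedLegInterfacePow_identity_avg_remainderConst`); the second is the [III]-side END statement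
the lead's §10 does not state.  EVERY binder uninstantiated for Bałaban's objects.
[cite: Balaban1987RG1, Thm 2 p.259] [cite: Balaban1988Convergent, (2.5)–(2.9) pp.255–256 and (2.46) p.263] -/
theorem wallEND_of_composedLegInterfacePow_identity_avg_remainderConst {Cn : B12.Construction}
    (hgen : ForwardGenerated Cn β) (hhalt : HaltsOutside Cn β) (hcur : CurriesHBeta Cn β) (S : B12Beta.OneLoopSplit β)
    (hdeg : ∀ i ∈ s, (P i).a + (Q i).a = 6) {μ ν : Fin 4} (hμν : μ ≠ ν) {N : ℝ} (hN : N ≠ 0)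
    (hval : ∀ x : E4, x ≠ 0 → x μ * x ν * contBubble s cc₀ P Q x = leadingIntegrand (kappaBal N) μ ν x)
    {Lc : ℕ} (hL : 2 ≤ Lc) {μC : ℕ → ℕ → ℝ}
    {F' G' : κB → ι → ℕ → Pt → ℝ} {R Sg R' S' : ι → ℝ} {δ U cc : ℝ} {M : ℕ → ℕ}
    {Bset : ℕ → Finset κB} {wt : ℕ → κB → ℝ}
    (hwt0 : ∀ n : ℕ, 2 ≤ n → ∀ b ∈ Bset n, 0 ≤ wt n b) (hwt1 : ∀ n : ℕ, 2 ≤ n → ∑ b ∈ Bset n, wt n b = 1)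
    (hR : ∀ i ∈ s, 0 ≤ R i) (hS : ∀ i ∈ s, 0 ≤ Sg i) (hR' : ∀ i ∈ s, 0 ≤ R' i) (hS' : ∀ i ∈ s, 0 ≤ S' i) (hδ : 0 < δ)
    (hc : 1 ≤ cc) (hM : ∀ L : ℕ, 2 ≤ L → 1 ≤ M L ∧ (L : ℝ) ≤ cc * M L) (hML : ∀ L : ℕ, 2 ≤ L → M L ≤ L)
    (hF : ∀ m : ℕ, 1 ≤ m → ∀ b ∈ Bset (Lc ^ m), ∀ w ∈ annulus 4 0 (M (Lc ^ m)), ∀ i ∈ s,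
      |F' b i (Lc ^ m) w - (P i).f (Lc ^ m) 0 w| ≤ R i / ((supNorm w : ℝ) ^ ((P i).a - 2) * ((Lc ^ m : ℕ) : ℝ) ^ 2))
    (hG : ∀ m : ℕ, 1 ≤ m → ∀ b ∈ Bset (Lc ^ m), ∀ w ∈ annulus 4 0 (M (Lc ^ m)), ∀ i ∈ s,
      |G' b i (Lc ^ m) w - (Q i).f (Lc ^ m) 0 w| ≤ Sg i / ((supNorm w : ℝ) ^ ((Q i).a - 2) * ((Lc ^ m : ℕ) : ℝ) ^ 2))
    (hFtail : ∀ m : ℕ, 1 ≤ m → ∀ b ∈ Bset (Lc ^ m), ∀ r : ℕ, M (Lc ^ m) ≤ r → ∀ w ∈ annulus 4 r (r + 1), ∀ i ∈ s,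
      |F' b i (Lc ^ m) w| ≤ R' i / ((r : ℝ) + 1) ^ (P i).a * Real.exp (-(δ / ((Lc ^ m : ℕ) : ℝ)) * ((r : ℝ) + 1)))
    (hGtail : ∀ m : ℕ, 1 ≤ m → ∀ b ∈ Bset (Lc ^ m), ∀ r : ℕ, M (Lc ^ m) ≤ r → ∀ w ∈ annulus 4 r (r + 1), ∀ i ∈ s,
      |G' b i (Lc ^ m) w| ≤ S' i / ((r : ℝ) + 1) ^ (Q i).a)
    (hident : ∀ m : ℕ, 1 ≤ m → ∃ R₀ : ℕ, M (Lc ^ m) ≤ R₀ ∧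
      |composedCoeff μC m - ∑ b ∈ Bset (Lc ^ m), wt (Lc ^ m) b * ∑ w ∈ annulus 4 0 R₀, toReal w μ * toReal w ν *
        ∑ i ∈ s, cc₀ i * (F' b i (Lc ^ m) w * G' b i (Lc ^ m) w)| ≤ U)
    (hid : IdentityForm μC S.β0)
    {rr γ₀ γ₁ β' β₀ : ℝ} (hγ₀ : 0 < γ₀) (hrem : RemainderConst S γ₀ rr) (hr : rr < B12Normalization.stepBal N Lc)
    (hcont : BetaContH γ₀ β) (hup : BetaUpperH β' γ₀ β) {L p : ℕ} (Sm : B14FlowStep.SmallnessFor γ₁ β' β₀ L p)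
    {A₀ : ℝ} (hA₀ : 0 ≤ A₀)
    (hAγ : 2 * constA (|kappaBal N| * 24 + |kappaBal N| * 110592) (bubbleConst s cc₀ P Q)
          ((80 * (∑ i ∈ s, |cc₀ i| * (R' i * S' i)) * (1 + cc / δ) + U) +
            80 * ∑ i ∈ s, |cc₀ i| * ((((P i).A + (P i).B) * Sg i + R i * ((Q i).A + (Q i).B) + R i * Sg i)))
          cc (kappaBal N * transverseValue) * γ₁ ^ 2 ≤ β₀ * (2 + β₀))
    (hAγ' : 2 * constA (|kappaBal N| * 24 + |kappaBal N| * 110592) (bubbleConst s cc₀ P Q)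
          ((80 * (∑ i ∈ s, |cc₀ i| * (R' i * S' i)) * (1 + cc / δ) + U) +
            80 * ∑ i ∈ s, |cc₀ i| * ((((P i).A + (P i).B) * Sg i + R i * ((Q i).A + (Q i).B) + R i * Sg i)))
          cc (kappaBal N * transverseValue) * γ₁ ^ 2 ≤ 1 / 2)
    {κ₀ : ℕ} (hκ : 6 ≤ κ₀)
    (hsmall : Real.sqrt 2 ^ (κ₀ - 6) * (2 * γ₁ ^ 4 / (B12Normalization.stepBal N Lc - rr) + γ₁ ^ 6) < 1) :
    EndpointExistence Cn ∧
      ∀ γ : ℝ, 0 < γ → γ ≤ min γ₀ γ₁ → ∀ Pr : B12.RunParams, (Cn Pr).flow.InInterval γ Pr.K →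
        ∃ Rj : ℕ → ℕ, (∀ j, B14.IsRj L p ((Cn Pr).flow.g j) (Rj j)) ∧
          HorizonFacts (Cn Pr).flow β' β₀ A₀ L p κ₀ Rj Pr.K :=
  (betaAvgAFH_of_composedLegInterfacePow_identity_avg_remainderConst S hdeg hμν hN hval hL hwt0 hwt1 hR hS hR' hS' hδ hc hM hML
    hF hG hFtail hGtail hident hid hrem).endpoint_and_flowControl (sub_pos.mpr hr) hgen hhalt hcur hγ₀ Sm hA₀ hcont hup hAγ hAγ'
    hκ hsmall

end WallAvg

section WallAvgOnePoint

variable {β : HBeta} {ι : Type*} {s : Finset ι} {cc₀ : ι → ℝ} {P Q : ι → Leg}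

/-- **ONE-POINT INSTANCE — (R13-3) SUBSUMES (R11)'s SOCKET ON THE [III] SIDE.**  The §2′ carrier of the one-point (§8) wall socket,
RE-DERIVED from the averaged (§10) socket with ONE base point (`κB = Unit`, `Bset n = {()}`, `wt ≡ 1`): SAME slope `stepBal N Lc − rr`,
SAME defect `2A′` (compare `betaAvgAFH_of_composedLegInterfacePow_identity_remainderConst`, whose binders and conclusion this theorem
repeats verbatim).  Consistency check only; the §8 binder `hident` is the one-point case of §10's, as the lead's §10 header says. [folklore] -/
theorem betaAvgAFH_of_composedLegInterfacePow_identity_remainderConst_via_avg (S : B12Beta.OneLoopSplit β)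
    (hdeg : ∀ i ∈ s, (P i).a + (Q i).a = 6) {μ ν : Fin 4} (hμν : μ ≠ ν) {N : ℝ} (hN : N ≠ 0)
    (hval : ∀ x : E4, x ≠ 0 → x μ * x ν * contBubble s cc₀ P Q x = leadingIntegrand (kappaBal N) μ ν x)
    {Lc : ℕ} (hL : 2 ≤ Lc) {μC : ℕ → ℕ → ℝ}
    {F' G' : ι → ℕ → Pt → ℝ} {R S' R' Sg : ι → ℝ} {δ U cc : ℝ} {M : ℕ → ℕ}
    (hR : ∀ i ∈ s, 0 ≤ R i) (hS : ∀ i ∈ s, 0 ≤ Sg i) (hR' : ∀ i ∈ s, 0 ≤ R' i) (hS' : ∀ i ∈ s, 0 ≤ S' i) (hδ : 0 < δ)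
    (hc : 1 ≤ cc) (hM : ∀ L : ℕ, 2 ≤ L → 1 ≤ M L ∧ (L : ℝ) ≤ cc * M L) (hML : ∀ L : ℕ, 2 ≤ L → M L ≤ L)
    (hF : ∀ m : ℕ, 1 ≤ m → ∀ w ∈ annulus 4 0 (M (Lc ^ m)), ∀ i ∈ s,
      |F' i (Lc ^ m) w - (P i).f (Lc ^ m) 0 w| ≤ R i / ((supNorm w : ℝ) ^ ((P i).a - 2) * ((Lc ^ m : ℕ) : ℝ) ^ 2))
    (hG : ∀ m : ℕ, 1 ≤ m → ∀ w ∈ annulus 4 0 (M (Lc ^ m)), ∀ i ∈ s,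
      |G' i (Lc ^ m) w - (Q i).f (Lc ^ m) 0 w| ≤ Sg i / ((supNorm w : ℝ) ^ ((Q i).a - 2) * ((Lc ^ m : ℕ) : ℝ) ^ 2))
    (hFtail : ∀ m : ℕ, 1 ≤ m → ∀ r : ℕ, M (Lc ^ m) ≤ r → ∀ w ∈ annulus 4 r (r + 1), ∀ i ∈ s,
      |F' i (Lc ^ m) w| ≤ R' i / ((r : ℝ) + 1) ^ (P i).a * Real.exp (-(δ / ((Lc ^ m : ℕ) : ℝ)) * ((r : ℝ) + 1)))
    (hGtail : ∀ m : ℕ, 1 ≤ m → ∀ r : ℕ, M (Lc ^ m) ≤ r → ∀ w ∈ annulus 4 r (r + 1), ∀ i ∈ s,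
      |G' i (Lc ^ m) w| ≤ S' i / ((r : ℝ) + 1) ^ (Q i).a)
    (hident : ∀ m : ℕ, 1 ≤ m → ∃ R₀ : ℕ, M (Lc ^ m) ≤ R₀ ∧
      |composedCoeff μC m - ∑ w ∈ annulus 4 0 R₀, toReal w μ * toReal w ν *
        ∑ i ∈ s, cc₀ i * (F' i (Lc ^ m) w * G' i (Lc ^ m) w)| ≤ U)
    (hid : IdentityForm μC S.β0) {rr γ₀ : ℝ} (hrem : RemainderConst S γ₀ rr) :
    BetaAvgAFH (B12Normalization.stepBal N Lc - rr)
      (2 * constA (|kappaBal N| * 24 + |kappaBal N| * 110592) (bubbleConst s cc₀ P Q)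
          ((80 * (∑ i ∈ s, |cc₀ i| * (R' i * S' i)) * (1 + cc / δ) + U) +
            80 * ∑ i ∈ s, |cc₀ i| * ((((P i).A + (P i).B) * Sg i + R i * ((Q i).A + (Q i).B) + R i * Sg i)))
          cc (kappaBal N * transverseValue)) γ₀ β :=
  betaAvgAFH_of_composedLegInterfacePow_identity_avg_remainderConst (κB := Unit) S hdeg hμν hN hval hL
    (F' := fun _ => F') (G' := fun _ => G') (Bset := fun _ => {()}) (wt := fun _ _ => (1 : ℝ))
    (fun _ _ _ _ => zero_le_one) (fun _ _ => by simp) hR hS hR' hS' hδ hc hM hML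
    (fun m hm _ _ w hw i hi => hF m hm w hw i hi) (fun m hm _ _ w hw i hi => hG m hm w hw i hi)
    (fun m hm _ _ r hr w hw i hi => hFtail m hm r hr w hw i hi) (fun m hm _ _ r hr w hw i hi => hGtail m hm r hr w hw i hi)
    (fun m hm => by
      obtain ⟨R₀, hR₀, h⟩ := hident m hm
      exact ⟨R₀, hR₀, by simpa only [Finset.sum_singleton, one_mul] using h⟩)
    hid hrem

end WallAvgOnePoint

/-! ## 8. (v1.4) THE THRESHOLD EXISTS — the END statements in print's quantifier order «∀ constants ∃ γ»

[Balaban1988Convergent] p. 255, after (2.6): *"β₀ > 0 can be chosen arbitrarily small, if g is sufficiently small"*;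
[Balaban1987RG1] Thm 3 p. 264: *"The constant γ depends on all other constants."* (both typed upstream: `B14FlowStep` header,
`B12.lean`).  The END theorems of §3/§4/§7 carry the γ-smallness as FOUR explicit numeric hypotheses on one threshold `γ₁`
(`SmallnessFor γ₁ β′ β₀ L p`, `Dγ₁² ≤ β₀(2+β₀)`, `Dγ₁² ≤ 1/2`, `(√2)^{κ₀−6}(2γ₁⁴/s + γ₁⁶) < 1`) — BETA-SPEC §7.20 binder table
(T), row «smallness»: «arithmetic, stated; they ARE the statement's hypotheses».  THIS SECTION closes the arithmetic: for EVERY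
defect `D ≥ 0`, slope `s > 0`, upper bound `β′ ≥ 0`, `0 < β₀ ≤ 1` with `Lβ₀ ≤ 1`, `L ≥ 2`, exponent `p` and `κ₀` there IS a
`γ₁ > 0` meeting all four at once (`exists_threshold`; elementary: every condition is monotone in `γ₁` and holds near `0⁺`).
Hence the END statements with NO numeric smallness hypothesis left — only the sign conditions print states on its constants —
and the conclusion in the literal shape «for g sufficiently small»: `EndpointExistence C ∧ ∃ γ₁ > 0, ∀ γ ≤ min(γ₀,γ₁), ∀ runs in
]0,γ]: sizes ∧ HorizonFacts` (`BetaAvgAFH.endpoint_and_flowControl_smallCoupling`), and the (R13-3) averaged wall END TO END in that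
shape (`wallEND_of_composedLegInterfacePow_identity_avg_remainderConst_smallCoupling`).  Bookkeeping over the carrier; every
β-input a binder; nothing of the series asserted. -/

section Threshold

open Filter Topology

/-- **THE THRESHOLD EXISTS.**  For every defect `D ≥ 0`, slope `s > 0`, `β′ ≥ 0`, `0 < β₀ ≤ 1` with `L·β₀ ≤ 1`, `L ≥ 2`, and all
exponents `p`, `κ₀`, some `γ₁ > 0` satisfies SIMULTANEOUSLY `B14FlowStep.SmallnessFor γ₁ β′ β₀ L p`, `Dγ₁² ≤ β₀(2+β₀)`, `Dγ₁² ≤ 1/2`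
and `(√2)^{κ₀−6}(2γ₁⁴/s + γ₁⁶) < 1` — the four γ-hypotheses of `BetaAvgAFH.endpoint_and_flowControl` / §4 / §7.  Proof: each
condition holds for all small `γ₁ > 0` (explicit sufficient thresholds `1/2`, `β₀/(β′+1)`, `e^{−(2p+1)}`, `e^{−p/(2β₀)}`, `β₀/(D+1)`,
`1/(2(D+1))`, `1/(2·(√2)^{κ₀−6}·(2/s+1))`), and `𝓝[>] 0` is a proper filter. [folklore] -/
theorem exists_threshold {D s β' β₀ : ℝ} {L : ℕ} (p κ₀ : ℕ) (hD : 0 ≤ D) (hs : 0 < s) (hβ' : 0 ≤ β')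
    (hβ₀ : 0 < β₀) (hβ₀1 : β₀ ≤ 1) (hL : 2 ≤ L) (hLβ₀ : (L : ℝ) * β₀ ≤ 1) :
    ∃ γ₁ : ℝ, 0 < γ₁ ∧ B14FlowStep.SmallnessFor γ₁ β' β₀ L p ∧ D * γ₁ ^ 2 ≤ β₀ * (2 + β₀) ∧
      D * γ₁ ^ 2 ≤ 1 / 2 ∧ Real.sqrt 2 ^ (κ₀ - 6) * (2 * γ₁ ^ 4 / s + γ₁ ^ 6) < 1 := by
  set C : ℝ := Real.sqrt 2 ^ (κ₀ - 6) with hC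
  have hC1 : 1 ≤ C := one_le_pow₀ (Real.one_le_sqrt.mpr (by norm_num))
  have hCpos : 0 < C := lt_of_lt_of_le one_pos hC1
  have ev : ∀ t : ℝ, 0 < t → ∀ᶠ γ in 𝓝[>] (0 : ℝ), γ ≤ t := fun t ht =>
    eventually_nhdsWithin_of_eventually_nhds (eventually_le_nhds ht)
  have ev0 : ∀ᶠ γ in 𝓝[>] (0 : ℝ), 0 < γ := eventually_mem_nhdsWithin
  obtain ⟨γ, hγ0, h1, h2, h3, h4, h5, h6, h7⟩ :=
    (ev0.and ((ev (1 / 2) (by norm_num)).and ((ev (β₀ / (β' + 1)) (by positivity)).and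
      ((ev (Real.exp (-(2 * p + 1))) (Real.exp_pos _)).and ((ev (Real.exp (-(p / (2 * β₀)))) (Real.exp_pos _)).and
      ((ev (β₀ / (D + 1)) (by positivity)).and ((ev (1 / (2 * (D + 1))) (by positivity)).and
      (ev (1 / (2 * C * (2 / s + 1))) (by positivity))))))))).exists
  have hγ1 : γ < 1 := by linarith
  have hsq : γ ^ 2 ≤ γ := by nlinarith
  have hlog : Real.log (γ ^ 2)⁻¹ = -2 * Real.log γ := by
    rw [Real.log_inv, Real.log_pow]; push_cast; ring
  have hl3 : Real.log γ ≤ -(2 * (p : ℝ) + 1) := (Real.log_le_iff_le_exp hγ0).mpr h3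
  have hl4 : Real.log γ ≤ -((p : ℝ) / (2 * β₀)) := (Real.log_le_iff_le_exp hγ0).mpr h4
  -- `γ²(β′+1) ≤ β₀`, `γ²(D+1) ≤ β₀`, `γ²(D+1) ≤ 1/2`
  have hA : γ ^ 2 * (β' + 1) ≤ β₀ := by
    calc γ ^ 2 * (β' + 1) ≤ γ * (β' + 1) := by gcongr
      _ ≤ β₀ / (β' + 1) * (β' + 1) := by gcongr
      _ = β₀ := div_mul_cancel₀ _ (by positivity)
  have hB : γ ^ 2 * (D + 1) ≤ β₀ := by
    calc γ ^ 2 * (D + 1) ≤ γ * (D + 1) := by gcongr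
      _ ≤ β₀ / (D + 1) * (D + 1) := by gcongr
      _ = β₀ := div_mul_cancel₀ _ (by positivity)
  have hB' : γ ^ 2 * (D + 1) ≤ 1 / 2 := by
    calc γ ^ 2 * (D + 1) ≤ γ * (D + 1) := by gcongr
      _ ≤ 1 / (2 * (D + 1)) * (D + 1) := by gcongr
      _ = 1 / 2 := by field_simp
  have hβ₀2 : β₀ ≤ β₀ * (2 + β₀) := by nlinarith
  refine ⟨γ, hγ0, ⟨hγ0, hγ1, hβ', hβ₀, hβ₀1, ?_, ?_, ?_, ?_, hL, hLβ₀⟩, ?_, ?_, ?_⟩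
  · nlinarith
  · nlinarith
  · rw [hlog]; linarith
  · rw [hlog]
    have hq : β₀ * ((p : ℝ) / (2 * β₀)) = p / 2 := by field_simp
    have := mul_le_mul_of_nonneg_left hl4 hβ₀.le
    rw [mul_neg, hq] at this
    linarith
  · nlinarith
  · nlinarith
  · -- `C(2γ⁴/s + γ⁶) ≤ C·γ·(2/s + 1) ≤ 1/2 < 1`
    have hγ4 : γ ^ 4 ≤ γ := by
      calc γ ^ 4 ≤ γ ^ 1 := pow_le_pow_of_le_one hγ0.le hγ1.le (by norm_num)
        _ = γ := pow_one γ
    have hγ6 : γ ^ 6 ≤ γ := by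
      calc γ ^ 6 ≤ γ ^ 1 := pow_le_pow_of_le_one hγ0.le hγ1.le (by norm_num)
        _ = γ := pow_one γ
    have hsum : 2 * γ ^ 4 / s + γ ^ 6 ≤ γ * (2 / s + 1) := by
      have : 2 * γ ^ 4 / s = (2 / s) * γ ^ 4 := by ring
      rw [this]
      have h2s : 0 ≤ 2 / s := by positivity
      nlinarith [mul_le_mul_of_nonneg_left hγ4 h2s]
    have hγC : γ * (2 * C * (2 / s + 1)) ≤ 1 := by
      calc γ * (2 * C * (2 / s + 1)) ≤ 1 / (2 * C * (2 / s + 1)) * (2 * C * (2 / s + 1)) := by gcongr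
        _ = 1 := by field_simp
    calc C * (2 * γ ^ 4 / s + γ ^ 6) ≤ C * (γ * (2 / s + 1)) := by gcongr
      _ = γ * (2 * C * (2 / s + 1)) / 2 := by ring
      _ ≤ 1 / 2 := by gcongr
      _ < 1 := by norm_num

end Threshold

namespace BetaAvgAFH

variable {β : HBeta} {s D : ℝ}

/-- **THE END STATEMENT «FOR g SUFFICIENTLY SMALL», NO NUMERIC SMALLNESS HYPOTHESIS LEFT.**  From the carrier with `s > 0` on
`]0,γ₀]`, continuity (C), the printed-type upper bound with `β′ ≥ 0`, and ONLY the sign conditions print states on its constants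
(`0 < β₀ ≤ 1`, `L ≥ 2`, `Lβ₀ ≤ 1`, `κ₀ ≥ 6`, `A₀ ≥ 0`, any `p`): `EndpointExistence C` AND there is `γ₁ > 0` such that along every run
in `]0,γ]` with `γ ≤ min(γ₀,γ₁)` sizes and `HorizonFacts` ((2.6)–(2.9) ∧ (2.46)) hold — `endpoint_and_flowControl` with its four
γ-hypotheses discharged by `exists_threshold`; print's quantifier order «∀ constants ∃ γ».
[cite: Balaban1987RG1, Thm 2 p.259 and Thm 3 p.264] [cite: Balaban1988Convergent, (2.5)–(2.9) pp.255–256 and (2.46) p.263] -/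
theorem endpoint_and_flowControl_smallCoupling {γ₀ β' β₀ : ℝ} (h : BetaAvgAFH s D γ₀ β) (hs : 0 < s) {C : B12.Construction}
    (hgen : ForwardGenerated C β) (hhalt : HaltsOutside C β) (hcur : CurriesHBeta C β) (hγ₀ : 0 < γ₀)
    (hβ' : 0 ≤ β') (hβ₀ : 0 < β₀) (hβ₀1 : β₀ ≤ 1) {L : ℕ} (hL : 2 ≤ L) (hLβ₀ : (L : ℝ) * β₀ ≤ 1) (p : ℕ)
    {A₀ : ℝ} (hA₀ : 0 ≤ A₀) (hcont : BetaContH γ₀ β) (hup : BetaUpperH β' γ₀ β) {κ₀ : ℕ} (hκ : 6 ≤ κ₀) :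
    EndpointExistence C ∧ ∃ γ₁ : ℝ, 0 < γ₁ ∧
      ∀ γ : ℝ, 0 < γ → γ ≤ min γ₀ γ₁ → ∀ P : B12.RunParams, (C P).flow.InInterval γ P.K →
        ∃ Rj : ℕ → ℕ, (∀ j, B14.IsRj L p ((C P).flow.g j) (Rj j)) ∧ HorizonFacts (C P).flow β' β₀ A₀ L p κ₀ Rj P.K := by
  obtain ⟨γ₁, hγ₁, Sm, hDγ, hDγ', hsmall⟩ := exists_threshold p κ₀ (h.defect_nonneg hγ₀) hs hβ' hβ₀ hβ₀1 hL hLβ₀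
  obtain ⟨hE, hF⟩ := h.endpoint_and_flowControl hs hgen hhalt hcur hγ₀ Sm hA₀ hcont hup hDγ hDγ' hκ hsmall
  exact ⟨hE, γ₁, hγ₁, hF⟩

end BetaAvgAFH

section WallAvgSmall

variable {β : HBeta} {ι : Type*} {s : Finset ι} {cc₀ : ι → ℝ} {P Q : ι → Leg} {κB : Type*}

/-- **THE (R13-3) AVERAGED WALL, END TO END, «FOR g SUFFICIENTLY SMALL».**  As
`wallEND_of_composedLegInterfacePow_identity_avg_remainderConst`, with the four numeric γ-hypotheses on the threshold REMOVED
(`exists_threshold`): the averaged wall binders + `IdentityForm` + `RemainderConst S γ₀ rr` with `rr < stepBal N Lc` STRICTLY + (C) +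
the printed-type upper bound `β′ ≥ 0` + the sign conditions `0 < β₀ ≤ 1`, `L ≥ 2`, `Lβ₀ ≤ 1`, `κ₀ ≥ 6`, `A₀ ≥ 0`
⟹ `EndpointExistence Cn` ∧ `∃ γ₁ > 0`, sizes and `HorizonFacts` ((2.6)–(2.9) ∧ (2.46)) along every run in `]0,γ]`, `γ ≤ min(γ₀,γ₁)`.
EVERY β-binder uninstantiated for Bałaban's objects. [cite: Balaban1987RG1, Thm 2 p.259 and Thm 3 p.264] [cite: Balaban1988Convergent, (2.5)–(2.9) pp.255–256 and (2.46) p.263] -/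
theorem wallEND_of_composedLegInterfacePow_identity_avg_remainderConst_smallCoupling {Cn : B12.Construction}
    (hgen : ForwardGenerated Cn β) (hhalt : HaltsOutside Cn β) (hcur : CurriesHBeta Cn β) (S : B12Beta.OneLoopSplit β)
    (hdeg : ∀ i ∈ s, (P i).a + (Q i).a = 6) {μ ν : Fin 4} (hμν : μ ≠ ν) {N : ℝ} (hN : N ≠ 0)
    (hval : ∀ x : E4, x ≠ 0 → x μ * x ν * contBubble s cc₀ P Q x = leadingIntegrand (kappaBal N) μ ν x)
    {Lc : ℕ} (hL : 2 ≤ Lc) {μC : ℕ → ℕ → ℝ}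
    {F' G' : κB → ι → ℕ → Pt → ℝ} {R Sg R' S' : ι → ℝ} {δ U cc : ℝ} {M : ℕ → ℕ}
    {Bset : ℕ → Finset κB} {wt : ℕ → κB → ℝ}
    (hwt0 : ∀ n : ℕ, 2 ≤ n → ∀ b ∈ Bset n, 0 ≤ wt n b) (hwt1 : ∀ n : ℕ, 2 ≤ n → ∑ b ∈ Bset n, wt n b = 1)
    (hR : ∀ i ∈ s, 0 ≤ R i) (hS : ∀ i ∈ s, 0 ≤ Sg i) (hR' : ∀ i ∈ s, 0 ≤ R' i) (hS' : ∀ i ∈ s, 0 ≤ S' i) (hδ : 0 < δ)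
    (hc : 1 ≤ cc) (hM : ∀ L : ℕ, 2 ≤ L → 1 ≤ M L ∧ (L : ℝ) ≤ cc * M L) (hML : ∀ L : ℕ, 2 ≤ L → M L ≤ L)
    (hF : ∀ m : ℕ, 1 ≤ m → ∀ b ∈ Bset (Lc ^ m), ∀ w ∈ annulus 4 0 (M (Lc ^ m)), ∀ i ∈ s,
      |F' b i (Lc ^ m) w - (P i).f (Lc ^ m) 0 w| ≤ R i / ((supNorm w : ℝ) ^ ((P i).a - 2) * ((Lc ^ m : ℕ) : ℝ) ^ 2))
    (hG : ∀ m : ℕ, 1 ≤ m → ∀ b ∈ Bset (Lc ^ m), ∀ w ∈ annulus 4 0 (M (Lc ^ m)), ∀ i ∈ s,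
      |G' b i (Lc ^ m) w - (Q i).f (Lc ^ m) 0 w| ≤ Sg i / ((supNorm w : ℝ) ^ ((Q i).a - 2) * ((Lc ^ m : ℕ) : ℝ) ^ 2))
    (hFtail : ∀ m : ℕ, 1 ≤ m → ∀ b ∈ Bset (Lc ^ m), ∀ r : ℕ, M (Lc ^ m) ≤ r → ∀ w ∈ annulus 4 r (r + 1), ∀ i ∈ s,
      |F' b i (Lc ^ m) w| ≤ R' i / ((r : ℝ) + 1) ^ (P i).a * Real.exp (-(δ / ((Lc ^ m : ℕ) : ℝ)) * ((r : ℝ) + 1)))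
    (hGtail : ∀ m : ℕ, 1 ≤ m → ∀ b ∈ Bset (Lc ^ m), ∀ r : ℕ, M (Lc ^ m) ≤ r → ∀ w ∈ annulus 4 r (r + 1), ∀ i ∈ s,
      |G' b i (Lc ^ m) w| ≤ S' i / ((r : ℝ) + 1) ^ (Q i).a)
    (hident : ∀ m : ℕ, 1 ≤ m → ∃ R₀ : ℕ, M (Lc ^ m) ≤ R₀ ∧
      |composedCoeff μC m - ∑ b ∈ Bset (Lc ^ m), wt (Lc ^ m) b * ∑ w ∈ annulus 4 0 R₀, toReal w μ * toReal w ν *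
        ∑ i ∈ s, cc₀ i * (F' b i (Lc ^ m) w * G' b i (Lc ^ m) w)| ≤ U)
    (hid : IdentityForm μC S.β0)
    {rr γ₀ β' β₀ : ℝ} (hγ₀ : 0 < γ₀) (hrem : RemainderConst S γ₀ rr) (hr : rr < B12Normalization.stepBal N Lc)
    (hcont : BetaContH γ₀ β) (hup : BetaUpperH β' γ₀ β) (hβ' : 0 ≤ β') (hβ₀ : 0 < β₀) (hβ₀1 : β₀ ≤ 1)
    {L : ℕ} (hL2 : 2 ≤ L) (hLβ₀ : (L : ℝ) * β₀ ≤ 1) (p : ℕ) {A₀ : ℝ} (hA₀ : 0 ≤ A₀) {κ₀ : ℕ} (hκ : 6 ≤ κ₀) :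
    EndpointExistence Cn ∧ ∃ γ₁ : ℝ, 0 < γ₁ ∧
      ∀ γ : ℝ, 0 < γ → γ ≤ min γ₀ γ₁ → ∀ Pr : B12.RunParams, (Cn Pr).flow.InInterval γ Pr.K →
        ∃ Rj : ℕ → ℕ, (∀ j, B14.IsRj L p ((Cn Pr).flow.g j) (Rj j)) ∧
          HorizonFacts (Cn Pr).flow β' β₀ A₀ L p κ₀ Rj Pr.K :=
  (betaAvgAFH_of_composedLegInterfacePow_identity_avg_remainderConst S hdeg hμν hN hval hL hwt0 hwt1 hR hS hR' hS' hδ hc hM hML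
    hF hG hFtail hGtail hident hid hrem).endpoint_and_flowControl_smallCoupling (sub_pos.mpr hr) hgen hhalt hcur hγ₀ hβ' hβ₀ hβ₀1
    hL2 hLβ₀ p hA₀ hcont hup hκ

end WallAvgSmall

/-! ## 9. (v1.5) AT PRINT'S BLOCK SIZE: the typed smallness structure at `L = 13`, the `β₀ ≤ 1/L` DIVERGENCE, and the inhabited
witnesses at EVERY admissible `(L, β₀)`

[Balaban1987RG1] p. 251 prints *"L is an odd, positive integer > 11"* (typed `B12.lean` header; cell SMALLNESS §2: the census witness
uses `L = 13`), and [Balaban1989LargeFieldII] p. 389 works its exponent budget with the EXAMPLE `β₀ = 1/7` (typed `B16.budget_beta0_iff`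
/ `budget_beta0_le`, which also shows every `0 ≤ β₀ ≤ 1/7` passes that budget).  The typed smallness structure
`B14FlowStep.SmallnessFor γ β′ β₀ L p` (this lineage, gen 1) carries the γ-FREE sufficient form `L·β₀ ≤ 1` of (2.9)'s last member
(field `h29c`; the SHARP requirement is only `L·β₀·γ²β′ ≤ 1`, `B14FlowStep.third_member_29_sharp`, cell DIVERGENCE D-sb14.2).
THIS SECTION records, in the kernel: (a) the structure IS inhabited at print's `L = 13` with the census exponent `p = 23`, `β₀ = 1/13`,
`β′ = 1`, `γ = e^{−150}` (`smallnessFor_printL13`; `β′` and `p` are NOT printed values — `β′` is an unprinted constant, `p = p₀ = 23` is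
the cell's minimal census witness); (b) it is NOT inhabited at print's example pair `(L, β₀) = (13, 1/7)` (`not_smallnessFor_of_one_lt`,
`not_smallnessFor_13_7`) — so every kernel END statement built on `SmallnessFor` (this module, `FlowStepRuns` §11, `Beta.FlowConsumers`,
…) certifies `β₀ ≤ 1/L` where print allows `β₀ ≤ 1/2` ([Balaban1989LargeFieldI] (1.52) p. 187 «the usual restrictions on β₀, β, L₀ (i.e.,
β₀ ≤ 1/2, …)», typed `B15BasicStep.coeff152_lt_one`) at the expense of γ: a DIVERGENCE of convenience (D-sb14.2a), harmless for every
located consumer of MISSING-B14 §8 (each uses `(1+β₀)` as a bounded factor; p. 389's budget holds for all `β₀ ≤ 1/7`), NOT a finding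
about print; (c) the §6 inhabited witnesses, which used the cell numbers `L = p = 2`, hold at EVERY admissible `(L, β₀)` — `L ≥ 2`,
`0 < β₀ ≤ 1`, `Lβ₀ ≤ 1` —, every `p` and `κ₀ ≥ 6`, in the «∃ γ₁ > 0» shape of §8 (`Osc.inhabited_smallCoupling`), in particular at
print's `L = 13` (`Osc.inhabited_printL13`).  Elementary; nothing of the series asserted. -/

section PrintBlockSize

/-- **The typed smallness structure at print's block size `L = 13`**: `SmallnessFor (e^{−150}) 1 (1/13) 13 23` — `γ = e^{−150}`,
`β′ = 1` (placeholder for the unprinted upper bound), `β₀ = 1/13 = 1/L`, `L = 13` ([Balaban1987RG1] p. 251: `L` odd `> 11`), `p = 23`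
(the cell's census exponent witness, not printed).  Field by field: `log(γ²)⁻¹ = 300 ≥ 4·23 + 2` and `≥ 23/(1/13) = 299`;
`γ²β′ ≤ e^{−150} ≤ 1/151 ≤ (1/13)(2 + 1/13)`; `13·(1/13) ≤ 1`. [folklore] -/
theorem smallnessFor_printL13 : B14FlowStep.SmallnessFor (Real.exp (-150)) 1 (1 / 13) 13 23 := by
  have hpos : 0 < Real.exp (-150) := Real.exp_pos _
  have hγ : Real.exp (-150) < 1 := Real.exp_lt_one_iff.mpr (by norm_num)
  have hprod : Real.exp (-150) * Real.exp 150 = 1 := by rw [← Real.exp_add]; norm_num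
  have h150 : (151 : ℝ) ≤ Real.exp 150 := by linarith [Real.add_one_le_exp (150 : ℝ)]
  have h151 : Real.exp (-150) * 151 ≤ 1 := by
    calc Real.exp (-150) * 151 ≤ Real.exp (-150) * Real.exp 150 := mul_le_mul_of_nonneg_left h150 hpos.le
      _ = 1 := hprod
  have hsq : Real.exp (-150) ^ 2 ≤ Real.exp (-150) := by nlinarith
  have hlog : Real.log (Real.exp (-150) ^ 2)⁻¹ = 300 := by
    rw [Real.log_inv, Real.log_pow, Real.log_exp]; norm_num
  refine ⟨hpos, hγ, by norm_num, by norm_num, by norm_num, ?_, ?_, ?_, ?_, by norm_num, by norm_num⟩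
  · nlinarith
  · nlinarith
  · rw [hlog]; norm_num
  · rw [hlog]; norm_num

/-- **The `β₀ ≤ 1/L` divergence, negative half**: if `L·β₀ > 1` then `SmallnessFor γ β′ β₀ L p` fails (field `h29c`), whatever `γ`, `β′`,
`p`.  The SHARP (2.9c) requirement is only `L·β₀·γ²β′ ≤ 1` (`B14FlowStep.third_member_29_sharp`); the typed structure chose the
γ-free sufficient form. [folklore] -/
theorem not_smallnessFor_of_one_lt {γ β' β₀ : ℝ} {L p : ℕ} (h : 1 < (L : ℝ) * β₀) :
    ¬ B14FlowStep.SmallnessFor γ β' β₀ L p :=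
  fun S => absurd S.h29c (not_le.mpr h)

/-- **Print's example pair is not admitted by the typed structure**: `(L, β₀) = (13, 1/7)` ([Balaban1987RG1] p. 251 `L > 11` odd;
[Balaban1989LargeFieldII] p. 389's example `β₀ = 1/7`, typed `B16.budget_beta0_iff`) has `L·β₀ = 13/7 > 1`.  DIVERGENCE D-sb14.2a:
the kernel END statements certify `β₀ ≤ 1/13` at `L = 13` (print: «β₀ > 0 can be chosen arbitrarily small» — smaller `β₀` costs only γ,
`log γ⁻² ≥ p/β₀`). [folklore] -/
theorem not_smallnessFor_13_7 (γ β' : ℝ) (p : ℕ) : ¬ B14FlowStep.SmallnessFor γ β' (1 / 7) 13 p :=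
  not_smallnessFor_of_one_lt (by norm_num)

end PrintBlockSize

namespace Osc

/-- **(a6) THE SIGN-INDEFINITE CARRIER'S HONEST CONSTRUCTION AT EVERY ADMISSIBLE `(L, β₀)`, «∃ γ₁» SHAPE.**  For `s > 0`, `γ₀ > 0`,
any block size `L ≥ 2` and `0 < β₀ ≤ 1` with `Lβ₀ ≤ 1`, any exponent `p` and `κ₀ ≥ 6`: `EndpointExistence (modelOf (betaO s (2s)))`
AND there is `γ₁ > 0` such that along every run of that construction in `]0,γ]`, `γ ≤ min(γ₀,γ₁)`, sizes by (2.5) and `HorizonFacts`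
((2.6)–(2.9) with `β′ = 3s` ∧ (2.46)) hold — §8's `endpoint_and_flowControl_smallCoupling` on §5(b)'s carrier; no threshold
arithmetic, no cell numbers. [cite: Balaban1987RG1, Thm 2 p.259] [cite: Balaban1988Convergent, (2.5)–(2.9) pp.255–256 and (2.46) p.263] -/
theorem inhabited_smallCoupling {s : ℝ} (hs : 0 < s) {γ₀ : ℝ} (hγ₀ : 0 < γ₀) {β₀ : ℝ} (hβ₀ : 0 < β₀) (hβ₀1 : β₀ ≤ 1)
    {L : ℕ} (hL : 2 ≤ L) (hLβ₀ : (L : ℝ) * β₀ ≤ 1) (p : ℕ) {κ₀ : ℕ} (hκ : 6 ≤ κ₀) :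
    EndpointExistence (modelOf (betaO s (2 * s))) ∧ ∃ γ₁ : ℝ, 0 < γ₁ ∧
      ∀ γ : ℝ, 0 < γ → γ ≤ min γ₀ γ₁ → ∀ P : B12.RunParams, (modelOf (betaO s (2 * s)) P).flow.InInterval γ P.K →
        ∃ Rj : ℕ → ℕ, (∀ j, B14.IsRj L p ((modelOf (betaO s (2 * s)) P).flow.g j) (Rj j)) ∧
          HorizonFacts (modelOf (betaO s (2 * s)) P).flow (3 * s) β₀ 0 L p κ₀ Rj P.K := by
  have hc : (0 : ℝ) ≤ 2 * s := by linarith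
  obtain ⟨hcont, hup, -⟩ := cont_and_bounds hs.le hc γ₀
  have e : s + 2 * s = 3 * s := by ring
  rw [e] at hup
  exact (avgAFH s γ₀ hc).endpoint_and_flowControl_smallCoupling hs (modelOf_forwardGenerated _) (modelOf_haltsOutside _)
    (modelOf_curries _) hγ₀ (by linarith) hβ₀ hβ₀1 hL hLβ₀ p le_rfl hcont hup hκ

/-- **(a7) … IN PARTICULAR AT PRINT'S BLOCK SIZE**: `L = 13`, `β₀ = 1/13`, the census exponent `p = 23`, `κ₀ = 7`, any `s > 0`,
`γ₀ > 0`. [cite: Balaban1987RG1, Thm 2 p.259 and p.251] [cite: Balaban1988Convergent, (2.5)–(2.9) pp.255–256 and (2.46) p.263] -/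
theorem inhabited_printL13 {s : ℝ} (hs : 0 < s) {γ₀ : ℝ} (hγ₀ : 0 < γ₀) :
    EndpointExistence (modelOf (betaO s (2 * s))) ∧ ∃ γ₁ : ℝ, 0 < γ₁ ∧
      ∀ γ : ℝ, 0 < γ → γ ≤ min γ₀ γ₁ → ∀ P : B12.RunParams, (modelOf (betaO s (2 * s)) P).flow.InInterval γ P.K →
        ∃ Rj : ℕ → ℕ, (∀ j, B14.IsRj 13 23 ((modelOf (betaO s (2 * s)) P).flow.g j) (Rj j)) ∧
          HorizonFacts (modelOf (betaO s (2 * s)) P).flow (3 * s) (1 / 13) 0 13 23 7 Rj P.K :=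
  inhabited_smallCoupling hs hγ₀ (by norm_num) (by norm_num) (by norm_num) (by norm_num) 23 (by norm_num)

end Osc

/-! ## 10. (v1.6) EVERY `β₀ > 0` — the [III] list is MONOTONE in `β₀`; the END statements with `β₀ ≤ 1` and `L·β₀ ≤ 1` REMOVED;
print's example pair `(13, 1/7)` SERVED

[Balaban1988Convergent] p. 255, after (2.6): *"where n > m, and β₀ > 0 can be chosen arbitrarily small, if g is sufficiently small."*  In the
displays (2.6)–(2.9) the constant `β₀` enters ONLY through the factors `(1+β₀)` ((2.6) last member, (2.7) first member, (2.8) both members)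
and `(1 + g_n²β′(n−m))^{β₀}` ((2.7)/(2.8)/(2.9) second members; base `≥ 1` for `β′ ≥ 0`), all NONDECREASING in `β₀`, against nonnegative
quantities (couplings, polylogarithms `log g⁻² ≥ 0` for `g ≤ 1`, `ε_j ≥ 0` for `A₀ ≥ 0`, sizes `R_j`); (2.46) does not involve `β₀`.  Hence the
bundled [III] list `B14DeltaBeta.HorizonFacts F β′ β₀ A₀ L p κ R k` at `β₀` implies it at every `β₀′ ≥ β₀` along a flow with couplings in `]0,1]`
up to the horizon (`horizonFacts_mono_beta0`).  CONSEQUENCE: §8's END statement, run at the admissible value `β₀⋆ := min(β₀, 1/L)` (`0 < β₀⋆ ≤ 1/L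
≤ 1`), lifts to ANY `β₀ > 0` — the hypotheses `β₀ ≤ 1` and `L·β₀ ≤ 1` of `endpoint_and_flowControl_smallCoupling` /
`wallEND_…_avg_remainderConst_smallCoupling` / `Osc.inhabited_smallCoupling` DISAPPEAR (`BetaAvgAFH.endpoint_and_flowControl_anyBeta0`,
`wallEND_of_composedLegInterfacePow_identity_avg_remainderConst_anyBeta0`, `Osc.inhabited_anyBeta0`), and print's example pair `(L, β₀) = (13, 1/7)`,
which §9's `not_smallnessFor_13_7` excludes from the typed smallness STRUCTURE, is served by the END STATEMENT (`Osc.inhabited_print_13_7`).  So the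
`β₀ ≤ 1/L` divergence of convenience (cell DIVERGENCE D-sb14.2a) is confined to the intermediate device `B14FlowStep.SmallnessFor` and touches NO
END statement; the threshold `γ₁` still depends on `β₀` (through `β₀⋆`: `log γ₁⁻² ≥ p/β₀⋆`), as print says.  Elementary; bookkeeping over the
carrier; nothing of the series asserted. -/

/-! ### β₀-monotonicity of the printed members -/

section MonoBeta0

variable {g : ℕ → ℝ} {β' β₀ β₀' : ℝ} {K : ℕ}

/-- (2.6) is monotone in `β₀` along positive couplings: only the last member `g_m ≤ (1+β₀)g_n` carries `β₀`. [folklore] -/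
theorem flowIneq26_mono_beta0 (hle : β₀ ≤ β₀') (hpos : ∀ j, j ≤ K → 0 ≤ g j)
    (h : B14.FlowIneq26 g β' β₀ K) : B14.FlowIneq26 g β' β₀' K := by
  intro m n hmn hn
  obtain ⟨h1, h2⟩ := h m n hmn hn
  refine ⟨h1, h2.trans ?_⟩
  exact mul_le_mul_of_nonneg_right (by linarith) (hpos n hn)

/-- (2.7) is monotone in `β₀` along couplings in `]0,1]` with `β′ ≥ 0`: the factors `(1+β₀)` and `(1 + g_n²β′(n−m))^{β₀}` (base `≥ 1`)
are nondecreasing in `β₀`, the polylogarithms are `≥ 0`. [folklore] -/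
theorem flowIneq27_mono_beta0 {p : ℕ} (hle : β₀ ≤ β₀') (hβ' : 0 ≤ β')
    (hpos : ∀ j, j ≤ K → 0 < g j) (hle1 : ∀ j, j ≤ K → g j ≤ 1)
    (h : B14.FlowIneq27 g β' β₀ p K) : B14.FlowIneq27 g β' β₀' p K := by
  intro m n hmn hn
  obtain ⟨h1, h2⟩ := h m n hmn hn
  have hm : m ≤ K := (Nat.le_of_lt hmn).trans hn
  have hlog : ∀ j, j ≤ K → 0 ≤ Real.log ((g j) ^ 2)⁻¹ := fun j hj => by
    apply Real.log_nonneg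
    have hg2 : (g j) ^ 2 ≤ 1 := by
      have := hle1 j hj
      have := hpos j hj
      nlinarith
    exact one_le_inv_iff₀.mpr ⟨by have := hpos j hj; positivity, hg2⟩
  refine ⟨h1.trans ?_, h2.trans ?_⟩
  · exact mul_le_mul_of_nonneg_right (by linarith) (pow_nonneg (hlog m hm) p)
  · apply mul_le_mul_of_nonneg_right _ (pow_nonneg (hlog n hn) p)
    have hbase : 1 ≤ 1 + (g n) ^ 2 * β' * ((n : ℝ) - m) := by
      have hnm : (0 : ℝ) ≤ (n : ℝ) - m := by
        have : (m : ℝ) ≤ n := by exact_mod_cast (Nat.le_of_lt hmn)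
        linarith
      have : 0 ≤ (g n) ^ 2 * β' * ((n : ℝ) - m) := by positivity
      linarith
    exact Real.rpow_le_rpow_of_exponent_le hbase hle

/-- (2.8) (for `ε_j = g_j·A₀(log g_j⁻²)^p`, `A₀ ≥ 0`) is monotone in `β₀` along couplings in `]0,1]` with `β′ ≥ 0`. [folklore] -/
theorem flowIneq28_mono_beta0 (F : Flow) {A₀ : ℝ} {p : ℕ} (hle : β₀ ≤ β₀') (hβ₀ : 0 ≤ β₀) (hβ' : 0 ≤ β') (hA₀ : 0 ≤ A₀)
    (hpos : ∀ j, j ≤ K → 0 < F.g j) (hle1 : ∀ j, j ≤ K → F.g j ≤ 1)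
    (h : B14.FlowIneq28 (epsK A₀ p F) F.g β' β₀ K) : B14.FlowIneq28 (epsK A₀ p F) F.g β' β₀' K := by
  intro m n hmn hn
  obtain ⟨h1, h2⟩ := h m n hmn hn
  have hm : m ≤ K := (Nat.le_of_lt hmn).trans hn
  have heps : ∀ j, j ≤ K → 0 ≤ epsK A₀ p F j := fun j hj => by
    unfold epsK p0Profile
    have hlog : 0 ≤ Real.log ((F.g j) ^ 2)⁻¹ := by
      apply Real.log_nonneg
      have hg2 : (F.g j) ^ 2 ≤ 1 := by
        have := hle1 j hj
        have := hpos j hj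
        nlinarith
      exact one_le_inv_iff₀.mpr ⟨by have := hpos j hj; positivity, hg2⟩
    have := hpos j hj
    positivity
  have hnm : (0 : ℝ) ≤ (n : ℝ) - m := by
    have : (m : ℝ) ≤ n := by exact_mod_cast (Nat.le_of_lt hmn)
    linarith
  have hbase : 1 ≤ 1 + (F.g n) ^ 2 * β' * ((n : ℝ) - m) := by
    have : 0 ≤ (F.g n) ^ 2 * β' * ((n : ℝ) - m) := by positivity
    linarith
  refine ⟨h1.trans ?_, h2.trans ?_⟩
  · apply mul_le_mul_of_nonneg_right _ (heps m hm)
    exact mul_le_mul_of_nonneg_right (by linarith) (Real.sqrt_nonneg _)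
  · apply mul_le_mul_of_nonneg_right _ (heps n hn)
    have hr : (1 + (F.g n) ^ 2 * β' * ((n : ℝ) - m)) ^ β₀ ≤ (1 + (F.g n) ^ 2 * β' * ((n : ℝ) - m)) ^ β₀' :=
      Real.rpow_le_rpow_of_exponent_le hbase hle
    have hr0 : 0 ≤ (1 + (F.g n) ^ 2 * β' * ((n : ℝ) - m)) ^ β₀ :=
      Real.rpow_nonneg (by linarith) _
    calc (1 + β₀) * (1 + (F.g n) ^ 2 * β' * ((n : ℝ) - m)) ^ β₀
        ≤ (1 + β₀') * (1 + (F.g n) ^ 2 * β' * ((n : ℝ) - m)) ^ β₀ :=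
          mul_le_mul_of_nonneg_right (by linarith) hr0
      _ ≤ (1 + β₀') * (1 + (F.g n) ^ 2 * β' * ((n : ℝ) - m)) ^ β₀' :=
          mul_le_mul_of_nonneg_left hr (by linarith)

/-- (2.9) is monotone in `β₀` along any couplings with `β′ ≥ 0` (the base `1 + g_n²β′(n−m)` is `≥ 1`). [folklore] -/
theorem flowIneq29_mono_beta0 {R : ℕ → ℕ} {L : ℕ} (hle : β₀ ≤ β₀') (hβ' : 0 ≤ β')
    (h : B14FlowStep.FlowIneq29 R g L β' β₀ K) : B14FlowStep.FlowIneq29 R g L β' β₀' K := by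
  intro m n hmn hn
  obtain ⟨h1, h2⟩ := h m n hmn hn
  refine ⟨h1, h2.trans ?_⟩
  have hnm : (0 : ℝ) ≤ (n : ℝ) - m := by
    have : (m : ℝ) ≤ n := by exact_mod_cast (Nat.le_of_lt hmn)
    linarith
  have hbase : 1 ≤ 1 + (g n) ^ 2 * β' * ((n : ℝ) - m) := by
    have : 0 ≤ (g n) ^ 2 * β' * ((n : ℝ) - m) := by positivity
    linarith
  have hr := Real.rpow_le_rpow_of_exponent_le hbase hle
  have hL : (0 : ℝ) ≤ L := Nat.cast_nonneg L
  have hR : (0 : ℝ) ≤ R n := Nat.cast_nonneg (R n)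
  calc (L : ℝ) * (1 + (g n) ^ 2 * β' * ((n : ℝ) - m)) ^ β₀ * R n
      ≤ (L : ℝ) * (1 + (g n) ^ 2 * β' * ((n : ℝ) - m)) ^ β₀' * R n := by gcongr

/-- **The [III] list `HorizonFacts` is MONOTONE in `β₀`** along a flow with couplings in `]0,1]` up to the horizon, for `β′ ≥ 0`,
`A₀ ≥ 0`, `0 ≤ β₀ ≤ β₀′`: every member of (2.6)–(2.9) carries `β₀` only through the nondecreasing factors `(1+β₀)` and
`(1 + g_n²β′(n−m))^{β₀}`; (2.46) does not involve `β₀`.  So the flow facts for a SMALL `β₀` imply them for every larger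
one — print's «β₀ > 0 can be chosen arbitrarily small» read as a family of statements, strongest at small `β₀`. [cite: Balaban1988Convergent, (2.6)–(2.9) pp.255–256] -/
theorem horizonFacts_mono_beta0 (F : Flow) {A₀ : ℝ} {L p κ : ℕ} {R : ℕ → ℕ} {k : ℕ}
    (hle : β₀ ≤ β₀') (hβ₀ : 0 ≤ β₀) (hβ' : 0 ≤ β') (hA₀ : 0 ≤ A₀)
    (hpos : ∀ j, j ≤ k → 0 < F.g j) (hle1 : ∀ j, j ≤ k → F.g j ≤ 1)
    (h : HorizonFacts F β' β₀ A₀ L p κ R k) : HorizonFacts F β' β₀' A₀ L p κ R k := by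
  obtain ⟨⟨h26, h27, h28, h29⟩, h246⟩ := h
  exact ⟨⟨flowIneq26_mono_beta0 hle (fun j hj => (hpos j hj).le) h26, flowIneq27_mono_beta0 hle hβ' hpos hle1 h27,
    flowIneq28_mono_beta0 F hle hβ₀ hβ' hA₀ hpos hle1 h28, flowIneq29_mono_beta0 hle hβ' h29⟩, h246⟩

end MonoBeta0

namespace BetaAvgAFH

variable {β : HBeta} {s D : ℝ}

/-- **THE END STATEMENT FOR EVERY `β₀ > 0`** (no `β₀ ≤ 1`, no `L·β₀ ≤ 1`).  From the carrier with `s > 0` on `]0,γ₀]`, (C), the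
printed-type upper bound with `β′ ≥ 0`, and the sign conditions `0 < β₀`, `L ≥ 2`, `κ₀ ≥ 6`, `A₀ ≥ 0`, any `p`:
`EndpointExistence C` ∧ `∃ γ₁ > 0`, sizes and `HorizonFacts … β′ β₀ …` along every run in `]0,γ]`, `γ ≤ min(γ₀,γ₁)`.  Proof: run
`endpoint_and_flowControl_smallCoupling` at `β₀⋆ := min(β₀, 1/L)` (admissible: `0 < β₀⋆ ≤ 1/L ≤ 1`) and lift the conclusion to `β₀` by
`horizonFacts_mono_beta0` (couplings `≤ γ ≤ 1/2 < 1` after shrinking the threshold to `min(γ₁, 1/2)`).  The typed structure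
`SmallnessFor`'s `β₀ ≤ 1/L` (DIVERGENCE D-sb14.2a) thereby disappears from the END statements: print's example pair `(L, β₀) = (13, 1/7)`
is served (`Osc.inhabited_print_13_7`). [cite: Balaban1987RG1, Thm 2 p.259 and Thm 3 p.264] [cite: Balaban1988Convergent, (2.5)–(2.9) pp.255–256 and (2.46) p.263] -/
theorem endpoint_and_flowControl_anyBeta0 {γ₀ β' β₀ : ℝ} (h : BetaAvgAFH s D γ₀ β) (hs : 0 < s) {C : B12.Construction}
    (hgen : ForwardGenerated C β) (hhalt : HaltsOutside C β) (hcur : CurriesHBeta C β) (hγ₀ : 0 < γ₀)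
    (hβ' : 0 ≤ β') (hβ₀ : 0 < β₀) {L : ℕ} (hL : 2 ≤ L) (p : ℕ)
    {A₀ : ℝ} (hA₀ : 0 ≤ A₀) (hcont : BetaContH γ₀ β) (hup : BetaUpperH β' γ₀ β) {κ₀ : ℕ} (hκ : 6 ≤ κ₀) :
    EndpointExistence C ∧ ∃ γ₁ : ℝ, 0 < γ₁ ∧
      ∀ γ : ℝ, 0 < γ → γ ≤ min γ₀ γ₁ → ∀ P : B12.RunParams, (C P).flow.InInterval γ P.K →
        ∃ Rj : ℕ → ℕ, (∀ j, B14.IsRj L p ((C P).flow.g j) (Rj j)) ∧ HorizonFacts (C P).flow β' β₀ A₀ L p κ₀ Rj P.K := by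
  have hL0 : (0 : ℝ) < L := by exact_mod_cast (lt_of_lt_of_le (by norm_num : 0 < 2) hL)
  have hL1 : (1 : ℝ) ≤ L := by exact_mod_cast (le_trans (by norm_num : 1 ≤ 2) hL)
  set β₀s : ℝ := min β₀ (1 / L) with hβ₀s
  have hβ₀s_pos : 0 < β₀s := lt_min hβ₀ (by positivity)
  have hβ₀s_le : β₀s ≤ β₀ := min_le_left _ _
  have hLβ₀s : (L : ℝ) * β₀s ≤ 1 := by
    calc (L : ℝ) * β₀s ≤ L * (1 / L) := mul_le_mul_of_nonneg_left (min_le_right _ _) hL0.le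
      _ = 1 := by field_simp
  have hβ₀s1 : β₀s ≤ 1 := by
    calc β₀s ≤ 1 / L := min_le_right _ _
      _ ≤ 1 := by rw [div_le_one hL0]; exact hL1
  obtain ⟨hE, γ₁, hγ₁, hF⟩ := h.endpoint_and_flowControl_smallCoupling hs hgen hhalt hcur hγ₀ hβ' hβ₀s_pos hβ₀s1 hL hLβ₀s p
    hA₀ hcont hup hκ
  refine ⟨hE, min γ₁ (1 / 2), lt_min hγ₁ (by norm_num), fun γ hγ hγle P hI => ?_⟩
  have hγle' : γ ≤ min γ₀ γ₁ :=
    le_min (hγle.trans (min_le_left _ _)) ((hγle.trans (min_le_right _ _)).trans (min_le_left _ _))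
  have hγhalf : γ ≤ 1 / 2 := (hγle.trans (min_le_right _ _)).trans (min_le_right _ _)
  obtain ⟨Rj, hRj, hHF⟩ := hF γ hγ hγle' P hI
  refine ⟨Rj, hRj, horizonFacts_mono_beta0 (C P).flow hβ₀s_le hβ₀s_pos.le hβ' hA₀ (fun j hj => (hI j hj).1)
    (fun j hj => (hI j hj).2.trans (by linarith)) hHF⟩

end BetaAvgAFH


section WallAvgAny

variable {β : HBeta} {ι : Type*} {s : Finset ι} {cc₀ : ι → ℝ} {P Q : ι → Leg} {κB : Type*}

/-- **THE (R13-3) AVERAGED WALL, END TO END, FOR EVERY `β₀ > 0`.**  As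
`wallEND_of_composedLegInterfacePow_identity_avg_remainderConst_smallCoupling` with the hypotheses `β₀ ≤ 1` and `L·β₀ ≤ 1` REMOVED
(`BetaAvgAFH.endpoint_and_flowControl_anyBeta0`): the averaged wall binders + `IdentityForm` + `RemainderConst S γ₀ rr` with
`rr < stepBal N Lc` STRICTLY + (C) + the printed-type upper bound `β′ ≥ 0` + the sign conditions `0 < β₀`, `L ≥ 2`, `κ₀ ≥ 6`, `A₀ ≥ 0`
⟹ `EndpointExistence Cn` ∧ `∃ γ₁ > 0`, sizes and `HorizonFacts` ((2.6)–(2.9) ∧ (2.46)) along every run in `]0,γ]`, `γ ≤ min(γ₀,γ₁)`.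
EVERY β-binder uninstantiated for Bałaban's objects. [cite: Balaban1987RG1, Thm 2 p.259 and Thm 3 p.264] [cite: Balaban1988Convergent, (2.5)–(2.9) pp.255–256 and (2.46) p.263] -/
theorem wallEND_of_composedLegInterfacePow_identity_avg_remainderConst_anyBeta0 {Cn : B12.Construction}
    (hgen : ForwardGenerated Cn β) (hhalt : HaltsOutside Cn β) (hcur : CurriesHBeta Cn β) (S : B12Beta.OneLoopSplit β)
    (hdeg : ∀ i ∈ s, (P i).a + (Q i).a = 6) {μ ν : Fin 4} (hμν : μ ≠ ν) {N : ℝ} (hN : N ≠ 0)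
    (hval : ∀ x : E4, x ≠ 0 → x μ * x ν * contBubble s cc₀ P Q x = leadingIntegrand (kappaBal N) μ ν x)
    {Lc : ℕ} (hL : 2 ≤ Lc) {μC : ℕ → ℕ → ℝ}
    {F' G' : κB → ι → ℕ → Pt → ℝ} {R Sg R' S' : ι → ℝ} {δ U cc : ℝ} {M : ℕ → ℕ}
    {Bset : ℕ → Finset κB} {wt : ℕ → κB → ℝ}
    (hwt0 : ∀ n : ℕ, 2 ≤ n → ∀ b ∈ Bset n, 0 ≤ wt n b) (hwt1 : ∀ n : ℕ, 2 ≤ n → ∑ b ∈ Bset n, wt n b = 1)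
    (hR : ∀ i ∈ s, 0 ≤ R i) (hS : ∀ i ∈ s, 0 ≤ Sg i) (hR' : ∀ i ∈ s, 0 ≤ R' i) (hS' : ∀ i ∈ s, 0 ≤ S' i) (hδ : 0 < δ)
    (hc : 1 ≤ cc) (hM : ∀ L : ℕ, 2 ≤ L → 1 ≤ M L ∧ (L : ℝ) ≤ cc * M L) (hML : ∀ L : ℕ, 2 ≤ L → M L ≤ L)
    (hF : ∀ m : ℕ, 1 ≤ m → ∀ b ∈ Bset (Lc ^ m), ∀ w ∈ annulus 4 0 (M (Lc ^ m)), ∀ i ∈ s,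
      |F' b i (Lc ^ m) w - (P i).f (Lc ^ m) 0 w| ≤ R i / ((supNorm w : ℝ) ^ ((P i).a - 2) * ((Lc ^ m : ℕ) : ℝ) ^ 2))
    (hG : ∀ m : ℕ, 1 ≤ m → ∀ b ∈ Bset (Lc ^ m), ∀ w ∈ annulus 4 0 (M (Lc ^ m)), ∀ i ∈ s,
      |G' b i (Lc ^ m) w - (Q i).f (Lc ^ m) 0 w| ≤ Sg i / ((supNorm w : ℝ) ^ ((Q i).a - 2) * ((Lc ^ m : ℕ) : ℝ) ^ 2))
    (hFtail : ∀ m : ℕ, 1 ≤ m → ∀ b ∈ Bset (Lc ^ m), ∀ r : ℕ, M (Lc ^ m) ≤ r → ∀ w ∈ annulus 4 r (r + 1), ∀ i ∈ s,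
      |F' b i (Lc ^ m) w| ≤ R' i / ((r : ℝ) + 1) ^ (P i).a * Real.exp (-(δ / ((Lc ^ m : ℕ) : ℝ)) * ((r : ℝ) + 1)))
    (hGtail : ∀ m : ℕ, 1 ≤ m → ∀ b ∈ Bset (Lc ^ m), ∀ r : ℕ, M (Lc ^ m) ≤ r → ∀ w ∈ annulus 4 r (r + 1), ∀ i ∈ s,
      |G' b i (Lc ^ m) w| ≤ S' i / ((r : ℝ) + 1) ^ (Q i).a)
    (hident : ∀ m : ℕ, 1 ≤ m → ∃ R₀ : ℕ, M (Lc ^ m) ≤ R₀ ∧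
      |composedCoeff μC m - ∑ b ∈ Bset (Lc ^ m), wt (Lc ^ m) b * ∑ w ∈ annulus 4 0 R₀, toReal w μ * toReal w ν *
        ∑ i ∈ s, cc₀ i * (F' b i (Lc ^ m) w * G' b i (Lc ^ m) w)| ≤ U)
    (hid : IdentityForm μC S.β0)
    {rr γ₀ β' β₀ : ℝ} (hγ₀ : 0 < γ₀) (hrem : RemainderConst S γ₀ rr) (hr : rr < B12Normalization.stepBal N Lc)
    (hcont : BetaContH γ₀ β) (hup : BetaUpperH β' γ₀ β) (hβ' : 0 ≤ β') (hβ₀ : 0 < β₀)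
    {L : ℕ} (hL2 : 2 ≤ L) (p : ℕ) {A₀ : ℝ} (hA₀ : 0 ≤ A₀) {κ₀ : ℕ} (hκ : 6 ≤ κ₀) :
    EndpointExistence Cn ∧ ∃ γ₁ : ℝ, 0 < γ₁ ∧
      ∀ γ : ℝ, 0 < γ → γ ≤ min γ₀ γ₁ → ∀ Pr : B12.RunParams, (Cn Pr).flow.InInterval γ Pr.K →
        ∃ Rj : ℕ → ℕ, (∀ j, B14.IsRj L p ((Cn Pr).flow.g j) (Rj j)) ∧
          HorizonFacts (Cn Pr).flow β' β₀ A₀ L p κ₀ Rj Pr.K :=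
  BetaAvgAFH.endpoint_and_flowControl_anyBeta0
    (betaAvgAFH_of_composedLegInterfacePow_identity_avg_remainderConst S hdeg hμν hN hval hL hwt0 hwt1 hR hS hR' hS' hδ hc hM hML
      hF hG hFtail hGtail hident hid hrem) (sub_pos.mpr hr) hgen hhalt hcur hγ₀ hβ' hβ₀ hL2 p hA₀ hcont hup hκ

end WallAvgAny


namespace Osc

/-- **(a8) THE SIGN-INDEFINITE CARRIER'S HONEST CONSTRUCTION AT EVERY `(L, β₀)` WITH `L ≥ 2`, `β₀ > 0`** — no `β₀ ≤ 1`, no `Lβ₀ ≤ 1`: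
`EndpointExistence (modelOf (betaO s (2s)))` ∧ `∃ γ₁ > 0`, sizes and `HorizonFacts` ((2.6)–(2.9) with `β′ = 3s` ∧ (2.46)) along every run
in `]0,γ]`, `γ ≤ min(γ₀,γ₁)` (`BetaAvgAFH.endpoint_and_flowControl_anyBeta0` on §5(b)'s carrier). [cite: Balaban1987RG1, Thm 2 p.259] [cite: Balaban1988Convergent, (2.5)–(2.9) pp.255–256 and (2.46) p.263] -/
theorem inhabited_anyBeta0 {s : ℝ} (hs : 0 < s) {γ₀ : ℝ} (hγ₀ : 0 < γ₀) {β₀ : ℝ} (hβ₀ : 0 < β₀)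
    {L : ℕ} (hL : 2 ≤ L) (p : ℕ) {κ₀ : ℕ} (hκ : 6 ≤ κ₀) :
    EndpointExistence (modelOf (betaO s (2 * s))) ∧ ∃ γ₁ : ℝ, 0 < γ₁ ∧
      ∀ γ : ℝ, 0 < γ → γ ≤ min γ₀ γ₁ → ∀ P : B12.RunParams, (modelOf (betaO s (2 * s)) P).flow.InInterval γ P.K →
        ∃ Rj : ℕ → ℕ, (∀ j, B14.IsRj L p ((modelOf (betaO s (2 * s)) P).flow.g j) (Rj j)) ∧
          HorizonFacts (modelOf (betaO s (2 * s)) P).flow (3 * s) β₀ 0 L p κ₀ Rj P.K := by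
  have hc : (0 : ℝ) ≤ 2 * s := by linarith
  obtain ⟨hcont, hup, -⟩ := cont_and_bounds hs.le hc γ₀
  have e : s + 2 * s = 3 * s := by ring
  rw [e] at hup
  exact (avgAFH s γ₀ hc).endpoint_and_flowControl_anyBeta0 hs (modelOf_forwardGenerated _) (modelOf_haltsOutside _)
    (modelOf_curries _) hγ₀ (by linarith) hβ₀ hL p le_rfl hcont hup hκ

/-- **(a9) … IN PARTICULAR AT PRINT'S EXAMPLE PAIR `(L, β₀) = (13, 1/7)`** ([Balaban1987RG1] p. 251 `L > 11` odd; [Balaban1989LargeFieldII]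
p. 389 «take β₀ = 1/7»), census exponent `p = 23`, `κ₀ = 7`, any `s > 0`, `γ₀ > 0` — the pair §9's `not_smallnessFor_13_7` excludes from the
typed smallness STRUCTURE is served by the END STATEMENT. [cite: Balaban1987RG1, Thm 2 p.259 and p.251] [cite: Balaban1989LargeFieldII, p.389] [cite: Balaban1988Convergent, (2.5)–(2.9) pp.255–256 and (2.46) p.263] -/
theorem inhabited_print_13_7 {s : ℝ} (hs : 0 < s) {γ₀ : ℝ} (hγ₀ : 0 < γ₀) :
    EndpointExistence (modelOf (betaO s (2 * s))) ∧ ∃ γ₁ : ℝ, 0 < γ₁ ∧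
      ∀ γ : ℝ, 0 < γ → γ ≤ min γ₀ γ₁ → ∀ P : B12.RunParams, (modelOf (betaO s (2 * s)) P).flow.InInterval γ P.K →
        ∃ Rj : ℕ → ℕ, (∀ j, B14.IsRj 13 23 ((modelOf (betaO s (2 * s)) P).flow.g j) (Rj j)) ∧
          HorizonFacts (modelOf (betaO s (2 * s)) P).flow (3 * s) (1 / 7) 0 13 23 7 Rj P.K :=
  inhabited_anyBeta0 hs hγ₀ (by norm_num) (by norm_num) 23 (by norm_num)

end Osc

/-! ## 11. (v1.7) ONE THRESHOLD FOR ALL PROFILES — «Similar inequalities hold for other constants» under a single «g sufficiently small»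

[Balaban1988Convergent] p. 256 [14], after (2.9), verbatim: *"Similar inequalities hold for other constants, which will be introduced later."*
The constants in question are profiles of the same shape `g·C(log g⁻²)^q` with different amplitudes and exponents: `ε_j = g_jA₀(log g_j⁻²)^{p₀}`
((2.4) p. 255), `α_{0,j} = g_jC₀(log g_j⁻²)^{q₀}`, `α_{1,j} = g_jC₁(log g_j⁻²)^{q₁}` ((2.28) p. 259, *"q₀, q₁ are integers greater than 1"*; typed
`B14.alphaJ`), and the radii `R_j` of (2.5) with exponent `r`.  The typed list `HorizonFacts F β′ β₀ A₀ L p κ R k` carries ONE exponent `p` and ONE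
amplitude `A₀`; the END statements of §8/§10 give a threshold `γ₁ = γ₁(p, …)` per exponent.  THIS SECTION: `B14FlowStep.SmallnessFor γ β′ β₀ L p` is
ANTITONE in `p` (`smallnessFor_of_exponent_le`) and does not involve `A₀`, so the threshold chosen for a MAXIMAL exponent `p` serves, along every
in-interval run below it, EVERY `p′ ≤ p` and EVERY `A₀ ≥ 0` AT ONCE (`BetaAvgAFH.endpoint_and_flowControl_allProfiles`, with §10's lifting to every
`β₀ > 0` built in; wall twin `wallEND_of_composedLegInterfacePow_identity_avg_remainderConst_allProfiles`; inhabited `Osc.inhabited_allProfiles`).  So the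
END statement has print's quantifier shape in all its constants: ∀ β₀ > 0, L ≥ 2, κ₀ ≥ 6, p ∃ γ₁ > 0 ∀ γ ≤ γ₁ ∀ runs ∀ p′ ≤ p ∀ A₀ ≥ 0.  LOCATED
ROAD-(2) CONSUMERS of exactly this mixed-exponent shape: the T⁴ cell's `T4ScalePairing.kappa_mul_R_le_p0Profile` (hypotheses `B14.FlowIneq27 g β′ β₀
p₀ K`, `∀ s ≤ K, B14.IsRj L r (g s) (R s)`, `r ≤ p₀`, `∀ s ≤ K, 1 ≤ log g_s⁻²`) and `T4UniformRadius.radius_profile_of_flowIneq29`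
(`B14FlowStep.FlowIneq29 R g L β′ β₀ K`) — served by the adapter `BetaAvgAFH.t4FlowInputs` (cell census MISSING-B14 §8 C19/C20).  Elementary;
bookkeeping over the carrier; nothing of the series or of the T⁴ records asserted. -/

/-- **`SmallnessFor` is ANTITONE in the exponent**: the two `p`-clauses `4p + 2 ≤ log γ⁻²` (`h27a`) and `p ≤ β₀ log γ⁻²` (`h27b`) weaken as `p`
decreases; every other field is `p`-free.  So ONE threshold chosen for the largest exponent serves every smaller one. [folklore] -/
theorem smallnessFor_of_exponent_le {γ β' β₀ : ℝ} {L p p' : ℕ} (S : B14FlowStep.SmallnessFor γ β' β₀ L p) (hp : p' ≤ p) :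
    B14FlowStep.SmallnessFor γ β' β₀ L p' := by
  have hp' : (p' : ℝ) ≤ p := by exact_mod_cast hp
  refine ⟨S.γ_pos, S.γ_lt_one, S.β'_nonneg, S.β₀_pos, S.β₀_le_one, S.h26c, S.h27c, ?_, ?_, S.hL, S.h29c⟩
  · linarith [S.h27a]
  · have := S.h27b
    have hβ₀ := S.β₀_pos
    nlinarith

namespace BetaAvgAFH

variable {β : HBeta} {s D : ℝ}

/-- **ONE THRESHOLD FOR ALL PROFILES.**  From the carrier with `s > 0` on `]0,γ₀]`, (C), the printed-type upper bound `β′ ≥ 0`, the sign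
conditions `0 < β₀`, `L ≥ 2`, `κ₀ ≥ 6`, and a MAXIMAL exponent `p`: `EndpointExistence C` ∧ `∃ γ₁ > 0` such that along every run in `]0,γ]`,
`γ ≤ min(γ₀,γ₁)`, FOR EVERY exponent `p′ ≤ p` AND EVERY amplitude `A₀ ≥ 0`: sizes by (2.5) with exponent `p′` and
`HorizonFacts … β′ β₀ A₀ L p′ κ₀` ((2.6), (2.7) with exponent `p′`, (2.8) for the profile `g·A₀(log g⁻²)^{p′}`, (2.9) for radii of exponent `p′`,
(2.46)).  Proof: `exists_threshold` at `(p, β₀⋆ := min(β₀, 1/L))`; `smallnessFor_of_exponent_le` + `smallnessFor_of_le` give the smallness at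
`(γ, p′)`; `flowControl_along'`; lift `β₀⋆ ↦ β₀` by §10's `horizonFacts_mono_beta0`.
[cite: Balaban1987RG1, Thm 2 p.259 and Thm 3 p.264] [cite: Balaban1988Convergent, (2.5)–(2.9) pp.255–256, (2.28) p.259, (2.46) p.263] -/
theorem endpoint_and_flowControl_allProfiles {γ₀ β' β₀ : ℝ} (h : BetaAvgAFH s D γ₀ β) (hs : 0 < s) {C : B12.Construction}
    (hgen : ForwardGenerated C β) (hhalt : HaltsOutside C β) (hcur : CurriesHBeta C β) (hγ₀ : 0 < γ₀)
    (hβ' : 0 ≤ β') (hβ₀ : 0 < β₀) {L : ℕ} (hL : 2 ≤ L) (p : ℕ)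
    (hcont : BetaContH γ₀ β) (hup : BetaUpperH β' γ₀ β) {κ₀ : ℕ} (hκ : 6 ≤ κ₀) :
    EndpointExistence C ∧ ∃ γ₁ : ℝ, 0 < γ₁ ∧
      ∀ γ : ℝ, 0 < γ → γ ≤ min γ₀ γ₁ → ∀ P : B12.RunParams, (C P).flow.InInterval γ P.K →
        ∀ p' : ℕ, p' ≤ p → ∀ A₀ : ℝ, 0 ≤ A₀ →
          ∃ Rj : ℕ → ℕ, (∀ j, B14.IsRj L p' ((C P).flow.g j) (Rj j)) ∧ HorizonFacts (C P).flow β' β₀ A₀ L p' κ₀ Rj P.K := by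
  have hL0 : (0 : ℝ) < L := by exact_mod_cast (lt_of_lt_of_le (by norm_num : 0 < 2) hL)
  have hL1 : (1 : ℝ) ≤ L := by exact_mod_cast (le_trans (by norm_num : 1 ≤ 2) hL)
  set β₀s : ℝ := min β₀ (1 / L) with hβ₀s
  have hβ₀s_pos : 0 < β₀s := lt_min hβ₀ (by positivity)
  have hβ₀s_le : β₀s ≤ β₀ := min_le_left _ _
  have hLβ₀s : (L : ℝ) * β₀s ≤ 1 := by
    calc (L : ℝ) * β₀s ≤ L * (1 / L) := mul_le_mul_of_nonneg_left (min_le_right _ _) hL0.le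
      _ = 1 := by field_simp
  have hβ₀s1 : β₀s ≤ 1 := by
    calc β₀s ≤ 1 / L := min_le_right _ _
      _ ≤ 1 := by rw [div_le_one hL0]; exact hL1
  have hD : 0 ≤ D := h.defect_nonneg hγ₀
  obtain ⟨γ₁, hγ₁, Sm, hDγ, hDγ', hsmall⟩ := exists_threshold p κ₀ hD hs hβ' hβ₀s_pos hβ₀s1 hL hLβ₀s
  refine ⟨h.endpointExistence hs.le hgen hγ₀ hβ' hcont hup, min γ₁ (1 / 2), lt_min hγ₁ (by norm_num),
    fun γ hγ hγle P hI p' hp' A₀ hA₀ => ?_⟩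
  have hγγ₀ : γ ≤ γ₀ := hγle.trans (min_le_left _ _)
  have hγγ₁ : γ ≤ γ₁ := (hγle.trans (min_le_right _ _)).trans (min_le_left _ _)
  have hγhalf : γ ≤ 1 / 2 := (hγle.trans (min_le_right _ _)).trans (min_le_right _ _)
  have Sm' : B14FlowStep.SmallnessFor γ β' β₀s L p' := smallnessFor_of_le (smallnessFor_of_exponent_le Sm hp') hγ hγγ₁
  obtain ⟨Rj, hRj, hHF⟩ := h.flowControl_along' hs hgen hhalt hcur Sm' hA₀ hγγ₀ hup (defect_of_le hD hγ.le hγγ₁ hDγ)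
    (defect_of_le hD hγ.le hγγ₁ hDγ') hκ (polySmall_of_le hs hγ.le hγγ₁ hsmall) P hI
  exact ⟨Rj, hRj, horizonFacts_mono_beta0 (C P).flow hβ₀s_le hβ₀s_pos.le hβ' hA₀ (fun j hj => (hI j hj).1)
    (fun j hj => (hI j hj).2.trans (by linarith)) hHF⟩

end BetaAvgAFH

/-- Along couplings `0 < g ≤ 1/2` the polylogarithm base is at least one: `1 ≤ log (g²)⁻¹` (indeed `≥ 2 log 2`) — the weak smallness
clause `hx1` of the T⁴ cell's `T4ScalePairing.kappa_mul_R_le_p0Profile`. [folklore] -/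
theorem one_le_log_inv_sq_of_le_half {g : ℝ} (hg : 0 < g) (hg2 : g ≤ 1 / 2) : 1 ≤ Real.log (g ^ 2)⁻¹ := by
  have hlog : Real.log (g ^ 2)⁻¹ = -2 * Real.log g := by
    rw [Real.log_inv, Real.log_pow]; push_cast; ring
  have h1 : Real.log g ≤ Real.log (1 / 2) := Real.log_le_log hg hg2
  have h2 : Real.log (1 / 2 : ℝ) = -Real.log 2 := by rw [one_div, Real.log_inv]
  rw [hlog]
  linarith [Real.log_two_gt_d9]

namespace BetaAvgAFH

variable {β : HBeta} {s D : ℝ}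

/-- **ROAD (2) ADAPTER — the T⁴ cell's FLOW-FACT hypothesis shapes, MIXED exponents, below ONE threshold.**  The T⁴ modules
`T4ScalePairing` (node U5c/NE7b: `kappa_mul_R_le_p0Profile` takes `B14.FlowIneq27 g β′ β₀ p₀ K`, `∀ s ≤ K, B14.IsRj L r (g s) (R s)` with
`r ≤ p₀`, and `∀ s ≤ K, 1 ≤ log g_s⁻²`) and `T4UniformRadius` (`radius_profile_of_flowIneq29` / `radius_pow_mul_geom_le_of_flowIneq29` take
`B14FlowStep.FlowIneq29 R g L β′ β₀ K`) consume (2.7) at the profile exponent `p₀` and the radii of (2.5)/(2.9) at ANOTHER exponent `r ≤ p₀`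
along the SAME tuned run (cell census MISSING-B14 §8 rows C19/C20).  From the carrier with `s > 0` (+ (C), printed-type upper bound, `0 < β₀`,
`L ≥ 2`): ONE `γ₁ > 0` below which every run in `]0,γ]` carries all four hypothesis shapes at once (`endpoint_and_flowControl_allProfiles` at
`p = p₀` with `p′ ∈ {p₀, r}`; the log-clause from `g_s ≤ γ ≤ 1/2`, `one_le_log_inv_sq_of_le_half`).  Nothing of the T⁴ records asserted; the
adapter only PRODUCES their binders. [cite: Balaban1988Convergent, (2.5)–(2.9) pp.255–256] -/
theorem t4FlowInputs {γ₀ β' β₀ : ℝ} (h : BetaAvgAFH s D γ₀ β) (hs : 0 < s) {C : B12.Construction}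
    (hgen : ForwardGenerated C β) (hhalt : HaltsOutside C β) (hcur : CurriesHBeta C β) (hγ₀ : 0 < γ₀)
    (hβ' : 0 ≤ β') (hβ₀ : 0 < β₀) {L : ℕ} (hL : 2 ≤ L) {p₀ r : ℕ} (hr : r ≤ p₀)
    (hcont : BetaContH γ₀ β) (hup : BetaUpperH β' γ₀ β) :
    ∃ γ₁ : ℝ, 0 < γ₁ ∧ ∀ γ : ℝ, 0 < γ → γ ≤ min γ₀ γ₁ → ∀ P : B12.RunParams, (C P).flow.InInterval γ P.K →
      B14.FlowIneq27 (C P).flow.g β' β₀ p₀ P.K ∧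
      (∀ j, j ≤ P.K → 1 ≤ Real.log (((C P).flow.g j) ^ 2)⁻¹) ∧
      ∃ Rj : ℕ → ℕ, (∀ j, B14.IsRj L r ((C P).flow.g j) (Rj j)) ∧ B14FlowStep.FlowIneq29 Rj (C P).flow.g L β' β₀ P.K := by
  obtain ⟨-, γ₁, hγ₁, hF⟩ := h.endpoint_and_flowControl_allProfiles hs hgen hhalt hcur hγ₀ hβ' hβ₀ hL p₀ hcont hup (le_refl 6)
  refine ⟨min γ₁ (1 / 2), lt_min hγ₁ (by norm_num), fun γ hγ hγle P hI => ?_⟩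
  have hγle' : γ ≤ min γ₀ γ₁ :=
    le_min (hγle.trans (min_le_left _ _)) ((hγle.trans (min_le_right _ _)).trans (min_le_left _ _))
  have hγhalf : γ ≤ 1 / 2 := (hγle.trans (min_le_right _ _)).trans (min_le_right _ _)
  obtain ⟨R₀, -, hHF₀⟩ := hF γ hγ hγle' P hI p₀ le_rfl 0 le_rfl
  obtain ⟨Rr, hRr, hHFr⟩ := hF γ hγ hγle' P hI r hr 0 le_rfl
  exact ⟨hHF₀.1.2.1, fun j hj => one_le_log_inv_sq_of_le_half (hI j hj).1 ((hI j hj).2.trans hγhalf), Rr, hRr, hHFr.1.2.2.2⟩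

end BetaAvgAFH

section WallAvgAll

variable {β : HBeta} {ι : Type*} {s : Finset ι} {cc₀ : ι → ℝ} {P Q : ι → Leg} {κB : Type*}

/-- **THE (R13-3) AVERAGED WALL, END TO END, ALL PROFILES UNDER ONE THRESHOLD.**  As
`wallEND_of_composedLegInterfacePow_identity_avg_remainderConst_anyBeta0` (§10) with the amplitude binder `A₀` moved INSIDE the conclusion and
the exponent conclusion strengthened to every `p′ ≤ p`: the averaged wall binders + `IdentityForm` + `RemainderConst S γ₀ rr` with `rr < stepBal N Lc`
STRICTLY + (C) + printed-type upper bound `β′ ≥ 0` + `0 < β₀`, `L ≥ 2`, `κ₀ ≥ 6` ⟹ `EndpointExistence Cn` ∧ `∃ γ₁ > 0`, along every run in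
`]0,γ]`, `γ ≤ min(γ₀,γ₁)`, for every `p′ ≤ p` and `A₀ ≥ 0`: sizes ∧ `HorizonFacts`.  EVERY β-binder uninstantiated for Bałaban's objects.
[cite: Balaban1987RG1, Thm 2 p.259 and Thm 3 p.264] [cite: Balaban1988Convergent, (2.5)–(2.9) pp.255–256, (2.28) p.259, (2.46) p.263] -/
theorem wallEND_of_composedLegInterfacePow_identity_avg_remainderConst_allProfiles {Cn : B12.Construction}
    (hgen : ForwardGenerated Cn β) (hhalt : HaltsOutside Cn β) (hcur : CurriesHBeta Cn β) (S : B12Beta.OneLoopSplit β)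
    (hdeg : ∀ i ∈ s, (P i).a + (Q i).a = 6) {μ ν : Fin 4} (hμν : μ ≠ ν) {N : ℝ} (hN : N ≠ 0)
    (hval : ∀ x : E4, x ≠ 0 → x μ * x ν * contBubble s cc₀ P Q x = leadingIntegrand (kappaBal N) μ ν x)
    {Lc : ℕ} (hL : 2 ≤ Lc) {μC : ℕ → ℕ → ℝ}
    {F' G' : κB → ι → ℕ → Pt → ℝ} {R Sg R' S' : ι → ℝ} {δ U cc : ℝ} {M : ℕ → ℕ}
    {Bset : ℕ → Finset κB} {wt : ℕ → κB → ℝ}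
    (hwt0 : ∀ n : ℕ, 2 ≤ n → ∀ b ∈ Bset n, 0 ≤ wt n b) (hwt1 : ∀ n : ℕ, 2 ≤ n → ∑ b ∈ Bset n, wt n b = 1)
    (hR : ∀ i ∈ s, 0 ≤ R i) (hS : ∀ i ∈ s, 0 ≤ Sg i) (hR' : ∀ i ∈ s, 0 ≤ R' i) (hS' : ∀ i ∈ s, 0 ≤ S' i) (hδ : 0 < δ)
    (hc : 1 ≤ cc) (hM : ∀ L : ℕ, 2 ≤ L → 1 ≤ M L ∧ (L : ℝ) ≤ cc * M L) (hML : ∀ L : ℕ, 2 ≤ L → M L ≤ L)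
    (hF : ∀ m : ℕ, 1 ≤ m → ∀ b ∈ Bset (Lc ^ m), ∀ w ∈ annulus 4 0 (M (Lc ^ m)), ∀ i ∈ s,
      |F' b i (Lc ^ m) w - (P i).f (Lc ^ m) 0 w| ≤ R i / ((supNorm w : ℝ) ^ ((P i).a - 2) * ((Lc ^ m : ℕ) : ℝ) ^ 2))
    (hG : ∀ m : ℕ, 1 ≤ m → ∀ b ∈ Bset (Lc ^ m), ∀ w ∈ annulus 4 0 (M (Lc ^ m)), ∀ i ∈ s,
      |G' b i (Lc ^ m) w - (Q i).f (Lc ^ m) 0 w| ≤ Sg i / ((supNorm w : ℝ) ^ ((Q i).a - 2) * ((Lc ^ m : ℕ) : ℝ) ^ 2))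
    (hFtail : ∀ m : ℕ, 1 ≤ m → ∀ b ∈ Bset (Lc ^ m), ∀ r : ℕ, M (Lc ^ m) ≤ r → ∀ w ∈ annulus 4 r (r + 1), ∀ i ∈ s,
      |F' b i (Lc ^ m) w| ≤ R' i / ((r : ℝ) + 1) ^ (P i).a * Real.exp (-(δ / ((Lc ^ m : ℕ) : ℝ)) * ((r : ℝ) + 1)))
    (hGtail : ∀ m : ℕ, 1 ≤ m → ∀ b ∈ Bset (Lc ^ m), ∀ r : ℕ, M (Lc ^ m) ≤ r → ∀ w ∈ annulus 4 r (r + 1), ∀ i ∈ s,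
      |G' b i (Lc ^ m) w| ≤ S' i / ((r : ℝ) + 1) ^ (Q i).a)
    (hident : ∀ m : ℕ, 1 ≤ m → ∃ R₀ : ℕ, M (Lc ^ m) ≤ R₀ ∧
      |composedCoeff μC m - ∑ b ∈ Bset (Lc ^ m), wt (Lc ^ m) b * ∑ w ∈ annulus 4 0 R₀, toReal w μ * toReal w ν *
        ∑ i ∈ s, cc₀ i * (F' b i (Lc ^ m) w * G' b i (Lc ^ m) w)| ≤ U)
    (hid : IdentityForm μC S.β0)
    {rr γ₀ β' β₀ : ℝ} (hγ₀ : 0 < γ₀) (hrem : RemainderConst S γ₀ rr) (hr : rr < B12Normalization.stepBal N Lc)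
    (hcont : BetaContH γ₀ β) (hup : BetaUpperH β' γ₀ β) (hβ' : 0 ≤ β') (hβ₀ : 0 < β₀)
    {L : ℕ} (hL2 : 2 ≤ L) (p : ℕ) {κ₀ : ℕ} (hκ : 6 ≤ κ₀) :
    EndpointExistence Cn ∧ ∃ γ₁ : ℝ, 0 < γ₁ ∧
      ∀ γ : ℝ, 0 < γ → γ ≤ min γ₀ γ₁ → ∀ Pr : B12.RunParams, (Cn Pr).flow.InInterval γ Pr.K →
        ∀ p' : ℕ, p' ≤ p → ∀ A₀ : ℝ, 0 ≤ A₀ →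
          ∃ Rj : ℕ → ℕ, (∀ j, B14.IsRj L p' ((Cn Pr).flow.g j) (Rj j)) ∧
            HorizonFacts (Cn Pr).flow β' β₀ A₀ L p' κ₀ Rj Pr.K :=
  BetaAvgAFH.endpoint_and_flowControl_allProfiles
    (betaAvgAFH_of_composedLegInterfacePow_identity_avg_remainderConst S hdeg hμν hN hval hL hwt0 hwt1 hR hS hR' hS' hδ hc hM hML
      hF hG hFtail hGtail hident hid hrem) (sub_pos.mpr hr) hgen hhalt hcur hγ₀ hβ' hβ₀ hL2 p hcont hup hκ

end WallAvgAll

namespace Osc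

/-- **(a10) THE SIGN-INDEFINITE CARRIER'S HONEST CONSTRUCTION, ALL PROFILES UNDER ONE THRESHOLD** (every `β₀ > 0`, `L ≥ 2`, `κ₀ ≥ 6`, maximal
exponent `p`): `EndpointExistence (modelOf (betaO s (2s)))` ∧ `∃ γ₁ > 0`, along every run in `]0,γ]`, `γ ≤ min(γ₀,γ₁)`, for every `p′ ≤ p` and every
`A₀ ≥ 0`: sizes with exponent `p′` ∧ `HorizonFacts … (3s) β₀ A₀ L p′ κ₀` (`BetaAvgAFH.endpoint_and_flowControl_allProfiles` on §5(b)'s carrier).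
[cite: Balaban1987RG1, Thm 2 p.259] [cite: Balaban1988Convergent, (2.5)–(2.9) pp.255–256, (2.28) p.259, (2.46) p.263] -/
theorem inhabited_allProfiles {s : ℝ} (hs : 0 < s) {γ₀ : ℝ} (hγ₀ : 0 < γ₀) {β₀ : ℝ} (hβ₀ : 0 < β₀)
    {L : ℕ} (hL : 2 ≤ L) (p : ℕ) {κ₀ : ℕ} (hκ : 6 ≤ κ₀) :
    EndpointExistence (modelOf (betaO s (2 * s))) ∧ ∃ γ₁ : ℝ, 0 < γ₁ ∧
      ∀ γ : ℝ, 0 < γ → γ ≤ min γ₀ γ₁ → ∀ P : B12.RunParams, (modelOf (betaO s (2 * s)) P).flow.InInterval γ P.K →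
        ∀ p' : ℕ, p' ≤ p → ∀ A₀ : ℝ, 0 ≤ A₀ →
          ∃ Rj : ℕ → ℕ, (∀ j, B14.IsRj L p' ((modelOf (betaO s (2 * s)) P).flow.g j) (Rj j)) ∧
            HorizonFacts (modelOf (betaO s (2 * s)) P).flow (3 * s) β₀ A₀ L p' κ₀ Rj P.K := by
  have hc : (0 : ℝ) ≤ 2 * s := by linarith
  obtain ⟨hcont, hup, -⟩ := cont_and_bounds hs.le hc γ₀
  have e : s + 2 * s = 3 * s := by ring
  rw [e] at hup
  exact (avgAFH s γ₀ hc).endpoint_and_flowControl_allProfiles hs (modelOf_forwardGenerated _) (modelOf_haltsOutside _)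
    (modelOf_curries _) hγ₀ (by linarith) hβ₀ hL p hcont hup hκ

end Osc

/-! ## 12. (v1.8) THE SAME AT THE BARE END GRADE (slope `s ≥ 0`): (2.6)–(2.9) for all profiles WITHOUT (2.46), and the road-(2) adapter there

The located consumers of the flow inequalities that do NOT involve (2.46) — MISSING-B14 §8 C1–C7, C11, C12, C15 ([III] §3, [IV] §1) and road (2)'s C19/C20
(`T4ScalePairing`, `T4UniformRadius`) — need no slope: v1 §3's `flowIneq_along` serves (2.6)–(2.9) from the carrier with `s ≥ 0`, i.e. (for `s = 0`) from
the Gloss-3 END grade `FlowStepRuns.BetaPartialSumsLowerH D γ₀ β` (§1 `zero_iff`).  THIS SECTION puts §10 (every `β₀ > 0`) and §11 (all profiles under one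
threshold) on top of it: `BetaAvgAFH.flowIneq_allProfiles` (no (2.46), no continuity hypothesis, `s ≥ 0`), `BetaAvgAFH.t4FlowInputs_of_nonneg` (§11's road-(2)
adapter at `s ≥ 0`), `BetaAvgAFH.t4FlowInputs_of_partialSums` (the END grade produces the T⁴ binders).  Census reading: C19/C20 are «slope ≥ 0» rows —
served by EVERY row of Table 9.1 (BETA-SPEC §5 / MISSING-B14 §9), the (A-ps) grade included; only C8/C13/C14/C16 need `s > 0`.  Elementary; bookkeeping over
the carrier; nothing of the series or of the T⁴ records asserted. -/

namespace BetaAvgAFH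

variable {β : HBeta} {s D : ℝ}

/-- **(2.6)–(2.9) FOR ALL PROFILES AT THE BARE END GRADE (slope `s ≥ 0`).**  From the carrier with `s ≥ 0` (equivalently, for `s = 0`, the
Gloss-3 END grade `BetaPartialSumsLowerH D γ₀ β`), (C)-free, the printed-type upper bound `β′ ≥ 0`, `0 < β₀`, `L ≥ 2` and a maximal exponent `p`:
`∃ γ₁ > 0` such that along every run in `]0,γ]`, `γ ≤ min(γ₀,γ₁)`, for every `p′ ≤ p` and `A₀ ≥ 0` there are sizes of exponent `p′` with
(2.6) ∧ (2.7)_{p′} ∧ (2.8)_{A₀,p′} ∧ (2.9) — NO (2.46) (that member needs `s > 0`: §5(a)).  Consumers C1–C7, C11, C12, C15 and road (2)'s C19/C20.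
[cite: Balaban1988Convergent, (2.5)–(2.9) pp.255–256] -/
theorem flowIneq_allProfiles {γ₀ β' β₀ : ℝ} (h : BetaAvgAFH s D γ₀ β) (hs : 0 ≤ s) {C : B12.Construction}
    (hgen : ForwardGenerated C β) (hhalt : HaltsOutside C β) (hcur : CurriesHBeta C β) (hγ₀ : 0 < γ₀)
    (hβ' : 0 ≤ β') (hβ₀ : 0 < β₀) {L : ℕ} (hL : 2 ≤ L) (p : ℕ) (hup : BetaUpperH β' γ₀ β) :
    ∃ γ₁ : ℝ, 0 < γ₁ ∧
      ∀ γ : ℝ, 0 < γ → γ ≤ min γ₀ γ₁ → ∀ P : B12.RunParams, (C P).flow.InInterval γ P.K →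
        ∀ p' : ℕ, p' ≤ p → ∀ A₀ : ℝ, 0 ≤ A₀ →
          ∃ Rj : ℕ → ℕ, (∀ j, B14.IsRj L p' ((C P).flow.g j) (Rj j)) ∧
            B14.FlowIneq26 (C P).flow.g β' β₀ P.K ∧ B14.FlowIneq27 (C P).flow.g β' β₀ p' P.K ∧
            B14.FlowIneq28 (epsK A₀ p' (C P).flow) (C P).flow.g β' β₀ P.K ∧
            B14FlowStep.FlowIneq29 Rj (C P).flow.g L β' β₀ P.K := by
  have hL0 : (0 : ℝ) < L := by exact_mod_cast (lt_of_lt_of_le (by norm_num : 0 < 2) hL)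
  have hL1 : (1 : ℝ) ≤ L := by exact_mod_cast (le_trans (by norm_num : 1 ≤ 2) hL)
  set β₀s : ℝ := min β₀ (1 / L) with hβ₀s
  have hβ₀s_pos : 0 < β₀s := lt_min hβ₀ (by positivity)
  have hβ₀s_le : β₀s ≤ β₀ := min_le_left _ _
  have hLβ₀s : (L : ℝ) * β₀s ≤ 1 := by
    calc (L : ℝ) * β₀s ≤ L * (1 / L) := mul_le_mul_of_nonneg_left (min_le_right _ _) hL0.le
      _ = 1 := by field_simp
  have hβ₀s1 : β₀s ≤ 1 := by
    calc β₀s ≤ 1 / L := min_le_right _ _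
      _ ≤ 1 := by rw [div_le_one hL0]; exact hL1
  have hD : 0 ≤ D := h.defect_nonneg hγ₀
  -- threshold at the dummy slope 1 (the (2.46)-clause of `exists_threshold` is not used)
  obtain ⟨γ₁, hγ₁, Sm, hDγ, -, -⟩ := exists_threshold p 6 hD one_pos hβ' hβ₀s_pos hβ₀s1 hL hLβ₀s
  refine ⟨min γ₁ (1 / 2), lt_min hγ₁ (by norm_num), fun γ hγ hγle P hI p' hp' A₀ hA₀ => ?_⟩
  have hγγ₀ : γ ≤ γ₀ := hγle.trans (min_le_left _ _)
  have hγγ₁ : γ ≤ γ₁ := (hγle.trans (min_le_right _ _)).trans (min_le_left _ _)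
  have hγhalf : γ ≤ 1 / 2 := (hγle.trans (min_le_right _ _)).trans (min_le_right _ _)
  have Sm' : B14FlowStep.SmallnessFor γ β' β₀s L p' := smallnessFor_of_le (smallnessFor_of_exponent_le Sm hp') hγ hγγ₁
  choose Rj hRj using fun j => B14FlowStep.isRj_exists Sm'.hL p' ((C P).flow.g j)
  obtain ⟨h26, h27, h28, h29⟩ := h.flowIneq_along hs hgen hhalt hcur Sm' hA₀ hγγ₀ hup (defect_of_le hD hγ.le hγγ₁ hDγ) P hI Rj
    fun j _ => hRj j
  have hpos : ∀ j, j ≤ P.K → 0 < (C P).flow.g j := fun j hj => (hI j hj).1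
  have hle1 : ∀ j, j ≤ P.K → (C P).flow.g j ≤ 1 := fun j hj => (hI j hj).2.trans (by linarith)
  exact ⟨Rj, hRj, flowIneq26_mono_beta0 hβ₀s_le (fun j hj => (hpos j hj).le) h26,
    flowIneq27_mono_beta0 hβ₀s_le hβ' hpos hle1 h27, flowIneq28_mono_beta0 (C P).flow hβ₀s_le hβ₀s_pos.le hβ' hA₀ hpos hle1 h28,
    flowIneq29_mono_beta0 hβ₀s_le hβ' h29⟩

/-- **ROAD (2) ADAPTER AT THE BARE END GRADE (slope `s ≥ 0`)**: the mixed-exponent flow-fact binders of `T4ScalePairing.kappa_mul_R_le_p0Profile`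
((2.7) at `p₀`, radii at `r ≤ p₀`, `1 ≤ log g_s⁻²`) and `T4UniformRadius.radius_profile_of_flowIneq29` ((2.9)) below ONE threshold, from the carrier with
`s ≥ 0` — so census rows C19/C20 are «slope ≥ 0» rows (served already by the Gloss-3 END grade `BetaPartialSumsLowerH`), like C1–C7; §11's
`t4FlowInputs` (`s > 0`) is the special case. [cite: Balaban1988Convergent, (2.5)–(2.9) pp.255–256] -/
theorem t4FlowInputs_of_nonneg {γ₀ β' β₀ : ℝ} (h : BetaAvgAFH s D γ₀ β) (hs : 0 ≤ s) {C : B12.Construction}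
    (hgen : ForwardGenerated C β) (hhalt : HaltsOutside C β) (hcur : CurriesHBeta C β) (hγ₀ : 0 < γ₀)
    (hβ' : 0 ≤ β') (hβ₀ : 0 < β₀) {L : ℕ} (hL : 2 ≤ L) {p₀ r : ℕ} (hr : r ≤ p₀) (hup : BetaUpperH β' γ₀ β) :
    ∃ γ₁ : ℝ, 0 < γ₁ ∧ ∀ γ : ℝ, 0 < γ → γ ≤ min γ₀ γ₁ → ∀ P : B12.RunParams, (C P).flow.InInterval γ P.K →
      B14.FlowIneq27 (C P).flow.g β' β₀ p₀ P.K ∧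
      (∀ j, j ≤ P.K → 1 ≤ Real.log (((C P).flow.g j) ^ 2)⁻¹) ∧
      ∃ Rj : ℕ → ℕ, (∀ j, B14.IsRj L r ((C P).flow.g j) (Rj j)) ∧ B14FlowStep.FlowIneq29 Rj (C P).flow.g L β' β₀ P.K := by
  obtain ⟨γ₁, hγ₁, hF⟩ := h.flowIneq_allProfiles hs hgen hhalt hcur hγ₀ hβ' hβ₀ hL p₀ hup
  refine ⟨min γ₁ (1 / 2), lt_min hγ₁ (by norm_num), fun γ hγ hγle P hI => ?_⟩
  have hγle' : γ ≤ min γ₀ γ₁ :=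
    le_min (hγle.trans (min_le_left _ _)) ((hγle.trans (min_le_right _ _)).trans (min_le_left _ _))
  have hγhalf : γ ≤ 1 / 2 := (hγle.trans (min_le_right _ _)).trans (min_le_right _ _)
  obtain ⟨R₀, -, -, h27, -, -⟩ := hF γ hγ hγle' P hI p₀ le_rfl 0 le_rfl
  obtain ⟨Rr, hRr, -, -, -, h29⟩ := hF γ hγ hγle' P hI r hr 0 le_rfl
  exact ⟨h27, fun j hj => one_le_log_inv_sq_of_le_half (hI j hj).1 ((hI j hj).2.trans hγhalf), Rr, hRr, h29⟩

/-- The Gloss-3 END grade itself (`FlowStepRuns.BetaPartialSumsLowerH M γ₀ β` = `BetaAvgAFH 0 M γ₀ β`, §1 `zero_iff`) serves the T⁴ flow-fact binders. [folklore] -/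
theorem t4FlowInputs_of_partialSums {γ₀ β' β₀ M : ℝ} (hps : BetaPartialSumsLowerH M γ₀ β) {C : B12.Construction}
    (hgen : ForwardGenerated C β) (hhalt : HaltsOutside C β) (hcur : CurriesHBeta C β) (hγ₀ : 0 < γ₀)
    (hβ' : 0 ≤ β') (hβ₀ : 0 < β₀) {L : ℕ} (hL : 2 ≤ L) {p₀ r : ℕ} (hr : r ≤ p₀) (hup : BetaUpperH β' γ₀ β) :
    ∃ γ₁ : ℝ, 0 < γ₁ ∧ ∀ γ : ℝ, 0 < γ → γ ≤ min γ₀ γ₁ → ∀ P : B12.RunParams, (C P).flow.InInterval γ P.K →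
      B14.FlowIneq27 (C P).flow.g β' β₀ p₀ P.K ∧
      (∀ j, j ≤ P.K → 1 ≤ Real.log (((C P).flow.g j) ^ 2)⁻¹) ∧
      ∃ Rj : ℕ → ℕ, (∀ j, B14.IsRj L r ((C P).flow.g j) (Rj j)) ∧ B14FlowStep.FlowIneq29 Rj (C P).flow.g L β' β₀ P.K :=
  t4FlowInputs_of_nonneg (s := 0) (D := M) (BetaAvgAFH.zero_iff.mpr hps) le_rfl hgen hhalt hcur hγ₀ hβ' hβ₀ hL hr hup

end BetaAvgAFH

/-! ## 13. (v1.8) THE ACCELERATION LANES ON THE [III] SIDE — what the asymptotic lane's `LimitForm` and the computer-assisted lane's finite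
list buy among the located consumers (lead's RULING (R15), BETA-SPEC v1.9zf §7.30; co-lead §5.19)

RULING (R15) (2026-08-19T06:10Z) adds two acceleration lanes to the β sub-cell: a COMPUTER-ASSISTED finite-k lane (cap1–3; export socket
`Beta.Certified.SmallKCert` = certified rational enclosures `3β⁰_∞/4 ≤ β⁰_{k+1}` for `k < k₁`, a COMPUTATIONAL LEAF at fixed parameters, relating to
Bałaban's `S.β0` only through the wall's (D1) normalisation content — (R15-1)/(R15-2)) and an ASYMPTOTIC large-k lane (asym1/asym2; sockets
`Assembly.LimitForm` — (AF-0∞) `β⁰_∞ > 0`, (AF-0r) `|β⁰_{k+1} − β⁰_∞| ≤ c₀θ^k`, (AF-1) `|β¹| ≤ C_r·g_k`, (C), the printed upper bound; every field a BINDER =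
the wall's (D1)+(D3) «in rate clothing» — and `Beta.RateCertificate`).  (R15-3): «their END-statement bookkeeping … is §5 = CO-LEAD».  THIS SECTION is
that bookkeeping in the kernel, BY NAME, with no new object: (a) a `LimitForm D` ALONE gives the carrier with slope `β⁰_∞/2` and defect
`(β⁰_∞/2 + max β′ c₀)·k₀` on `]0,γ₁]` (`betaAvgAFH_of_limitForm` = `betaAvgAFH_of_eventualForm D.toEventual`: Gloss 2), hence EVERY located consumer of
MISSING-B14 §8 — `limitForm_END_allProfiles` (EndpointExistence ∧ sizes ∧ the whole [III] list, all profile exponents `p′ ≤ p` and amplitudes, every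
`β₀ > 0`, below one threshold), `limitForm_t4FlowInputs` (the T⁴ cell's flow-fact binders, C19/C20) —; (b) the SAME `LimitForm` + the certified finite
list up to any `k₁` with `c₀θ^{k₁} ≤ β⁰_∞/4` gives the carrier with DEFECT ZERO (`betaAvgAFH_of_limitForm_list` = `betaAvgAFH_of_betaLowerH ∘
LimitForm.betaLowerH_of_list`: the (AF-0s) row of Table 9.1).  CENSUS READING (§5.19): on the consumer side the finite list buys EXACTLY the defect —
hence the LITERAL (0.31) anchors of the T⁴ rows C16/C18 (defect 0 in `CouplingMatchingCarrier.discrete031Defect_of_avgAFH` / `sum_weights_le_of_avgAFH`)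
and «Theorem 2 as printed» on the coarse lattices (`Assembly.LimitForm.thm2Printed_of_list`, `Certified.thm2Printed_of_cert`) — and NOTHING ELSE:
C1–C15, C19, C20 and the defected/halved forms of C16/C18 are served by (a) already (`PrefixAbsorption.eventualForm_not_thm2Printed` marks the literal
coarse-lattice (0.31) as the ONE statement that needs small-k information).  HONEST FRAMING: every `LimitForm` field and the list are HYPOTHESIS
BINDERS / a computational leaf; nothing of Bałaban's (1.22) is asserted; the wall is untouched; NOT summit progress. -/

section Lanes

variable {β : HBeta}

/-- **THE ASYMPTOTIC LANE'S SOCKET FEEDS THE CARRIER (Gloss 2).**  A `LimitForm D` (binders (AF-0∞), (AF-0r), (AF-1), (C), printed upper bound)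
gives `BetaAvgAFH (β⁰_∞/2) ((β⁰_∞/2 + max β′ c₀)·k₀) γ₁ β` on the explicit box `]0, D.γ₁]` with the least index `D.k₀` — by
`LimitForm.toEventual` and §2's `betaAvgAFH_of_eventualForm`.  Slope `> 0`: every «s > 0» row of the census is served. [cite: Balaban1987RG1, §1 p.264 and (2.12)–(2.14) p.268] -/
theorem betaAvgAFH_of_limitForm (D : Beta.Assembly.LimitForm β) :
    BetaAvgAFH (D.binf / 2) ((D.binf / 2 + max D.β' D.c₀) * D.k₀) D.γ₁ β :=
  betaAvgAFH_of_eventualForm D.toEventual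

/-- **… PLUS THE COMPUTER-ASSISTED LANE'S FINITE LIST: DEFECT ZERO.**  The same `LimitForm` + the certified list `3β⁰_∞/4 ≤ β⁰_{k+1}` for
`k < k₁` (the cap lane's `Certified.SmallKCert.hsmall`, a computational leaf) with the rate inequality `c₀θ^{k₁} ≤ β⁰_∞/4` at `k₁` (the asym lane's
index) gives the (AF-0s)-grade carrier `BetaAvgAFH (β⁰_∞/2) 0 γ₁ β` — `LimitForm.betaLowerH_of_list` + §2's `betaAvgAFH_of_betaLowerH`.  On the
consumer side the list buys exactly the DEFECT (0 instead of `(β⁰_∞/2 + max β′ c₀)·k₀`). [cite: Balaban1987RG1, Thm 2 p.259 and (2.12)–(2.14) p.268] -/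
theorem betaAvgAFH_of_limitForm_list (D : Beta.Assembly.LimitForm β) {k₁ : ℕ} (hk₁ : D.c₀ * D.θ ^ k₁ ≤ D.binf / 4)
    (hsmall : ∀ k, k < k₁ → 3 * D.binf / 4 ≤ D.S.β0 k) : BetaAvgAFH (D.binf / 2) 0 D.γ₁ β :=
  betaAvgAFH_of_betaLowerH (D.betaLowerH_of_list hk₁ hsmall)

/-- The minimal-index form: the list over `k < D.k₀` suffices. [folklore] -/
theorem betaAvgAFH_of_limitForm_smallList (D : Beta.Assembly.LimitForm β) (hsmall : ∀ k, k < D.k₀ → 3 * D.binf / 4 ≤ D.S.β0 k) :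
    BetaAvgAFH (D.binf / 2) 0 D.γ₁ β :=
  betaAvgAFH_of_betaLowerH (D.betaLowerH_of_smallList hsmall)

/-- **THE ASYMPTOTIC LANE ALONE SERVES EVERY LOCATED CONSUMER** — END statement, all profiles, every `β₀ > 0`, below ONE threshold: from a
`LimitForm D`, a forward-generated construction currying `β`, `0 < β₀`, `L ≥ 2`, `κ₀ ≥ 6` and a maximal exponent `p`:
`EndpointExistence C ∧ ∃ γ₂ > 0, ∀ γ ≤ min D.γ₁ γ₂, ∀ runs in ]0,γ], ∀ p′ ≤ p, ∀ A₀ ≥ 0: sizes ∧ HorizonFacts … (max β′ c₀) β₀ A₀ L p′ κ₀`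
(§11's `endpoint_and_flowControl_allProfiles` on `betaAvgAFH_of_limitForm`; NO finite list, NO small-k sign).
[cite: Balaban1987RG1, Thm 2 p.259 and Thm 3 p.264] [cite: Balaban1988Convergent, (2.5)–(2.9) pp.255–256 and (2.46) p.263] -/
theorem limitForm_END_allProfiles (D : Beta.Assembly.LimitForm β) {C : B12.Construction} (hgen : ForwardGenerated C β)
    (hhalt : HaltsOutside C β) (hcur : CurriesHBeta C β) {β₀ : ℝ} (hβ₀ : 0 < β₀) {L : ℕ} (hL : 2 ≤ L) (p : ℕ)
    {κ₀ : ℕ} (hκ : 6 ≤ κ₀) :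
    EndpointExistence C ∧ ∃ γ₂ : ℝ, 0 < γ₂ ∧
      ∀ γ : ℝ, 0 < γ → γ ≤ min D.γ₁ γ₂ → ∀ P : B12.RunParams, (C P).flow.InInterval γ P.K →
        ∀ p' : ℕ, p' ≤ p → ∀ A₀ : ℝ, 0 ≤ A₀ →
          ∃ Rj : ℕ → ℕ, (∀ j, B14.IsRj L p' ((C P).flow.g j) (Rj j)) ∧
            HorizonFacts (C P).flow (max D.β' D.c₀) β₀ A₀ L p' κ₀ Rj P.K :=
  (betaAvgAFH_of_limitForm D).endpoint_and_flowControl_allProfiles (half_pos D.binf_pos) hgen hhalt hcur D.γ₁_pos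
    (D.β'_pos.le.trans (le_max_left _ _)) hβ₀ hL p D.toEventual.cont D.toEventual.upper hκ

/-- **THE ASYMPTOTIC LANE ALONE SERVES THE T⁴ CELL's FLOW-FACT BINDERS** (census C19/C20; §12's slope-≥-0 adapter on `betaAvgAFH_of_limitForm`).
[cite: Balaban1988Convergent, (2.5)–(2.9) pp.255–256] -/
theorem limitForm_t4FlowInputs (D : Beta.Assembly.LimitForm β) {C : B12.Construction} (hgen : ForwardGenerated C β)
    (hhalt : HaltsOutside C β) (hcur : CurriesHBeta C β) {β₀ : ℝ} (hβ₀ : 0 < β₀) {L : ℕ} (hL : 2 ≤ L) {p₀ r : ℕ}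
    (hr : r ≤ p₀) :
    ∃ γ₂ : ℝ, 0 < γ₂ ∧ ∀ γ : ℝ, 0 < γ → γ ≤ min D.γ₁ γ₂ → ∀ P : B12.RunParams, (C P).flow.InInterval γ P.K →
      B14.FlowIneq27 (C P).flow.g (max D.β' D.c₀) β₀ p₀ P.K ∧
      (∀ j, j ≤ P.K → 1 ≤ Real.log (((C P).flow.g j) ^ 2)⁻¹) ∧
      ∃ Rj : ℕ → ℕ, (∀ j, B14.IsRj L r ((C P).flow.g j) (Rj j)) ∧
        B14FlowStep.FlowIneq29 Rj (C P).flow.g L (max D.β' D.c₀) β₀ P.K :=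
  (betaAvgAFH_of_limitForm D).t4FlowInputs_of_nonneg (half_pos D.binf_pos).le hgen hhalt hcur D.γ₁_pos
    (D.β'_pos.le.trans (le_max_left _ _)) hβ₀ hL hr D.toEventual.upper

/-- **THE LIST BUYS THE DEFECT, NOTHING ELSE (consumer side)**: with the finite list the END grade is `BetaPartialSumsLowerH 0 γ₁ β` — window
sums of the β's are NONNEGATIVE along every `]0,γ₁]`-history (§1 `zero_iff` on `betaAvgAFH_of_limitForm_list` weakened to slope 0) —, the
defect-free anchor through which `CouplingMatchingCarrier.discrete031Defect_of_avgAFH` returns the LITERAL (0.31) and `Assembly.LimitForm.thm2Printed_of_list`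
«Theorem 2 as printed»; without the list the same consumers hold with defect `(β⁰_∞/2 + max β′ c₀)·k₀` (`betaAvgAFH_of_limitForm`). [folklore] -/
theorem partialSums_zero_of_limitForm_list (D : Beta.Assembly.LimitForm β) {k₁ : ℕ} (hk₁ : D.c₀ * D.θ ^ k₁ ≤ D.binf / 4)
    (hsmall : ∀ k, k < k₁ → 3 * D.binf / 4 ≤ D.S.β0 k) : BetaPartialSumsLowerH 0 D.γ₁ β :=
  (betaAvgAFH_of_limitForm_list D hk₁ hsmall).partialSums (half_pos D.binf_pos).le

end Lanes

end

end Literature.MathematicalPhysics.QuantumFieldTheory.Balaban1983to89.Beta.AveragedAFCarrier
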